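import Mathlib.RingTheory.PowerSeries.Derivative
import Mathlib.RingTheory.PowerSeries.Inverse
import Mathlib.RingTheory.PowerSeries.Substitution
import Mathlib.Algebra.Algebra.Rat
import Mathlib.RingTheory.Localization.FractionRing
import Mathlib.Algebra.CharP.Algebra
import Mathlib.Algebra.MvPolynomial.CommRing
import Mathlib.RingTheory.MvPolynomial.Basic
import HarnessLib
import Literature.Computability.AlgebraicComplexity.OrbitClosureInheritance
import Literature.Computability.AlgebraicComplexity.HwvIdealRankBound
import Literature.Computability.AlgebraicComplexity.PowerSumLowDegreeIdeal
import Literature.Computability.AlgebraicComplexity.ChowVersusPowerSums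
import Literature.Computability.AlgebraicComplexity.TableauHighestWeight

/-!
# Dörfler–Ikenmeyer–Panova's multiplicity obstruction `(n²-2, n, 2)`: the discharge of
# `DIP2020_thm_2_3_1` by an explicit Brill-type highest weight vector

This file proves the tree's named fact `DIP2020_thm_2_3_1` (file `ChowVersusPowerSums`):
for `n ≥ 2`, `m ≥ n + 1` and `λ = (n²-2, n, 2) ⊢ (n+1)n`,

  `mult_{λ*} ℂ[GL_m · x₁⋯x_n]_{n+1} < mult_{λ*} ℂ[GL_m · (x₁ⁿ + ⋯ + x_{n+1}ⁿ)]_{n+1}`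

(`DIP2020_thm_2_3_1_holds`; Dörfler–Ikenmeyer–Panova 2020, Thm. 2.3 (1), the case `k = d = n+1`
of their Main Theorem, in the orbit-closure range `m ≥ n + 1` of the tree's statement).
[cite: DorflerIkenmeyerPanova2020, Thm. 2.3]

## The argument (not DIP's)

DIP compute both multiplicities (`§4–§6`: the coordinate ring of the orbit `GL · x₁⋯x_n` via
`S_n ≀`-invariants and an inequality of plethysm coefficients). We use instead the tree's
rank–nullity bound `orbitMultiplicity_lt_plethysmCoeff_of_mem_orbitVanishingIdeal`
(file `HwvIdealRankBound`): ONE nonzero highest weight vector of weight `λ*` in the degree-`(n+1)`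
part of the ideal of the orbit makes the multiplicity drop strictly below the plethysm
coefficient `a_λ(n+1, n)`, while on the power-sum side the multiplicity IS the plethysm
coefficient (`DIP2020_prop_3_3_holds`, file `PowerSumLowDegreeIdeal`). The vector is a Brill-type
equation (Brill, Gordan, Gelfand–Kapranov–Zelevinsky; Landsberg 2017 §9.6; the `(n²-2, n, 2)`
isotypic component of Brill's module is Guan's): in three variables `x ≻ y ≻ z` write a form of
degree `n` as `p = Q(x,y) + z R(x,y) + z² S(x,y) + O(z³)` and put

  `F_n(p) = Φ_n(Q; R² - 2 Q S)`,

where `Φ_n` is the residue functional `BrillResidue.phiDef` of Part I of this file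
(header below). Then (all statements below are theorems of this file):

* `F3_linSubst_upper` — `F_n(A · p) = A₂₂^{n²-2} A₁₁ⁿ A₀₀² F_n(p)` for every upper-triangular
  substitution `A` of `k[x,y,z]`: `A` factors as torus · `E₁₂` · `E₀₂` · `E₀₁`
  (`linSubst_eq_comp_of_upper`), the torus acts through `phiDef_scale` (`F3_diagSubst`), the root
  group `x ↦ x + t y` through the translation invariance `phiDef_twist` (`F3_elemSubst12`), and
  the root groups `x ↦ x + t z`, `y ↦ y + t z` change `R² - 2QS` by Wronskians, killed by
  `phiDef_wronskX/Y` (`F3_elemSubst02`, `F3_elemSubst01`); the one combinatorial input is the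
  coefficient formula `coeff_elemSubst` for `X_l ↦ X_l + t X_k` on monomials.
* `F3poly_mem_highestWeightSpace` — hence `F_n` of the universal form is a highest weight vector
  of `k[Sym^n k³]` of weight `chi3 n = (-2, -n, -(n²-2)) = λ*` (tree conventions:
  `coordRep`, `highestWeightSpace`, `MvPolynomial.funext` + `aeval_formCoeff_coordSubst`).
* `F3_prod_linForm3` — `F_n` vanishes on every product of `n` linear forms: multiplying by
  `ℓ = αx + βy + γz` changes the jets by `Q ↦ MQ`, `R ↦ MR + γQ`, `S ↦ MS + γR` (`M = α + βu`),
  so `R² - 2QS = Σ_i γ_i² Π_{j≠i} M_j²` on `Π ℓ_i` (`jets_prod_linForm3`) and `phiDef_sq_cofactor`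
  applies termwise.
* `F3poly_ne_zero` — `F_n(xⁿ - yⁿ + x^{n-2}z²) = Φ_n(xⁿ - yⁿ; -2(xⁿ - yⁿ)x^{n-2}) ≠ 0`
  (`phiDef_witness_ne_zero`).
* Transfer to `m` variables along the top embedding `Fin 3 ↪ Fin m` by the tree's inheritance
  lemmas (`rename_mem_highestWeightSpace_coordRep`, `aeval_formCoeff_rename_degIdxMap`,
  `killCompl`): the renamed vector is a highest weight vector of weight
  `Weight.dualOfPartition m (dipPartition n)` (`extend_chi3`) lying in
  `orbitVanishingIdeal (truncatedChowMonomial ℂ n m) n`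
  (`killCompl_linSubstRep_truncatedChowMonomial`), and the rank–nullity bound finishes.

No named facts are introduced; net debt `-1` (`DIP2020_thm_2_3_1`). The weaker reading
"`λ` is a vanishing ideal occurrence obstruction" follows
(`dip2020_isVanishingIdealOccurrenceObstructionAt_holds`).

## References

* J. Dörfler, C. Ikenmeyer, G. Panova, *On geometric complexity theory: multiplicity obstructions
  are stronger than occurrence obstructions*, SIAM J. Appl. Algebra Geom. 4 (2020) 354–376
  (= arXiv:1901.04576), Thm. 2.3 (1), Rem. 2.2, Prop. 3.3, §5.
  [cite: DorflerIkenmeyerPanova2020, Thm. 2.3]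
* J. M. Landsberg, *Geometry and complexity theory*, Cambridge 2017, §9.6 (Brill's equations,
  Thm. 9.6.2.1), §8.3.3 (inheritance). [cite: Landsberg2017, §9.6]
-/

/-!
# Part I. A Brill-type covariant of weight `(n²-2, n, 2)` as a residue at infinity — binary forms

Dörfler–Ikenmeyer–Panova prove that `λ = (n²-2, n, 2) ⊢ (n+1)n` is a multiplicity obstruction
separating the power-sum orbit closure from the Chow variety `Ch_n = GL · (x₁⋯x_n)` in degree
`n + 1`: `mult_λ ℂ[Ch_n]_{n+1} < mult_λ ℂ[Pow]_{n+1}` (the tree's named fact `DIP2020_thm_2_3_1`,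
file `ChowVersusPowerSums`). On the Chow side the drop below the plethysm coefficient comes from
highest weight vectors of weight `λ*` in the degree-`(n+1)` part of the ideal of `Ch_n`, i.e. from
Brill-type equations (Brill, Gordan, Gelfand–Kapranov–Zelevinsky, Briand; Landsberg 2017 §9.6,
Thm. 9.6.2.1; the `(n²-2, n, 2)`-isotypic equations are Guan's). With the tree's rank–nullity
bound `orbitMultiplicity_lt_plethysmCoeff_of_mem_orbitVanishingIdeal` (file `HwvIdealRankBound`)
and `DIP2020_prop_3_3_holds` (file `PowerSumLowDegreeIdeal`), discharging `DIP2020_thm_2_3_1`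
reduces to exhibiting ONE nonzero highest weight vector of weight `λ*` in
`ℂ[Sym^n ℂ^m]_{n+1} ∩ I(GL · x₁⋯x_n)`. This file constructs the binary-form functional `Φ_n` from
which that vector is built and proves, as theorems, every property of `Φ_n` the construction
needs (Part I); Part II (`BrillHWV`) carries out the ternary jet calculus and the final inequality.
[cite: DorflerIkenmeyerPanova2020, Thm. 2.3] [cite: Landsberg2017, §9.6]

## The functional `Φ_n`

Let `Q` be a binary form of degree `n` with coefficients `q_b` (of `x^{n-b} y^b`) and `G` a binary
form of degree `2n - 2` with coefficients `g_b`. In the chart `u = y/x` at `x = ∞` write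
`Q̃(u) = Q(1,u) = Σ q_b u^b` (`ser n q`), `G̃ = ser (2n-2) g`, and `𝒬̃(u) = Σ q_b u^b / (n+1-b)`
(`calSer n q`), the chart of the `x`-antiderivative `𝒬` of `Q` (`∂ₓ 𝒬 = Q`; Euler relation
`u 𝒬̃' = (n+1) 𝒬̃ - Q̃`, `X_mul_derivative_calSer`). Then

  `Φ_n(Q; G) = q₀ⁿ · coeff_{uⁿ} (𝒬̃ · G̃ · Q̃⁻²) = ± q₀ⁿ · Res_{x = ∞} (𝒬 G / Q²) dx`.

`phiDef n q g` is the manifestly polynomial form of this expression (degree `n - 1` in `q`, linear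
in `g`, rational coefficients), meaningful over any commutative `ℚ`-algebra; `phiDef_eq_coeff` is
the bridge to the residue form over a field when `q₀ ≠ 0`.

The highest weight vector of Part II is `F_n(p) = Φ_n(Q; R² - 2QS)`, where
`p = Q(x,y) + z R(x,y) + z² S(x,y) + O(z³)` is the 2-jet of a form `p` of degree `n` transversal
to the flag line (`x ≻ y ≻ z` the three largest variables), and `R² - 2QS = -[z²] p(z) p(-z)`.

## Main statements (all theorems; the file introduces no named facts)

* `phiDef_eq_coeff`, `phiDef_coeffFun_eq` — the bridge to the residue form (field, `q₀ ≠ 0`).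
* `phiDef_wronskX`, `phiDef_wronskY` — `Φ_n(Q; P ∂Q - ∂P Q) = 0` for `deg P = n - 1` and either
  partial derivative; the invariance of `F_n` under the root groups `x ↦ x + cz`, `y ↦ y + ez`
  reduces to these and to linearity.
* `phiDef_sq_cofactor` — `Φ_n(M N; N²) = 0` for `M` linear, `deg N = n - 1`; on a product of
  linear forms `ℓ_i = M_i(x,y) + γ_i z` one has `R² - 2QS = Σ_i γ_i² Π_{j ≠ i} M_j²`, so `F_n`
  vanishes on the orbit `GL · (x₁⋯x_n)`.
* `phiDef_twist` — invariance under `x ↦ x + b y` (`twist m b f` is the chart of `F(x + by, y)`,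
  `coeff_twist` its coefficients); `phiDef_scale` — torus covariance (factor `c₁^{n-1} c₂ rⁿ`);
  `phiDef_add_right`, `phiDef_const_mul_right` — linearity in `G`; `map_phiDef` — compatibility
  with ring homomorphisms.
* `phiDef_witness_ne_zero` — `Φ_n(xⁿ - yⁿ; -2 (xⁿ - yⁿ) x^{n-2}) = 2 - 2/(n+1) ≠ 0`: the value of
  `F_n` at `p = xⁿ - yⁿ + x^{n-2} z²` (`Q = xⁿ - yⁿ`, `R = 0`, `S = x^{n-2}`).

The vanishing and invariance statements are proved over a field of characteristic zero on the
open set `q₀ ≠ 0` by residue calculus in `K⟦u⟧` — `coeff_n (u · Y') = n · coeff_n Y`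
(`coeff_X_mul_derivative`), the Euler relation, and for the translation the Möbius substitution
`u ↦ u / (1 + b u)` (`coeff_lin_pow_mul_subst_moeb`) — and then transported to arbitrary
coefficients over any commutative `ℚ`-algebra through the generic point (`section Transport`:
indeterminate coefficients, the fraction field of `ℚ[X_•]`, injectivity of `algebraMap`, and
specialisation). All statements are elementary algebra ([folklore]); the references locate their
use.

## References

* J. Dörfler, C. Ikenmeyer, G. Panova, *On geometric complexity theory: multiplicity obstructions
  are stronger than occurrence obstructions*, SIAM J. Appl. Algebra Geom. 4 (2020), Thm. 2.3 (1),
  Rem. 2.2, Prop. 3.3, §5. [cite: DorflerIkenmeyerPanova2020, Thm. 2.3]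
* J. M. Landsberg, *Geometry and complexity theory* (2017), §9.6 (Brill's equations,
  Thm. 9.6.2.1; Guan's module structure). [cite: Landsberg2017, §9.6]
-/

noncomputable section

open scoped BigOperators

namespace Literature.Computability.AlgebraicComplexity

namespace BrillResidue

open PowerSeries

variable {A : Type*} [CommRing A]

/-- The `u`-chart series of a binary form of degree `m` with coefficient vector `q`
(`q b` = coefficient of `x^{m-b} y^b`): `Q̃(u) = Q(1,u) = Σ_{b ≤ m} q_b u^b`. [folklore] -/
def ser (m : ℕ) (q : ℕ → A) : A⟦X⟧ :=
  PowerSeries.mk fun b => if b ≤ m then q b else 0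

/-- Coefficients of `ser m q`: `q_b` for `b ≤ m`, zero beyond. [folklore] -/
@[simp] private theorem coeff_ser (m : ℕ) (q : ℕ → A) (b : ℕ) :
    coeff b (ser m q) = if b ≤ m then q b else 0 := by
  simp [ser, coeff_mk]

/-- The constant coefficient of `ser m q` is `q₀`. [folklore] -/
private theorem constantCoeff_ser (m : ℕ) (q : ℕ → A) : constantCoeff (ser m q) = q 0 := by
  rw [← coeff_zero_eq_constantCoeff_apply, coeff_ser, if_pos (Nat.zero_le _)]

variable [Algebra ℚ A]

/-- The `u`-chart series of the `x`-antiderivative of a binary form of degree `m`: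
`𝒬̃(u) = Σ_{b ≤ m} q_b u^b / (m+1-b)` (so that `u 𝒬̃' = (m+1) 𝒬̃ - Q̃`). [folklore] -/
def calSer (m : ℕ) (q : ℕ → A) : A⟦X⟧ :=
  PowerSeries.mk fun b => if b ≤ m then (((m + 1 - b : ℕ) : ℚ)⁻¹) • q b else 0

/-- Coefficients of `calSer m q`: `q_b / (m+1-b)` for `b ≤ m`, zero beyond. [folklore] -/
@[simp] private theorem coeff_calSer (m : ℕ) (q : ℕ → A) (b : ℕ) :
    coeff b (calSer m q) = if b ≤ m then (((m + 1 - b : ℕ) : ℚ)⁻¹) • q b else 0 := by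
  simp [calSer, coeff_mk]

omit [Algebra ℚ A] in
/-- `coeff n (X * f') = n * coeff n f`: the residue at infinity of an exact form vanishes,
coefficientwise. [folklore] -/
private theorem coeff_X_mul_derivative (f : A⟦X⟧) (n : ℕ) :
    coeff n (X * d⁄dX A f) = (n : A) * coeff n f := by
  cases n with
  | zero => simp
  | succ n =>
    rw [coeff_succ_X_mul, coeff_derivative]
    push_cast
    ring

/-- The Euler relation of the antiderivative in the `u`-chart:
`u · 𝒬̃' = (m+1) 𝒬̃ - Q̃`. [folklore] -/
private theorem X_mul_derivative_calSer (m : ℕ) (q : ℕ → A) :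
    X * d⁄dX A (calSer m q) = ((m : A) + 1) • calSer m q - ser m q := by
  ext b
  rw [coeff_X_mul_derivative, map_sub, coeff_smul, coeff_calSer, coeff_ser]
  split_ifs with hb
  · have hr : ((m + 1 - b : ℕ) : ℚ) ≠ 0 := by rw [Nat.cast_ne_zero]; omega
    rw [Algebra.smul_def, smul_eq_mul, ← mul_assoc, ← mul_assoc]
    have h1 : (b : A) = algebraMap ℚ A b := by simp
    have h2 : ((m : A) + 1) = algebraMap ℚ A (m + 1) := by simp
    rw [h1, h2, ← map_mul, ← map_mul,
      show algebraMap ℚ A (((m : ℚ) + 1) * (((m + 1 - b : ℕ) : ℚ))⁻¹) * q b - q b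
        = algebraMap ℚ A (((m : ℚ) + 1) * (((m + 1 - b : ℕ) : ℚ))⁻¹ - 1) * q b by
          rw [map_sub, map_one, sub_mul, one_mul]]
    congr 2
    rw [Nat.cast_sub (by omega)] at hr ⊢
    push_cast at hr ⊢
    field_simp
    ring
  · simp

omit [Algebra ℚ A] in
/-- A natural number cast into `A⟦X⟧` is the constant series `C m`. [folklore] -/
private theorem natCast_eq_C (m : ℕ) : ((m : A⟦X⟧)) = C (m : A) := (map_natCast C m).symm

/-- `u · 𝒬̃' = (m+1) 𝒬̃ - Q̃`, multiplicative form. [folklore] -/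
private theorem X_mul_derivative_calSer' (m : ℕ) (q : ℕ → A) :
    X * d⁄dX A (calSer m q) = ((m : A⟦X⟧) + 1) * calSer m q - ser m q := by
  rw [X_mul_derivative_calSer, smul_eq_C_mul, map_add, map_natCast, map_one]

/-! ## The explicit polynomial `Φ_n`

`phiDef n q g` is the manifestly polynomial form of `q₀ⁿ · coeff n (𝒬̃ G̃ Q̃⁻²)`: the geometric
expansion `Q̃⁻² = Σ_j (-1)^j (j+1) q₀^{-j-2} (Q̃ - q₀)^j` truncated at `j ≤ n`, multiplied by
`q₀^{n+2}`, with the only two terms carrying a negative power of `q₀` (`j = n-1, n`) replaced by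
their explicit sum (their `q₀⁻¹` parts cancel). Degree `n - 1` in `q`, linear in `g`; needs
`n ≥ 2`. -/

/-- The Brill-covariant residue functional `Φ_n(Q; G)` (up to the normalising integer `c_n`),
as an explicit polynomial in the coefficients `q` (binary form of degree `n`) and `g` (binary
form of degree `2n-2`). See `phiDef_eq_coeff` for its meaning. [folklore] -/
def phiDef (n : ℕ) (q g : ℕ → A) : A :=
  (∑ j ∈ Finset.range (n - 1), (-1 : A) ^ j * ((j : A) + 1) * q 0 ^ (n - 2 - j) *
      coeff n (calSer n q * ser (2 * n - 2) g * (ser n q - C (q 0)) ^ j))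
  + (-1 : A) ^ (n - 1) * (((n : ℚ) / ((n : ℚ) + 1)) •
      (q 1 ^ (n - 2) * (((n : A) - 1) * q 2 * g 0 + q 1 * g 1)))

section Map

variable {B : Type*} [CommRing B] [Algebra ℚ B]

omit [Algebra ℚ A] [Algebra ℚ B] in
/-- `ser` commutes with ring homomorphisms (coefficientwise). [folklore] -/
private theorem map_ser (φ : A →+* B) (m : ℕ) (q : ℕ → A) :
    PowerSeries.map φ (ser m q) = ser m (φ ∘ q) := by
  ext b
  rw [coeff_map, coeff_ser, coeff_ser]
  split_ifs <;> simp

/-- `calSer` commutes with ring homomorphisms of `ℚ`-algebras. [folklore] -/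
private theorem map_calSer (φ : A →+* B) (m : ℕ) (q : ℕ → A) :
    PowerSeries.map φ (calSer m q) = calSer m (φ ∘ q) := by
  ext b
  rw [coeff_map, coeff_calSer, coeff_calSer]
  split_ifs
  · exact map_rat_smul φ.toAddMonoidHom _ _
  · simp

/-- `phiDef` commutes with ring homomorphisms (it is a polynomial expression with rational
coefficients in `q` and `g`). [folklore] -/
private theorem map_phiDef (φ : A →+* B) (n : ℕ) (q g : ℕ → A) :
    φ (phiDef n q g) = phiDef n (φ ∘ q) (φ ∘ g) := by
  unfold phiDef
  have hsmul : ∀ (c : ℚ) (x : A), φ (c • x) = c • φ x := fun c x => map_rat_smul φ c x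
  rw [map_add, map_sum, map_mul, hsmul]
  simp only [map_mul, map_pow, map_neg, map_one, map_add, map_natCast, map_sub,
    Function.comp_apply]
  congr 1
  refine Finset.sum_congr rfl fun j _ => ?_
  rw [← coeff_map]
  simp only [_root_.map_mul (PowerSeries.map φ), _root_.map_pow (PowerSeries.map φ),
    _root_.map_sub (PowerSeries.map φ), map_calSer, map_ser, PowerSeries.map_C]

end Map

/-! ## Torus covariance: `Φ_n` is bihomogeneous and isobaric

`phiDef n` has degree `n - 1` in `q`, degree `1` in `g`, and total `u`-weight `n`: rescaling
`q_b ↦ c₁ r^b q_b`, `g_b ↦ c₂ r^b g_b` multiplies it by `c₁^{n-1} c₂ rⁿ`.  This is the action of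
the diagonal torus on the transversal jet (used for the weight computation of the highest weight
vector). -/

section Scale

omit [Algebra ℚ A] in
/-- Torus action on `ser`: `ser m (c r^b q_b) = C c · (ser m q)(r u)`. [folklore] -/
private theorem ser_scale (m : ℕ) (q : ℕ → A) (c r : A) :
    ser m (fun b => c * r ^ b * q b) = C c * rescale r (ser m q) := by
  ext b
  simp only [coeff_ser, coeff_C_mul, coeff_rescale]
  split_ifs <;> ring

/-- Torus action on `calSer`: `calSer m (c r^b q_b) = C c · (calSer m q)(r u)`. [folklore] -/
private theorem calSer_scale (m : ℕ) (q : ℕ → A) (c r : A) :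
    calSer m (fun b => c * r ^ b * q b) = C c * rescale r (calSer m q) := by
  ext b
  simp only [coeff_calSer, coeff_C_mul, coeff_rescale]
  split_ifs
  · simp only [Algebra.smul_def]; ring
  · ring

omit [Algebra ℚ A] in
/-- `rescale` fixes constant series. [folklore] -/
private theorem rescale_C' (r a : A) : rescale r (C a) = C a := by
  ext b
  rw [coeff_rescale, coeff_C]
  split_ifs with h
  · rw [h, pow_zero, one_mul]
  · rw [mul_zero]

/-- Torus covariance of `Φ_n`. [folklore] -/
private theorem phiDef_scale {n : ℕ} (hn : 2 ≤ n) (q g : ℕ → A) (c₁ c₂ r : A) :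
    phiDef n (fun b => c₁ * r ^ b * q b) (fun b => c₂ * r ^ b * g b)
      = c₁ ^ (n - 1) * c₂ * r ^ n * phiDef n q g := by
  obtain ⟨k, rfl⟩ := Nat.exists_eq_add_of_le hn
  have key : ∀ j : ℕ,
      coeff (2 + k) (calSer (2 + k) (fun b => c₁ * r ^ b * q b)
        * ser (2 * (2 + k) - 2) (fun b => c₂ * r ^ b * g b)
        * (ser (2 + k) (fun b => c₁ * r ^ b * q b) - C (c₁ * r ^ 0 * q 0)) ^ j)
      = c₁ ^ (j + 1) * c₂ * r ^ (2 + k)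
        * coeff (2 + k) (calSer (2 + k) q * ser (2 * (2 + k) - 2) g
            * (ser (2 + k) q - C (q 0)) ^ j) := by
    intro j
    rw [calSer_scale, ser_scale, ser_scale, pow_zero, mul_one,
      show (C (c₁ * q 0) : A⟦X⟧) = C c₁ * rescale r (C (q 0)) by rw [rescale_C', map_mul],
      ← mul_sub, ← map_sub, mul_pow,
      show C c₁ * rescale r (calSer (2 + k) q) * (C c₂ * rescale r (ser (2 * (2 + k) - 2) g))
          * (C c₁ ^ j * (rescale r (ser (2 + k) q - C (q 0))) ^ j)
        = C (c₁ ^ (j + 1) * c₂) * rescale r (calSer (2 + k) q * ser (2 * (2 + k) - 2) g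
            * (ser (2 + k) q - C (q 0)) ^ j) by
          simp only [map_mul, map_pow]; ring,
      coeff_C_mul, coeff_rescale]
    ring
  unfold phiDef
  beta_reduce
  simp only [key]
  rw [mul_add (c₁ ^ (2 + k - 1) * c₂ * r ^ (2 + k)), Finset.mul_sum]
  congr 1
  · refine Finset.sum_congr rfl fun j hj => ?_
    have hj' := Finset.mem_range.mp hj
    rw [pow_zero, mul_one, mul_pow,
      show 2 + k - 1 = (2 + k - 2 - j) + (j + 1) by omega, pow_add]
    ring
  · simp only [Algebra.smul_def, show 2 + k - 2 = k from by omega,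
      show 2 + k - 1 = k + 1 from by omega, pow_zero, pow_one, mul_one]
    ring

end Scale

/-! ## Linearity of `Φ_n` in `G` -/

section Linear

omit [Algebra ℚ A] in
/-- `ser m` is additive in the coefficient vector. [folklore] -/
private theorem ser_add (m : ℕ) (g₁ g₂ : ℕ → A) : ser m (g₁ + g₂) = ser m g₁ + ser m g₂ := by
  ext b
  simp only [coeff_ser, map_add, Pi.add_apply]
  split_ifs <;> simp

omit [Algebra ℚ A] in
/-- `ser m` is homogeneous: `ser m (c · g) = C c · ser m g`. [folklore] -/
private theorem ser_const_mul (m : ℕ) (c : A) (g : ℕ → A) :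
    ser m (fun b => c * g b) = C c * ser m g := by
  ext b
  simp only [coeff_ser, coeff_C_mul]
  split_ifs <;> simp

/-- `Φ_n(Q; G₁ + G₂) = Φ_n(Q; G₁) + Φ_n(Q; G₂)`. [folklore] -/
private theorem phiDef_add_right (n : ℕ) (q g₁ g₂ : ℕ → A) :
    phiDef n q (g₁ + g₂) = phiDef n q g₁ + phiDef n q g₂ := by
  unfold phiDef
  simp only [ser_add, Pi.add_apply, mul_add, add_mul, map_add, Finset.sum_add_distrib, smul_add]
  ring

/-- `Φ_n(Q; c G) = c Φ_n(Q; G)`. [folklore] -/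
private theorem phiDef_const_mul_right (n : ℕ) (q : ℕ → A) (c : A) (g : ℕ → A) :
    phiDef n q (fun b => c * g b) = c * phiDef n q g := by
  unfold phiDef
  simp only [ser_const_mul]
  have h : ∀ j : ℕ, coeff n (calSer n q * (C c * ser (2 * n - 2) g) * (ser n q - C (q 0)) ^ j)
      = c * coeff n (calSer n q * ser (2 * n - 2) g * (ser n q - C (q 0)) ^ j) := by
    intro j
    rw [show calSer n q * (C c * ser (2 * n - 2) g) * (ser n q - C (q 0)) ^ j
      = C c * (calSer n q * ser (2 * n - 2) g * (ser n q - C (q 0)) ^ j) by ring, coeff_C_mul]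
  rw [mul_add c, Finset.mul_sum]
  congr 1
  · refine Finset.sum_congr rfl fun j _ => ?_
    rw [h]
    ring
  · simp only [Algebra.smul_def]
    ring

end Linear

/-! ## Linear forms, `x`-derivatives and Wronskians in the `u`-chart (any commutative ring) -/

section Ops

variable {R S : Type*} [CommRing R] [CommRing S]

/-- The `u`-chart of a linear form `α x + β y`: `α + β u`. [folklore] -/
def lin (α β : R) : R⟦X⟧ := C α + C β * X

/-- The constant coefficient of `lin α β = α + β u` is `α`. [folklore] -/
@[simp] private theorem constantCoeff_lin (α β : R) : constantCoeff (lin α β) = α := by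
  simp [lin]

/-- `(α + β u)' = β`. [folklore] -/
private theorem derivative_lin (α β : R) : d⁄dX R (lin α β) = C β := by
  simp [lin, Derivation.leibniz]

/-- Coefficients of `(α + β u) · N`: `coeff_{b+1} = α N_{b+1} + β N_b`. [folklore] -/
private theorem coeff_succ_lin_mul (α β : R) (N : R⟦X⟧) (b : ℕ) :
    coeff (b + 1) (lin α β * N) = α * coeff (b + 1) N + β * coeff b N := by
  simp only [lin, add_mul, map_add, coeff_C_mul, mul_assoc, coeff_succ_X_mul]

/-- The `x`-derivative of a form of degree `m` in the `u`-chart: `(∂ₓF)~ = m F̃ - u F̃'`.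
[folklore] -/
def Dser (m : ℕ) (F : R⟦X⟧) : R⟦X⟧ := (m : R⟦X⟧) * F - X * d⁄dX R F

/-- The `u`-chart of the `x`-Wronskian `P ∂ₓQ - ∂ₓP Q` of the binary forms `Q` (degree `n`,
coefficients `q`) and `P` (degree `n - 1`, coefficients `p`). [folklore] -/
def wronskXSer (n : ℕ) (q p : ℕ → R) : R⟦X⟧ :=
  ser (n - 1) p * Dser n (ser n q) - Dser (n - 1) (ser (n - 1) p) * ser n q

/-- The `u`-chart of the `y`-Wronskian `P ∂_yQ - ∂_yP Q` (`∂_y = d/du` in the chart). [folklore] -/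
def wronskYSer (n : ℕ) (q p : ℕ → R) : R⟦X⟧ :=
  ser (n - 1) p * d⁄dX R (ser n q) - d⁄dX R (ser (n - 1) p) * ser n q

/-- Truncating a series with no coefficients beyond degree `m` at `m` does nothing. [folklore] -/
private theorem ser_coeff_eq (m : ℕ) (W : R⟦X⟧) (hW : ∀ b, m < b → coeff b W = 0) :
    ser m (fun k => coeff k W) = W := by
  ext b
  rw [coeff_ser]
  split_ifs with h
  · rfl
  · exact (hW b (not_le.mp h)).symm

/-- `lin` commutes with ring homomorphisms. [folklore] -/
private theorem map_lin (φ : R →+* S) (α β : R) : map φ (lin α β) = lin (φ α) (φ β) := by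
  simp only [lin, map_add, map_mul, map_C, map_X]

/-- The formal derivative commutes with `PowerSeries.map`. [folklore] -/
private theorem map_derivative (φ : R →+* S) (F : R⟦X⟧) :
    map φ (d⁄dX R F) = d⁄dX S (map φ F) := by
  ext k
  simp only [coeff_map, coeff_derivative, map_mul, map_add, map_natCast, map_one]

/-- `Dser` commutes with `PowerSeries.map`. [folklore] -/
private theorem map_Dser (φ : R →+* S) (m : ℕ) (F : R⟦X⟧) :
    map φ (Dser m F) = Dser m (map φ F) := by
  simp only [Dser, map_sub, map_mul, map_natCast, map_X, map_derivative]

/-- `wronskXSer` commutes with ring homomorphisms. [folklore] -/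
private theorem map_wronskXSer (φ : R →+* S) (n : ℕ) (q p : ℕ → R) :
    map φ (wronskXSer n q p) = wronskXSer n (φ ∘ q) (φ ∘ p) := by
  simp only [wronskXSer, map_sub, map_mul, map_ser, map_Dser]

/-- `wronskYSer` commutes with ring homomorphisms. [folklore] -/
private theorem map_wronskYSer (φ : R →+* S) (n : ℕ) (q p : ℕ → R) :
    map φ (wronskYSer n q p) = wronskYSer n (φ ∘ q) (φ ∘ p) := by
  simp only [wronskYSer, map_sub, map_mul, map_ser, map_derivative]

end Ops

/-! ## Translations `x ↦ x + b y` in the `u`-chart (any commutative ring) -/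

section Twist

variable {R S : Type*} [CommRing R] [CommRing S]

/-- `ser m f` as a finite sum of monomials `Σ_{k ≤ m} f_k u^k`. [folklore] -/
private theorem ser_eq_sum (m : ℕ) (f : ℕ → R) :
    ser m f = ∑ k ∈ Finset.range (m + 1), C (f k) * X ^ k := by
  ext j
  rw [coeff_ser, map_sum]
  simp_rw [coeff_C_mul_X_pow]
  rw [Finset.sum_ite_eq]
  simp only [Finset.mem_range, Nat.lt_succ_iff]

/-- `(α + β u)^N` has no coefficients beyond degree `N`. [folklore] -/
private theorem coeff_lin_pow_eq_zero
    (α β : R) (N j : ℕ) (h : N < j) : coeff j (lin α β ^ N) = 0 := by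
  induction N generalizing j with
  | zero => rw [pow_zero, coeff_one, if_neg (by omega)]
  | succ N ih =>
    obtain ⟨j, rfl⟩ : ∃ j', j = j' + 1 := ⟨j - 1, by omega⟩
    rw [pow_succ', coeff_succ_lin_mul, ih _ (by omega), ih _ (by omega), mul_zero, mul_zero,
      add_zero]

/-- The `u`-chart series of `F(x + b y, y)` for a binary form `F` of degree `m` with
coefficient vector `f`: `Σ_{k ≤ m} f_k u^k (1 + b u)^{m-k}`. [folklore] -/
def twist (m : ℕ) (b : R) (f : ℕ → R) : R⟦X⟧ :=
  ∑ k ∈ Finset.range (m + 1), C (f k) * X ^ k * lin 1 b ^ (m - k)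

/-- `twist m b f` has no coefficients beyond degree `m`. [folklore] -/
private theorem coeff_twist_eq_zero (m : ℕ) (b : R) (f : ℕ → R) (j : ℕ) (hj : m < j) :
    coeff j (twist m b f) = 0 := by
  unfold twist
  rw [map_sum]
  refine Finset.sum_eq_zero fun k hk => ?_
  have hk' := Finset.mem_range.mp hk
  rw [mul_assoc, coeff_C_mul, coeff_X_pow_mul', if_pos (by omega),
    coeff_lin_pow_eq_zero _ _ _ _ (by omega), mul_zero]

/-- The constant coefficient of `twist m b f` is `f₀` (translation `x ↦ x + by` fixes the leading
`x`-coefficient). [folklore] -/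
private theorem constantCoeff_twist (m : ℕ) (b : R) (f : ℕ → R) :
    constantCoeff (twist m b f) = f 0 := by
  unfold twist
  rw [map_sum, Finset.sum_eq_single 0]
  · simp [constantCoeff_lin]
  · intro k _ hk0
    simp [zero_pow hk0]
  · intro h
    simp at h

/-- `twist` commutes with ring homomorphisms. [folklore] -/
private theorem map_twist (φ : R →+* S) (m : ℕ) (b : R) (f : ℕ → R) :
    map φ (twist m b f) = twist m (φ b) (φ ∘ f) := by
  simp only [twist, map_sum, _root_.map_mul, _root_.map_pow, map_C, map_X, map_lin,
    _root_.map_one, Function.comp_apply]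

/-- Binomial theorem in the chart: `coeff_i (1 + b u)^N = C(N,i) b^i`. [folklore] -/
private theorem coeff_lin_one_pow (b : R) (N i : ℕ) :
    coeff i (lin 1 b ^ N) = (N.choose i : R) * b ^ i := by
  induction N generalizing i with
  | zero =>
    rw [pow_zero, coeff_one]
    cases i with
    | zero => simp
    | succ i => simp
  | succ N ih =>
    cases i with
    | zero =>
      rw [coeff_zero_eq_constantCoeff_apply, map_pow, constantCoeff_lin, one_pow,
        Nat.choose_zero_right,
        Nat.cast_one, pow_zero, mul_one]
    | succ j =>
      rw [pow_succ', coeff_succ_lin_mul, ih, ih, Nat.choose_succ_succ', Nat.cast_add]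
      ring

/-- Coefficients of the twist: `coeff_j (twist m b f) = Σ_{l ≤ j} C(m-l, j-l) b^{j-l} f_l`
for `j ≤ m` (the coefficient of `x^{m-j} y^j` in `F(x + b y, y)`). [folklore] -/
private theorem coeff_twist (m : ℕ) (b : R) (f : ℕ → R) (j : ℕ) (hj : j ≤ m) :
    coeff j (twist m b f)
      = ∑ l ∈ Finset.range (j + 1), ((m - l).choose (j - l) : R) * b ^ (j - l) * f l := by
  unfold twist
  rw [map_sum, Finset.range_eq_Ico,
    ← Finset.sum_Ico_consecutive _ (show 0 ≤ j + 1 by omega) (show j + 1 ≤ m + 1 by omega),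
    Finset.sum_eq_zero (s := Finset.Ico (j + 1) (m + 1)) (fun l hl => by
      have hl' := (Finset.mem_Ico.mp hl).1
      rw [mul_assoc, coeff_C_mul, coeff_X_pow_mul', if_neg (by omega), mul_zero]), add_zero,
    ← Finset.range_eq_Ico]
  refine Finset.sum_congr rfl fun l hl => ?_
  have hl' : l ≤ j := Nat.lt_succ_iff.mp (Finset.mem_range.mp hl)
  rw [mul_assoc, coeff_C_mul, coeff_X_pow_mul', if_pos hl', coeff_lin_one_pow]
  ring

end Twist

/-! ## Residue calculus at infinity over a field

Over a field `K` of characteristic zero the `u`-chart series `Q̃` of a form with nonzero leading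
coefficient `q₀ = Q̃(0)` is invertible in `K⟦u⟧`, and `coeff n (𝒬̃ · G̃ · Q̃⁻²)` is (up to the
factor `q₀ⁿ`) the residue at `x = ∞` of `𝒬 G / Q² dx`. The three vanishing statements below are
the residue computations of AS-PRINTED-1 §28.4 (ii), (iii). -/

section Field

variable {K : Type*} [Field K] [CharZero K]

/-- **(iii) of §28.4: `Res_∞(𝒬/M²) = 0` on a product `Q = M · N` with `M` linear.**
If `Q̃ = M̃ Ñ` with `M̃ = α + β u`, `α ≠ 0`, and `Ñ` of degree `< n`, then
`coeff n (𝒬̃ · M̃⁻²) = 0` — because `α 𝒬̃ M̃⁻² = Ñ - n H + u H'` with `H = 𝒬̃ M̃⁻¹`.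
[folklore] -/
private theorem coeff_calSer_mul_inv_lin_sq {n : ℕ} (q : ℕ → K) {α β : K} (hα : α ≠ 0)
    (N : K⟦X⟧) (hN : ∀ b, n ≤ b → coeff b N = 0) (hQ : ser n q = lin α β * N) :
    coeff n (calSer n q * ((lin α β)⁻¹) ^ 2) = 0 := by
  set M := lin α β with hM
  have hM0 : constantCoeff M ≠ 0 := by rwa [hM, constantCoeff_lin]
  have hMinv : M * M⁻¹ = 1 := PowerSeries.mul_inv_cancel M hM0
  have hX := X_mul_derivative_calSer' (A := K) n q
  have hDM : d⁄dX K M⁻¹ = -M⁻¹ ^ 2 * C β := by rw [derivative_inv', hM, derivative_lin]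
  have hDH : d⁄dX K (calSer n q * M⁻¹) =
      calSer n q * d⁄dX K M⁻¹ + M⁻¹ * d⁄dX K (calSer n q) := by
    rw [Derivation.leibniz, smul_eq_mul, smul_eq_mul]
  have hlin : M = C α + C β * X := by rw [hM]; rfl
  -- the key identity `C α * (𝒬̃ M⁻²) = N - n H + X H'`, `H = 𝒬̃ M⁻¹`
  have hid : C α * (calSer n q * (M⁻¹) ^ 2) =
      N - (n : K⟦X⟧) * (calSer n q * M⁻¹) + X * d⁄dX K (calSer n q * M⁻¹) := by
    linear_combination (-M⁻¹) * hX + M⁻¹ * hQ + (N + calSer n q * M⁻¹) * hMinv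
      + (-(X * calSer n q)) * hDM + (-X) * hDH + (-(calSer n q * M⁻¹ ^ 2)) * hlin
  have hcoeff := congrArg (coeff n) hid
  rw [coeff_C_mul, map_add, map_sub, coeff_X_mul_derivative, natCast_eq_C, coeff_C_mul,
    hN n le_rfl, zero_sub, neg_add_cancel] at hcoeff
  exact (mul_eq_zero.mp hcoeff).resolve_left hα

/-- **(ii) of §28.4, `x`-version: `Res_∞(𝒬 · (P Qₓ - Pₓ Q)/Q²) = 0`.** For `P̃` of degree
`< n` and `q₀ ≠ 0`: `coeff n (𝒬̃ · (P̃ · Dₙ Q̃ - D_{n-1} P̃ · Q̃) · Q̃⁻²) = 0`. [folklore] -/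
private theorem coeff_calSer_mul_wronskX {n : ℕ} (hn : 1 ≤ n) (q : ℕ → K) (hq : q 0 ≠ 0)
    (P : K⟦X⟧) (hP : ∀ b, n ≤ b → coeff b P = 0) :
    coeff n (calSer n q * (P * Dser n (ser n q) - Dser (n - 1) P * ser n q) *
      ((ser n q)⁻¹) ^ 2) = 0 := by
  set Q := ser n q with hQ
  have hQ0 : constantCoeff Q ≠ 0 := by rwa [hQ, constantCoeff_ser]
  have hQinv : Q * Q⁻¹ = 1 := PowerSeries.mul_inv_cancel Q hQ0
  have hX := X_mul_derivative_calSer' (A := K) n q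
  rw [← hQ] at hX
  have hcast : ((n - 1 : ℕ) : K⟦X⟧) = (n : K⟦X⟧) - 1 := by
    rw [Nat.cast_sub hn, Nat.cast_one]
  have hDQ : d⁄dX K Q⁻¹ = -Q⁻¹ ^ 2 * d⁄dX K Q := derivative_inv' Q
  have hDL : d⁄dX K (P * Q⁻¹) = P * d⁄dX K Q⁻¹ + Q⁻¹ * d⁄dX K P := by
    rw [Derivation.leibniz, smul_eq_mul, smul_eq_mul]
  have hDcL : d⁄dX K (calSer n q * (P * Q⁻¹)) =
      calSer n q * d⁄dX K (P * Q⁻¹) + (P * Q⁻¹) * d⁄dX K (calSer n q) := by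
    rw [Derivation.leibniz, smul_eq_mul, smul_eq_mul]
  -- the key identity `𝒬̃ W Q⁻² = X (𝒬̃ L)' - n 𝒬̃ L + P`, `L = P Q⁻¹`
  have hid : calSer n q * (P * Dser n Q - Dser (n - 1) P * Q) * (Q⁻¹) ^ 2 =
      X * d⁄dX K (calSer n q * (P * Q⁻¹)) - (n : K⟦X⟧) * (calSer n q * (P * Q⁻¹)) + P := by
    simp only [Dser]
    rw [hcast, hDcL, hDL, hDQ]
    linear_combination (-(P * Q⁻¹)) * hX
      + (calSer n q * P * Q⁻¹ + X * calSer n q * d⁄dX K P * Q⁻¹ + P) * hQinv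
  have hcoeff := congrArg (coeff n) hid
  rw [map_add, map_sub, coeff_X_mul_derivative, natCast_eq_C, coeff_C_mul, hP n le_rfl]
    at hcoeff
  rw [hcoeff]; ring

/-- **(ii) of §28.4, `y`-version: `Res_∞(𝒬 · (P Q_y - P_y Q)/Q²) = 0`** (in the `u`-chart the
`y`-derivative is the `u`-derivative). [folklore] -/
private theorem coeff_calSer_mul_wronskY {n : ℕ} (q : ℕ → K) (hq : q 0 ≠ 0)
    (P : K⟦X⟧) (hP : ∀ b, n ≤ b → coeff b P = 0) :
    coeff n (calSer n q * (P * d⁄dX K (ser n q) - d⁄dX K P * ser n q) *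
      ((ser n q)⁻¹) ^ 2) = 0 := by
  set Q := ser n q with hQ
  have hQ0 : constantCoeff Q ≠ 0 := by rwa [hQ, constantCoeff_ser]
  have hQinv : Q * Q⁻¹ = 1 := PowerSeries.mul_inv_cancel Q hQ0
  have hX := X_mul_derivative_calSer' (A := K) n q
  rw [← hQ] at hX
  have hDQ : d⁄dX K Q⁻¹ = -Q⁻¹ ^ 2 * d⁄dX K Q := derivative_inv' Q
  have hDL : d⁄dX K (P * Q⁻¹) = P * d⁄dX K Q⁻¹ + Q⁻¹ * d⁄dX K P := by
    rw [Derivation.leibniz, smul_eq_mul, smul_eq_mul]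
  have hDcL : d⁄dX K (calSer n q * (P * Q⁻¹)) =
      calSer n q * d⁄dX K (P * Q⁻¹) + (P * Q⁻¹) * d⁄dX K (calSer n q) := by
    rw [Derivation.leibniz, smul_eq_mul, smul_eq_mul]
  -- `X · 𝒬̃ W_y Q⁻² = -X (𝒬̃ L)' + ((n+1) 𝒬̃ L - P)`, `L = P Q⁻¹`
  have hid : X * (calSer n q * (P * d⁄dX K Q - d⁄dX K P * Q) * (Q⁻¹) ^ 2) =
      - (X * d⁄dX K (calSer n q * (P * Q⁻¹)))
        + (((n : K⟦X⟧) + 1) * (calSer n q * (P * Q⁻¹)) - P) := by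
    rw [hDcL, hDL, hDQ]
    linear_combination (P * Q⁻¹) * hX
      + (-(X * calSer n q * d⁄dX K P * Q⁻¹) - P) * hQinv
  have hcoeff := congrArg (coeff (n + 1)) hid
  rw [coeff_succ_X_mul, map_add, map_neg, coeff_X_mul_derivative, map_sub,
    show ((n : K⟦X⟧) + 1) = C ((n : K) + 1) by rw [map_add, map_natCast, map_one],
    coeff_C_mul, hP (n + 1) (Nat.le_succ n)] at hcoeff
  rw [hcoeff]; push_cast; ring

/-! ### Coefficient bookkeeping for the geometric expansion of `Q̃⁻²` -/

omit [CharZero K] in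
/-- `coeff 0 (W^j) = (coeff 0 W)^j`. [folklore] -/
private theorem coeff_zero_pow (W : K⟦X⟧) (j : ℕ) : coeff 0 (W ^ j) = (coeff 0 W) ^ j := by
  rw [coeff_zero_eq_constantCoeff_apply, map_pow, ← coeff_zero_eq_constantCoeff_apply]

omit [CharZero K] in
/-- `coeff 1 (W^j) = j (coeff 0 W)^(j-1) coeff 1 W`. [folklore] -/
private theorem coeff_one_pow (W : K⟦X⟧) (j : ℕ) :
    coeff 1 (W ^ j) = (j : K) * (coeff 0 W) ^ (j - 1) * coeff 1 W := by
  induction j with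
  | zero => simp
  | succ j ih =>
    rw [pow_succ, coeff_mul, Finset.Nat.antidiagonal_succ, Finset.sum_cons,
      Finset.Nat.antidiagonal_zero, Finset.map_singleton, Finset.sum_singleton]
    simp only [Function.Embedding.coe_prodMap, Function.Embedding.coeFn_mk, Prod.map_apply,
      Nat.succ_eq_add_one, Function.Embedding.refl_apply, zero_add]
    rw [ih, coeff_zero_pow]
    rcases j with _ | j
    · simp
    · rw [show j + 1 + 1 - 1 = j + 1 from rfl, show j + 1 - 1 = j from rfl]
      push_cast
      ring

omit [CharZero K] in
/-- If `X^j ∣ Y` then `coeff j (F Y) = F₀ Y_j` and `coeff (j+1) (F Y) = F₀ Y_{j+1} + F₁ Y_j`.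
[folklore] -/
private theorem coeff_mul_of_X_pow_dvd (F Y : K⟦X⟧) (j : ℕ) (hY : (X : K⟦X⟧) ^ j ∣ Y) :
    coeff j (F * Y) = coeff 0 F * coeff j Y ∧
      coeff (j + 1) (F * Y) = coeff 0 F * coeff (j + 1) Y + coeff 1 F * coeff j Y := by
  obtain ⟨Z, rfl⟩ := hY
  have hZ0 : coeff j (X ^ j * Z) = coeff 0 Z := by
    rw [coeff_X_pow_mul', if_pos le_rfl, Nat.sub_self]
  have hZ1 : coeff (j + 1) (X ^ j * Z) = coeff 1 Z := by
    rw [coeff_X_pow_mul', if_pos (Nat.le_succ j), Nat.add_sub_cancel_left]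
  refine ⟨?_, ?_⟩
  · rw [← mul_assoc, mul_comm F, mul_assoc, coeff_X_pow_mul', if_pos le_rfl, Nat.sub_self,
      hZ0, coeff_mul]
    simp
  · rw [← mul_assoc, mul_comm F, mul_assoc, coeff_X_pow_mul', if_pos (Nat.le_succ j),
      Nat.add_sub_cancel_left, hZ0, hZ1, coeff_mul, Finset.Nat.antidiagonal_succ,
      Finset.sum_cons, Finset.Nat.antidiagonal_zero]
    simp

omit [CharZero K] in
/-- The truncated geometric series for `(1+t)⁻²`:
`(1+t)² Σ_{j ≤ n} (-1)^j (j+1) t^j = 1 + (-1)^n ((n+2) t^{n+1} + (n+1) t^{n+2})`. [folklore] -/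
private theorem geom_sq_identity (t : K⟦X⟧) (n : ℕ) :
    (1 + t) ^ 2 * ∑ j ∈ Finset.range (n + 1), (-1 : K⟦X⟧) ^ j * ((j : K⟦X⟧) + 1) * t ^ j =
      1 + (-1 : K⟦X⟧) ^ n * (((n : K⟦X⟧) + 2) * t ^ (n + 1) + ((n : K⟦X⟧) + 1) * t ^ (n + 2)) := by
  induction n with
  | zero => simp; ring
  | succ n ih =>
    rw [Finset.sum_range_succ, mul_add, ih]
    push_cast
    ring

/-! ### The bridge: `phiDef` is `q₀ⁿ · coeff n (𝒬̃ G̃ Q̃⁻²)` -/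

omit [CharZero K] in
/-- A rational scalar acts on a characteristic-zero field through the cast. [folklore] -/
private theorem ratCast_smul_eq (r : ℚ) (x : K) [CharZero K] : r • x = (r : K) * x := by
  rw [Rat.smul_def]

/-- Over a field, `coeff_b (calSer m q) = q_b / (m+1-b)` for `b ≤ m`. [folklore] -/
private theorem coeff_calSer_eq_div (m : ℕ) (q : ℕ → K) (b : ℕ) (hb : b ≤ m) :
    coeff b (calSer m q) = ((m + 1 - b : ℕ) : K)⁻¹ * q b := by
  rw [coeff_calSer, if_pos hb, Rat.smul_def]
  push_cast
  rfl

/-- **Meaning of `phiDef`.** Over a field of characteristic zero, for a form with `q₀ ≠ 0`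
(`n ≥ 2`): `phiDef n q g = q₀ⁿ · coeff n (𝒬̃ · G̃ · Q̃⁻²)` — `q₀ⁿ` times the residue at
`x = ∞` of `𝒬 G/Q² dx` in the affine chart `y = 1`. [folklore] -/
private theorem phiDef_eq_coeff {n : ℕ} (hn : 2 ≤ n) (q g : ℕ → K) (hq : q 0 ≠ 0) :
    phiDef n q g =
      q 0 ^ n * coeff n (calSer n q * ser (2 * n - 2) g * ((ser n q)⁻¹) ^ 2) := by
  obtain ⟨k, rfl⟩ : ∃ k, n = k + 2 := ⟨n - 2, by omega⟩
  set Q := ser (k + 2) q with hQdef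
  set F := calSer (k + 2) q * ser (2 * (k + 2) - 2) g with hF
  set V := Q - C (q 0) with hV
  have hQ0 : constantCoeff Q ≠ 0 := by rwa [hQdef, constantCoeff_ser]
  have hQinv : Q * Q⁻¹ = 1 := PowerSeries.mul_inv_cancel Q hQ0
  have hV0 : constantCoeff V = 0 := by
    rw [hV, map_sub, hQdef, constantCoeff_ser, constantCoeff_C, sub_self]
  have hXV : (X : K⟦X⟧) ∣ V := X_dvd_iff.mpr hV0
  obtain ⟨W, hW⟩ := hXV
  have hW0 : coeff 0 W = q 1 := by
    have h := congrArg (coeff 1) hW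
    rw [coeff_succ_X_mul, hV, map_sub, coeff_C, if_neg one_ne_zero, sub_zero, hQdef,
      coeff_ser, if_pos (by omega)] at h
    exact h.symm
  have hW1 : coeff 1 W = q 2 := by
    have h := congrArg (coeff 2) hW
    rw [coeff_succ_X_mul, hV, map_sub, coeff_C, if_neg (by norm_num), sub_zero, hQdef,
      coeff_ser, if_pos (by omega)] at h
    exact h.symm
  have hVpow : ∀ j, (X : K⟦X⟧) ^ j ∣ V ^ j := fun j => by
    rw [hW, mul_pow]; exact dvd_mul_right _ _
  have hcVj : ∀ j, coeff j (V ^ j) = q 1 ^ j := fun j => by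
    rw [hW, mul_pow, coeff_X_pow_mul', if_pos le_rfl, Nat.sub_self, coeff_zero_pow, hW0]
  have hcVj1 : ∀ j, coeff (j + 1) (V ^ j) = (j : K) * q 1 ^ (j - 1) * q 2 := fun j => by
    rw [hW, mul_pow, coeff_X_pow_mul', if_pos (Nat.le_succ j), Nat.add_sub_cancel_left,
      coeff_one_pow, hW0, hW1]
  -- coefficients of `F = 𝒬̃ G̃`
  have hF0 : coeff 0 F = ((k : K) + 3)⁻¹ * q 0 * g 0 := by
    rw [hF, coeff_mul, Finset.Nat.antidiagonal_zero, Finset.sum_singleton,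
      coeff_calSer_eq_div _ _ _ (Nat.zero_le _), coeff_ser, if_pos (Nat.zero_le _), Nat.sub_zero]
    push_cast; ring
  have hF1 : coeff 1 F = ((k : K) + 3)⁻¹ * q 0 * g 1 + ((k : K) + 2)⁻¹ * q 1 * g 0 := by
    rw [hF, coeff_mul, Finset.Nat.antidiagonal_succ, Finset.sum_cons,
      Finset.Nat.antidiagonal_zero]
    simp only [Finset.map_singleton, Finset.sum_singleton, Function.Embedding.coe_prodMap,
      Function.Embedding.coeFn_mk, Prod.map_apply, Function.Embedding.refl_apply]
    rw [coeff_calSer_eq_div _ _ _ (Nat.zero_le _), coeff_calSer_eq_div _ _ _ (by omega),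
      coeff_ser, coeff_ser, if_pos (by omega), if_pos (by omega), Nat.sub_zero,
      show k + 2 + 1 - (0 + 1) = k + 2 from rfl]
    push_cast; ring
  -- the two top terms of the geometric expansion
  have ha : coeff (k + 2) (F * V ^ (k + 2)) = coeff 0 F * q 1 ^ (k + 2) := by
    rw [(coeff_mul_of_X_pow_dvd F (V ^ (k + 2)) (k + 2) (hVpow _)).1, hcVj]
  have hb : coeff (k + 2) (F * V ^ (k + 1)) =
      coeff 0 F * (((k + 1 : ℕ) : K) * q 1 ^ k * q 2) + coeff 1 F * q 1 ^ (k + 1) := by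
    rw [(coeff_mul_of_X_pow_dvd F (V ^ (k + 1)) (k + 1) (hVpow _)).2, hcVj, hcVj1,
      Nat.add_sub_cancel]
  -- the truncated geometric series `S` and `X^{n+1} ∣ Q² S - 1`
  set S : K⟦X⟧ := ∑ j ∈ Finset.range (k + 3),
    (-1 : K⟦X⟧) ^ j * ((j : K⟦X⟧) + 1) * C ((q 0)⁻¹ ^ (j + 2)) * V ^ j with hS
  have hQS : (X : K⟦X⟧) ^ (k + 3) ∣ Q ^ 2 * S - 1 := by
    set t : K⟦X⟧ := C ((q 0)⁻¹) * V with ht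
    have hQt : Q = C (q 0) * (1 + t) := by
      rw [ht, mul_add, mul_one, ← mul_assoc, ← map_mul, mul_inv_cancel₀ hq, map_one, one_mul,
        hV, add_sub_cancel]
    have hSt : S = C ((q 0)⁻¹ ^ 2) *
        ∑ j ∈ Finset.range (k + 3), (-1 : K⟦X⟧) ^ j * ((j : K⟦X⟧) + 1) * t ^ j := by
      rw [hS, Finset.mul_sum]
      refine Finset.sum_congr rfl fun j _ => ?_
      rw [ht, mul_pow, ← map_pow, pow_add, map_mul]
      ring
    have hid : Q ^ 2 * S - 1 = (-1 : K⟦X⟧) ^ (k + 2) *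
        ((((k + 2 : ℕ) : K⟦X⟧) + 2) * t ^ (k + 2 + 1) +
          (((k + 2 : ℕ) : K⟦X⟧) + 1) * t ^ (k + 2 + 2)) := by
      rw [hQt, hSt, mul_pow, ← map_pow,
        show C (q 0 ^ 2) * (1 + t) ^ 2 * (C ((q 0)⁻¹ ^ 2) *
            ∑ j ∈ Finset.range (k + 3), (-1 : K⟦X⟧) ^ j * ((j : K⟦X⟧) + 1) * t ^ j)
          = (C (q 0 ^ 2) * C ((q 0)⁻¹ ^ 2)) *
            ((1 + t) ^ 2 * ∑ j ∈ Finset.range (k + 2 + 1),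
              (-1 : K⟦X⟧) ^ j * ((j : K⟦X⟧) + 1) * t ^ j) by ring,
        ← map_mul, ← mul_pow, mul_inv_cancel₀ hq, one_pow, map_one, one_mul, geom_sq_identity]
      push_cast
      ring
    rw [hid]
    have hXt : (X : K⟦X⟧) ∣ t := by rw [ht, hW]; exact Dvd.intro (C (q 0)⁻¹ * W) (by ring)
    have h1 : (X : K⟦X⟧) ^ (k + 3) ∣ t ^ (k + 2 + 1) := pow_dvd_pow_of_dvd hXt _
    have h2 : (X : K⟦X⟧) ^ (k + 3) ∣ t ^ (k + 2 + 2) := by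
      have h := pow_dvd_pow_of_dvd hXt (k + 3)
      rw [show k + 2 + 2 = (k + 3) + 1 by ring, pow_succ]
      exact h.mul_right t
    exact Dvd.dvd.mul_left (dvd_add (Dvd.dvd.mul_left h1 _) (Dvd.dvd.mul_left h2 _)) _
  -- `coeff n (F Q⁻²) = coeff n (F S)`
  have hY : coeff (k + 2) (F * (Q⁻¹) ^ 2) = coeff (k + 2) (F * S) := by
    obtain ⟨E, hE⟩ := hQS
    have hQQ : (Q⁻¹) ^ 2 * Q ^ 2 = 1 := by rw [← mul_pow, mul_comm, hQinv, one_pow]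
    have h1 : F * S = F * (Q⁻¹) ^ 2 + (X : K⟦X⟧) ^ (k + 3) * (F * (Q⁻¹) ^ 2 * E) := by
      have h2 : F * (Q⁻¹) ^ 2 * (Q ^ 2 * S - 1) = F * S - F * (Q⁻¹) ^ 2 := by
        rw [mul_sub, mul_one, ← mul_assoc, mul_assoc F, hQQ, mul_one]
      rw [hE] at h2
      linear_combination -h2
    rw [h1, map_add, coeff_X_pow_mul', if_neg (by omega), add_zero]
  -- expand `coeff n (F S)`
  have hFS : coeff (k + 2) (F * S) = ∑ j ∈ Finset.range (k + 3),
      (-1 : K) ^ j * ((j : K) + 1) * (q 0)⁻¹ ^ (j + 2) * coeff (k + 2) (F * V ^ j) := by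
    rw [hS, Finset.mul_sum, map_sum]
    refine Finset.sum_congr rfl fun j _ => ?_
    have hC : C ((-1 : K) ^ j * ((j : K) + 1) * (q 0)⁻¹ ^ (j + 2)) =
        (-1 : K⟦X⟧) ^ j * ((j : K⟦X⟧) + 1) * C ((q 0)⁻¹ ^ (j + 2)) := by
      simp only [map_mul, map_pow, map_neg, map_one, map_add, map_natCast]
    rw [← coeff_C_mul, hC]
    congr 1
    ring
  -- assemble: `q₀² · phiDef = q₀^{n+2} · coeff n (F Q⁻²)`
  have h3 : ((k : K) + 3) ≠ 0 := by exact_mod_cast Nat.succ_ne_zero (k + 2)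
  have h2 : ((k : K) + 2) ≠ 0 := by exact_mod_cast Nat.succ_ne_zero (k + 1)
  have h3' : ((k : K) + 2 + 1) ≠ 0 := by
    rw [show (k : K) + 2 + 1 = (k : K) + 3 by ring]; exact h3
  have key : q 0 ^ 2 * phiDef (k + 2) q g =
      q 0 ^ (k + 2 + 2) * coeff (k + 2) (F * (Q⁻¹) ^ 2) := by
    rw [hY, hFS, Finset.mul_sum, Finset.sum_range_succ, Finset.sum_range_succ, add_assoc,
      phiDef, show k + 2 - 1 = k + 1 from rfl, mul_add, Finset.mul_sum]
    simp only [← hQdef, ← hF, ← hV]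
    congr 1
    · refine Finset.sum_congr rfl fun j hj => ?_
      have hjk : j ≤ k := Nat.lt_succ_iff.mp (Finset.mem_range.mp hj)
      rw [show k + 2 - 2 - j = k - j by omega]
      have hpow : q 0 ^ (k + 2 + 2) * (q 0)⁻¹ ^ (j + 2) = q 0 ^ 2 * q 0 ^ (k - j) := by
        rw [inv_pow, ← pow_sub₀ _ hq (by omega), show k + 2 + 2 - (j + 2) = 2 + (k - j) by omega,
          pow_add]
      linear_combination (-((-1 : K) ^ j * ((j : K) + 1) * coeff (k + 2) (F * V ^ j))) * hpow
    · rw [ha, hb, hF0, hF1, show k + 2 - 2 = k from rfl, ratCast_smul_eq]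
      have hp1 : q 0 ^ (k + 2 + 2) * (q 0)⁻¹ ^ (k + 1 + 2) = q 0 := by
        rw [inv_pow, ← pow_sub₀ _ hq (by omega), show k + 2 + 2 - (k + 1 + 2) = 1 by omega,
          pow_one]
      have hp2 : q 0 ^ (k + 2 + 2) * (q 0)⁻¹ ^ (k + 2 + 2) = 1 := by
        rw [inv_pow, mul_inv_cancel₀ (pow_ne_zero _ hq)]
      rw [show ∀ A B : K, q 0 ^ (k + 2 + 2) * (A * (q 0)⁻¹ ^ (k + 1 + 2) * B)
            = (q 0 ^ (k + 2 + 2) * (q 0)⁻¹ ^ (k + 1 + 2)) * (A * B) from fun A B => by ring, hp1,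
        show ∀ A B : K, q 0 ^ (k + 2 + 2) * (A * (q 0)⁻¹ ^ (k + 2 + 2) * B)
            = (q 0 ^ (k + 2 + 2) * (q 0)⁻¹ ^ (k + 2 + 2)) * (A * B) from fun A B => by ring, hp2]
      push_cast
      field_simp
      ring
  have hq2 : q 0 ^ 2 ≠ 0 := pow_ne_zero 2 hq
  apply mul_left_cancel₀ hq2
  rw [key]; ring

/-! ### The vanishing statements for `phiDef` -/

/-- **§28.4 (iii) for `phiDef`: vanishing on the square of a cofactor.** If `Q̃ = M̃ · Ñ`
(`M̃ = α + βu` linear) and `G̃ = Ñ²` with `Ñ` of degree `< n` and `q₀ ≠ 0`, then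
`Φ_n(Q; G) = 0`. (On a product of linear forms `T = R² - 2QS = Σ γ_i² N_i²` is a sum of such
`G`'s.) [folklore] -/
private theorem phiDef_eq_zero_of_sq_cofactor {n : ℕ} (hn : 2 ≤ n) (q g : ℕ → K) (hq : q 0 ≠ 0)
    {α β : K} (N : K⟦X⟧) (hN : ∀ b, n ≤ b → coeff b N = 0)
    (hQ : ser n q = lin α β * N) (hG : ser (2 * n - 2) g = N ^ 2) : phiDef n q g = 0 := by
  have hα : α ≠ 0 := by
    intro h
    apply hq
    rw [← constantCoeff_ser n q, hQ, map_mul, constantCoeff_lin, h, zero_mul]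
  have hN0 : constantCoeff N ≠ 0 := by
    intro h
    apply hq
    rw [← constantCoeff_ser n q, hQ, map_mul, h, mul_zero]
  have hNinv : N * N⁻¹ = 1 := PowerSeries.mul_inv_cancel N hN0
  rw [phiDef_eq_coeff hn q g hq, hG, hQ, PowerSeries.mul_inv_rev, mul_pow,
    show calSer n q * N ^ 2 * (N⁻¹ ^ 2 * (lin α β)⁻¹ ^ 2)
      = calSer n q * (lin α β)⁻¹ ^ 2 * (N * N⁻¹) ^ 2 by ring,
    hNinv, one_pow, mul_one, coeff_calSer_mul_inv_lin_sq q hα N hN hQ, mul_zero]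

/-- **§28.4 (ii), `x`-version, for `phiDef`.** If `G̃` is the `u`-chart of `P Qₓ - Pₓ Q` with
`deg P < n` and `q₀ ≠ 0`, then `Φ_n(Q; G) = 0`. [folklore] -/
private theorem phiDef_eq_zero_of_wronskX {n : ℕ} (hn : 2 ≤ n) (q g : ℕ → K) (hq : q 0 ≠ 0)
    (P : K⟦X⟧) (hP : ∀ b, n ≤ b → coeff b P = 0)
    (hG : ser (2 * n - 2) g = P * Dser n (ser n q) - Dser (n - 1) P * ser n q) :
    phiDef n q g = 0 := by
  rw [phiDef_eq_coeff hn q g hq, hG, coeff_calSer_mul_wronskX (by omega) q hq P hP, mul_zero]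

/-- **§28.4 (ii), `y`-version, for `phiDef`.** If `G̃` is the `u`-chart of `P Q_y - P_y Q`
(`u`-derivatives) with `deg P < n` and `q₀ ≠ 0`, then `Φ_n(Q; G) = 0`. [folklore] -/
private theorem phiDef_eq_zero_of_wronskY {n : ℕ} (hn : 2 ≤ n) (q g : ℕ → K) (hq : q 0 ≠ 0)
    (P : K⟦X⟧) (hP : ∀ b, n ≤ b → coeff b P = 0)
    (hG : ser (2 * n - 2) g = P * d⁄dX K (ser n q) - d⁄dX K P * ser n q) :
    phiDef n q g = 0 := by
  rw [phiDef_eq_coeff hn q g hq, hG, coeff_calSer_mul_wronskY q hq P hP, mul_zero]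

/-! ### Coefficient-function form of the bridge and of the vanishing statements -/

/-- The bridge with `G` given as the coefficient function of an arbitrary series `W` (the
truncation at degree `2n-2 ≥ n` inside `phiDef` does not affect the residue). [folklore] -/
private theorem phiDef_coeffFun_eq {n : ℕ} (hn : 2 ≤ n) (q : ℕ → K) (hq : q 0 ≠ 0) (W : K⟦X⟧) :
    phiDef n q (fun k => coeff k W) = q 0 ^ n * coeff n (calSer n q * W * (ser n q)⁻¹ ^ 2) := by
  rw [phiDef_eq_coeff hn q _ hq]
  congr 1
  have hdvd : (X : K⟦X⟧) ^ (2 * n - 1) ∣ ser (2 * n - 2) (fun k => coeff k W) - W := by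
    rw [PowerSeries.X_pow_dvd_iff]
    intro m hm
    rw [map_sub, coeff_ser, if_pos (by omega), sub_self]
  obtain ⟨E, hE⟩ := hdvd
  have h1 : calSer n q * ser (2 * n - 2) (fun k => coeff k W) * (ser n q)⁻¹ ^ 2
      = calSer n q * W * (ser n q)⁻¹ ^ 2
        + (X : K⟦X⟧) ^ (2 * n - 1) * (calSer n q * E * (ser n q)⁻¹ ^ 2) := by
    linear_combination (calSer n q * (ser n q)⁻¹ ^ 2) * hE
  rw [h1, map_add, coeff_X_pow_mul', if_neg (by omega), add_zero]

/-- `Φ_n(Q; P ∂ₓQ - ∂ₓP Q) = 0` over a field, `q₀ ≠ 0`, coefficient-function form. [folklore] -/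
private theorem phiDef_wronskX_of_ne_zero {n : ℕ} (hn : 2 ≤ n) (q p : ℕ → K) (hq : q 0 ≠ 0) :
    phiDef n q (fun k => coeff k (wronskXSer n q p)) = 0 := by
  rw [phiDef_coeffFun_eq hn q hq, wronskXSer,
    coeff_calSer_mul_wronskX (by omega) q hq _ (fun b hb => by rw [coeff_ser, if_neg (by omega)]),
    mul_zero]

/-- `Φ_n(Q; P ∂_yQ - ∂_yP Q) = 0` over a field, `q₀ ≠ 0`, coefficient-function form. [folklore] -/
private theorem phiDef_wronskY_of_ne_zero {n : ℕ} (hn : 2 ≤ n) (q p : ℕ → K) (hq : q 0 ≠ 0) :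
    phiDef n q (fun k => coeff k (wronskYSer n q p)) = 0 := by
  rw [phiDef_coeffFun_eq hn q hq, wronskYSer,
    coeff_calSer_mul_wronskY q hq _ (fun b hb => by rw [coeff_ser, if_neg (by omega)]), mul_zero]

/-- `Φ_n(M N; N²) = 0` over a field for `M = α x + β y`, `α ≠ 0`, `N(1,0) ≠ 0`,
coefficient-function form. [folklore] -/
private theorem phiDef_sq_cofactor_of_ne_zero {n : ℕ} (hn : 2 ≤ n) (α β : K) (m : ℕ → K)
    (hα : α ≠ 0) (hm : m 0 ≠ 0) :
    phiDef n (fun k => coeff k (lin α β * ser (n - 1) m))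
      (fun k => coeff k (ser (n - 1) m ^ 2)) = 0 := by
  set N := ser (n - 1) m with hNdef
  have hN : ∀ b, n ≤ b → coeff b N = 0 := fun b hb => by
    rw [hNdef, coeff_ser, if_neg (by omega)]
  have hQ : ser n (fun k => coeff k (lin α β * N)) = lin α β * N := by
    apply ser_coeff_eq
    intro b hb
    obtain ⟨b, rfl⟩ : ∃ b', b = b' + 1 := ⟨b - 1, by omega⟩
    rw [coeff_succ_lin_mul, hN _ (by omega), hN _ (by omega), mul_zero, mul_zero, add_zero]
  have hq0 : (fun k => coeff k (lin α β * N)) 0 ≠ 0 := by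
    simp only [coeff_zero_eq_constantCoeff, map_mul, constantCoeff_lin, hNdef, constantCoeff_ser]
    exact mul_ne_zero hα hm
  have hN0 : constantCoeff N ≠ 0 := by rwa [hNdef, constantCoeff_ser]
  have hNinv : N * N⁻¹ = 1 := PowerSeries.mul_inv_cancel N hN0
  rw [phiDef_coeffFun_eq hn _ hq0, hQ, PowerSeries.mul_inv_rev, mul_pow,
    show calSer n (fun k => coeff k (lin α β * N)) * N ^ 2 * (N⁻¹ ^ 2 * (lin α β)⁻¹ ^ 2)
      = calSer n (fun k => coeff k (lin α β * N)) * (lin α β)⁻¹ ^ 2 * (N * N⁻¹) ^ 2 by ring,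
    hNinv, one_pow, mul_one, coeff_calSer_mul_inv_lin_sq _ hα N hN hQ, mul_zero]

/-! ### Nonvanishing: the value at `Q = xⁿ - yⁿ`, `T = -2 (xⁿ - yⁿ) x^{n-2}` -/

omit [CharZero K] in
/-- Residue bookkeeping: if `S` inverts `Q²` modulo `X^{n+1}`, then
`coeff n (F Q⁻²) = coeff n (F S)`. [folklore] -/
private theorem coeff_mul_inv_sq_eq_of_dvd {n : ℕ} (F Q S : K⟦X⟧) (hQ0 : constantCoeff Q ≠ 0)
    (hQS : (X : K⟦X⟧) ^ (n + 1) ∣ Q ^ 2 * S - 1) :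
    coeff n (F * (Q⁻¹) ^ 2) = coeff n (F * S) := by
  have hQinv : Q * Q⁻¹ = 1 := PowerSeries.mul_inv_cancel Q hQ0
  obtain ⟨E, hE⟩ := hQS
  have hQQ : (Q⁻¹) ^ 2 * Q ^ 2 = 1 := by rw [← mul_pow, mul_comm, hQinv, one_pow]
  have h1 : F * S = F * (Q⁻¹) ^ 2 + (X : K⟦X⟧) ^ (n + 1) * (F * (Q⁻¹) ^ 2 * E) := by
    have h2 : F * (Q⁻¹) ^ 2 * (Q ^ 2 * S - 1) = F * S - F * (Q⁻¹) ^ 2 := by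
      rw [mul_sub, mul_one, ← mul_assoc, mul_assoc F, hQQ, mul_one]
    rw [hE] at h2
    linear_combination -h2
  rw [h1, map_add, coeff_X_pow_mul', if_neg (by omega), add_zero]

/-- The `Q`-coefficients of the witness `xⁿ - yⁿ`. [folklore] -/
def witnessQ (n : ℕ) : ℕ → K := fun b => if b = 0 then 1 else if b = n then -1 else 0

/-- The `T`-coefficients of the witness: `T = R² - 2QS` for `R = 0`, `S = x^{n-2}`, i.e.
`T = -2 x^{2n-2} + 2 x^{n-2} yⁿ`. [folklore] -/
def witnessG (n : ℕ) : ℕ → K := fun b => if b = 0 then -2 else if b = n then 2 else 0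

omit [CharZero K] in
/-- The chart of the witness `Q = xⁿ - yⁿ`: `Q̃ = 1 - uⁿ`. [folklore] -/
private theorem ser_witnessQ {n : ℕ} (hn : 2 ≤ n) :
    ser n (witnessQ (K := K) n) = 1 - X ^ n := by
  ext b
  rw [coeff_ser, map_sub, coeff_one, coeff_X_pow, witnessQ]
  by_cases hb0 : b = 0
  · subst hb0
    rw [if_pos (Nat.zero_le _), if_pos rfl, if_pos rfl, if_neg (by omega : ¬ (0 : ℕ) = n)]
    ring
  · by_cases hbn : b = n
    · subst hbn
      rw [if_pos le_rfl, if_neg hb0, if_pos rfl, if_neg hb0, if_pos rfl]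
      ring
    · rw [if_neg hb0, if_neg hbn]
      split_ifs <;> ring

/-- The chart of the antiderivative of the witness: `𝒬̃ = 1/(n+1) - uⁿ`. [folklore] -/
private theorem calSer_witnessQ {n : ℕ} (hn : 2 ≤ n) :
    calSer n (witnessQ (K := K) n) = C (((n : K) + 1)⁻¹) - X ^ n := by
  ext b
  rw [coeff_calSer, map_sub, coeff_C, coeff_X_pow, witnessQ]
  by_cases hb0 : b = 0
  · subst hb0
    rw [if_pos (Nat.zero_le _), if_pos rfl, if_pos rfl, if_neg (by omega : ¬ (0 : ℕ) = n),
      Nat.sub_zero, sub_zero, Rat.smul_one_eq_cast]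
    push_cast
    ring
  · by_cases hbn : b = n
    · subst hbn
      rw [if_pos le_rfl, if_neg hb0, if_pos rfl, if_neg hb0, if_pos rfl, Nat.add_sub_cancel_left,
        Nat.cast_one, inv_one, one_smul, zero_sub]
    · rw [if_neg hb0, if_neg hbn, if_neg hb0, if_neg hbn, sub_zero]
      split_ifs <;> simp

omit [CharZero K] in
/-- The chart of the witness `T = -2(xⁿ - yⁿ)x^{n-2}`: `-2 + 2uⁿ`. [folklore] -/
private theorem ser_witnessG {n : ℕ} (hn : 2 ≤ n) :
    ser (2 * n - 2) (witnessG (K := K) n) = -2 + 2 * X ^ n := by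
  ext b
  rw [coeff_ser, map_add, map_neg, witnessG,
    show (2 : K⟦X⟧) = C (2 : K) by rw [map_ofNat], coeff_C, coeff_C_mul_X_pow]
  by_cases hb0 : b = 0
  · subst hb0
    rw [if_pos (Nat.zero_le _), if_pos rfl, if_pos rfl, if_neg (by omega : ¬ (0 : ℕ) = n)]
    ring
  · by_cases hbn : b = n
    · subst hbn
      rw [if_pos (by omega), if_neg hb0, if_pos rfl, if_neg hb0]
      ring
    · rw [if_neg hb0, if_neg hbn]
      split_ifs <;> ring

/-- **§28.4 (iv): the witness value.** `Φ_n(xⁿ - yⁿ; -2x^{2n-2} + 2x^{n-2}yⁿ) = 2 - 2/(n+1)`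
(`= 2n/(n+1)`). [folklore] -/
private theorem phiDef_witness {n : ℕ} (hn : 2 ≤ n) :
    phiDef n (witnessQ (K := K) n) (witnessG n) = 2 - 2 * ((n : K) + 1)⁻¹ := by
  have hq : witnessQ (K := K) n 0 ≠ 0 := by simp [witnessQ]
  rw [phiDef_eq_coeff hn _ _ hq, show witnessQ (K := K) n 0 = 1 by simp [witnessQ], one_pow,
    one_mul, ser_witnessQ hn, calSer_witnessQ hn, ser_witnessG hn]
  obtain ⟨k, rfl⟩ : ∃ k, n = k + 2 := ⟨n - 2, by omega⟩
  set a : K := (((k + 2 : ℕ) : K) + 1)⁻¹ with ha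
  have hQ0 : constantCoeff (1 - X ^ (k + 2) : K⟦X⟧) ≠ 0 := by
    rw [map_sub, map_one, map_pow, constantCoeff_X, zero_pow (by omega), sub_zero]
    exact one_ne_zero
  have hQS : (X : K⟦X⟧) ^ (k + 2 + 1) ∣ (1 - X ^ (k + 2)) ^ 2 * (1 + X ^ (k + 2)) ^ 2 - 1 :=
    ⟨X ^ (k + 1) * (X ^ (k + 2) * X ^ (k + 2) - 2), by ring⟩
  rw [coeff_mul_inv_sq_eq_of_dvd _ _ _ hQ0 hQS]
  have hexp : (C a - X ^ (k + 2)) * (-2 + 2 * X ^ (k + 2)) * (1 + X ^ (k + 2)) ^ 2 =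
      C (-2 * a) + C (2 - 2 * a) * X ^ (k + 2) +
        X ^ (k + 2 + 1) * (X ^ (k + 1) *
          ((2 * C a + 2) + (2 * C a - 2) * X ^ (k + 2) - 2 * X ^ (k + 2) * X ^ (k + 2))) := by
    rw [map_mul, map_sub, map_mul, map_neg, map_ofNat]
    ring
  rw [hexp, map_add, map_add, coeff_C, if_neg (by omega), zero_add, coeff_C_mul_X_pow,
    if_pos rfl, coeff_X_pow_mul', if_neg (by omega), add_zero]

/-- The witness value is nonzero in characteristic zero (`n ≥ 2`). [folklore] -/
private theorem phiDef_witness_ne_zero {n : ℕ} (hn : 2 ≤ n) :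
    phiDef n (witnessQ (K := K) n) (witnessG n) ≠ 0 := by
  rw [phiDef_witness hn]
  have hn1 : ((n : K) + 1) ≠ 0 := by exact_mod_cast Nat.succ_ne_zero n
  have hn0 : (n : K) ≠ 0 := by exact_mod_cast (show n ≠ 0 by omega)
  intro h
  have : (2 : K) * (n : K) = 0 := by
    have h' := congrArg (· * ((n : K) + 1)) h
    simp only [sub_mul, mul_assoc, inv_mul_cancel₀ hn1, zero_mul] at h'
    linear_combination h'
  exact mul_ne_zero two_ne_zero hn0 this

end Field

/-! ## Translation invariance over a field: the Möbius substitution `u ↦ u/(1 + b u)` -/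

section TranslField

variable {K : Type*} [Field K] [CharZero K]

omit [CharZero K] in
/-- `1 + b u` is invertible in `K⟦u⟧`. [folklore] -/
private theorem lin_one_mul_inv (b : K) : lin (1 : K) b * (lin 1 b)⁻¹ = 1 :=
  PowerSeries.mul_inv_cancel _ (by simp [constantCoeff_lin])

/-- The Möbius substitution `u ↦ u / (1 + b u)` (the translation `x ↦ x + b` at `x = ∞`).
[folklore] -/
def moeb (b : K) : K⟦X⟧ := X * (lin 1 b)⁻¹

omit [CharZero K] in
/-- The Möbius series `u/(1+bu)` has zero constant term, so it can be substituted. [folklore] -/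
private theorem hasSubst_moeb (b : K) : HasSubst (moeb b) :=
  HasSubst.of_constantCoeff_zero' (by simp [moeb])

omit [CharZero K] in
/-- Substitution fixes constants. [folklore] -/
private theorem subst_moeb_C (b a : K) : subst (moeb b) (C a) = C a := by
  rw [subst_C]; rfl

omit [CharZero K] in
/-- Substitution commutes with finite sums. [folklore] -/
private theorem subst_moeb_sum (b : K) (s : Finset ℕ) (F : ℕ → K⟦X⟧) :
    subst (moeb b) (∑ k ∈ s, F k) = ∑ k ∈ s, subst (moeb b) (F k) := by
  rw [← coe_substAlgHom (hasSubst_moeb b), map_sum]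

omit [CharZero K] in
/-- `(1 + b u)^m · (ser m f)(u/(1+bu)) = twist m b f`. [folklore] -/
private theorem subst_moeb_ser (b : K) (m : ℕ) (f : ℕ → K) :
    subst (moeb b) (ser m f) * lin 1 b ^ m = twist m b f := by
  have hS := hasSubst_moeb b
  have hLinv := lin_one_mul_inv b
  rw [ser_eq_sum, subst_moeb_sum, Finset.sum_mul, twist]
  refine Finset.sum_congr rfl fun k hk => ?_
  have hk' : k ≤ m := Nat.lt_succ_iff.mp (Finset.mem_range.mp hk)
  obtain ⟨j, rfl⟩ := Nat.exists_eq_add_of_le hk'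
  rw [subst_mul hS, subst_pow hS, subst_X hS, subst_moeb_C, moeb, Nat.add_sub_cancel_left,
    pow_add, mul_pow,
    show C (f k) * (X ^ k * (lin 1 b)⁻¹ ^ k) * ((lin 1 b) ^ k * (lin 1 b) ^ j)
      = C (f k) * X ^ k * (lin 1 b) ^ j * ((lin 1 b) * (lin 1 b)⁻¹) ^ k by ring,
    hLinv, one_pow, mul_one]

omit [CharZero K] in
/-- **Möbius invariance of the residue at infinity**:
`coeff_{p+1} ((1 + b u)^p · Y(u/(1+bu))) = coeff_{p+1} Y`. [folklore] -/
private theorem coeff_lin_pow_mul_subst_moeb (b : K) (p : ℕ) (Y : K⟦X⟧) :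
    coeff (p + 1) (lin 1 b ^ p * subst (moeb b) Y) = coeff (p + 1) Y := by
  set L := lin (1 : K) b with hL
  have hS : HasSubst (moeb b) := hasSubst_moeb b
  have hLinv : L * L⁻¹ = 1 := lin_one_mul_inv b
  obtain ⟨T, hT⟩ : (X : K⟦X⟧) ^ (p + 2) ∣ Y - ser (p + 1) (fun k => coeff k Y) := by
    rw [PowerSeries.X_pow_dvd_iff]
    intro m hm
    rw [map_sub, coeff_ser, if_pos (by omega), sub_self]
  have hY : Y = ser (p + 1) (fun k => coeff k Y) + X ^ (p + 2) * T := by rw [← hT]; ring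
  have hterm : ∀ k ∈ Finset.range (p + 1),
      L ^ p * subst (moeb b) (C (coeff k Y) * X ^ k) = C (coeff k Y) * X ^ k * L ^ (p - k) := by
    intro k hk
    have hk' : k ≤ p := Nat.lt_succ_iff.mp (Finset.mem_range.mp hk)
    obtain ⟨j, hj⟩ := Nat.exists_eq_add_of_le hk'
    rw [subst_mul hS, subst_pow hS, subst_X hS, subst_moeb_C, moeb, hj,
      Nat.add_sub_cancel_left, pow_add, mul_pow,
      show L ^ k * L ^ j * (C (coeff k Y) * (X ^ k * (lin 1 b)⁻¹ ^ k))
        = C (coeff k Y) * X ^ k * L ^ j * (L * (lin 1 b)⁻¹) ^ k by ring,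
      hLinv, one_pow, mul_one]
  have hmain : L ^ p * subst (moeb b) Y
      = (∑ k ∈ Finset.range (p + 1), C (coeff k Y) * X ^ k * L ^ (p - k))
        + C (coeff (p + 1) Y) * X ^ (p + 1) * L⁻¹
        + X ^ (p + 2) * (L ^ p * (L⁻¹) ^ (p + 2) * subst (moeb b) T) := by
    conv_lhs => rw [hY, ser_eq_sum]
    rw [subst_add hS, subst_mul hS, subst_pow hS, subst_X hS, subst_moeb_sum,
      Finset.sum_range_succ, mul_add, mul_add, Finset.mul_sum, Finset.sum_congr rfl hterm,
      subst_mul hS, subst_pow hS, subst_X hS, subst_moeb_C, moeb, mul_pow, mul_pow,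
      show L ^ p * (C (coeff (p + 1) Y) * (X ^ (p + 1) * (lin 1 b)⁻¹ ^ (p + 1)))
        = C (coeff (p + 1) Y) * X ^ (p + 1) * (lin 1 b)⁻¹ * (L * (lin 1 b)⁻¹) ^ p by ring,
      hLinv, one_pow, mul_one]
    ring
  rw [hmain, map_add, map_add, coeff_X_pow_mul', if_neg (by omega), add_zero, map_sum,
    Finset.sum_eq_zero, zero_add, mul_assoc, coeff_C_mul, coeff_X_pow_mul', if_pos le_rfl,
    Nat.sub_self, coeff_zero_eq_constantCoeff_apply, constantCoeff_inv, constantCoeff_lin,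
    inv_one, mul_one]
  intro k hk
  have hk' : k ≤ p := Nat.lt_succ_iff.mp (Finset.mem_range.mp hk)
  rw [mul_assoc, coeff_C_mul, coeff_X_pow_mul', if_pos (by omega),
    coeff_lin_pow_eq_zero _ _ _ _ (by omega), mul_zero]

omit [CharZero K] in
/-- Euler operator on monomials: `u · (u^k)' = k u^k`. [folklore] -/
private theorem X_mul_derivative_X_pow (k : ℕ) :
    (X : K⟦X⟧) * d⁄dX K (X ^ k) = (k : K⟦X⟧) * X ^ k := by
  ext j
  rw [coeff_X_mul_derivative, natCast_eq_C, coeff_C_mul, coeff_X_pow]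
  split_ifs with h
  · rw [h]
  · rw [mul_zero, mul_zero]

omit [CharZero K] in
/-- Euler operator on powers of `1 + bu`: `u · ((1+bu)^{m+1})' = (m+1) b u (1+bu)^m`. [folklore] -/
private theorem X_mul_derivative_lin_pow_succ (b : K) (m : ℕ) :
    (X : K⟦X⟧) * d⁄dX K (lin 1 b ^ (m + 1)) = ((m : K⟦X⟧) + 1) * (C b * X) * lin 1 b ^ m := by
  rw [Derivation.leibniz_pow, Nat.add_sub_cancel, derivative_lin, smul_eq_mul, nsmul_eq_mul]
  push_cast
  ring

/-- The Euler relation of the twisted antiderivative: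
with `E = Σ_k 𝒬̃_k u^k (1+bu)^{n+1-k}` one has `u E' = (n+1) E - twist n b q`. [folklore] -/
private theorem euler_twist (b : K) (n : ℕ) (q : ℕ → K) :
    X * d⁄dX K (∑ k ∈ Finset.range (n + 1),
        C (coeff k (calSer n q)) * X ^ k * lin 1 b ^ (n - k + 1))
      = ((n : K⟦X⟧) + 1) * (∑ k ∈ Finset.range (n + 1),
          C (coeff k (calSer n q)) * X ^ k * lin 1 b ^ (n - k + 1)) - twist n b q := by
  set L := lin (1 : K) b with hL
  have hLdef : L = 1 + C b * X := by rw [hL, lin, map_one]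
  rw [twist, map_sum, Finset.mul_sum, Finset.mul_sum, ← Finset.sum_sub_distrib]
  refine Finset.sum_congr rfl fun k hk => ?_
  have hk' : k ≤ n := Nat.lt_succ_iff.mp (Finset.mem_range.mp hk)
  obtain ⟨m, hm⟩ := Nat.exists_eq_add_of_le hk'
  have hnk : n - k = m := by omega
  rw [hnk]
  set c := coeff k (calSer n q) with hc
  -- `q_k = (m+1) c`
  have hq : C (q k) = ((m : K⟦X⟧) + 1) * C c := by
    have h1 : c = (((n + 1 - k : ℕ) : ℚ)⁻¹) • q k := by rw [hc, coeff_calSer, if_pos hk']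
    have hr : ((n + 1 - k : ℕ) : ℚ) ≠ 0 := by rw [Nat.cast_ne_zero]; omega
    have h2 : q k = ((m : K) + 1) * c := by
      rw [h1, ratCast_smul_eq, ← mul_assoc, show n + 1 - k = m + 1 by omega]
      push_cast
      rw [mul_inv_cancel₀ (by exact_mod_cast (show (m + 1 : ℕ) ≠ 0 by omega)), one_mul]
    rw [h2, map_mul, map_add, map_natCast, map_one, natCast_eq_C]
  have hkm : (k : K⟦X⟧) + m = n := by rw [hm]; push_cast; ring
  have hθX := X_mul_derivative_X_pow (K := K) k
  have hθL := X_mul_derivative_lin_pow_succ b m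
  have hLeib : d⁄dX K (C c * X ^ k * L ^ (m + 1))
      = C c * d⁄dX K (X ^ k) * L ^ (m + 1) + C c * X ^ k * d⁄dX K (L ^ (m + 1)) := by
    rw [Derivation.leibniz, Derivation.leibniz, derivative_C, smul_zero, add_zero, smul_eq_mul,
      smul_eq_mul, smul_eq_mul]
    ring
  rw [hLeib]
  rw [← hL] at hθL
  linear_combination (C c * L ^ (m + 1)) * hθX + (C c * X ^ k) * hθL + X ^ k * L ^ m * hq
    + C c * X ^ k * L ^ m * ((k : K⟦X⟧) - n - 1) * hLdef
    + C c * X ^ k * L ^ m * (1 + C b * X) * hkm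

/-- **Translation invariance of the residue functional, core form** (`n = p + 1`,
`G`-degree `2p`): over a field with `q₀ ≠ 0`. [folklore] -/
private theorem coeff_twist_core (b : K) (p : ℕ) (q g : ℕ → K) (hq : q 0 ≠ 0) :
    coeff (p + 1) (calSer (p + 1) (fun k => coeff k (twist (p + 1) b q)) * twist (2 * p) b g
        * (twist (p + 1) b q)⁻¹ ^ 2)
      = coeff (p + 1) (calSer (p + 1) q * ser (2 * p) g * (ser (p + 1) q)⁻¹ ^ 2) := by
  set n := p + 1 with hn
  set L := lin (1 : K) b with hL
  set Q' := twist n b q with hQ'def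
  set G' := twist (2 * p) b g with hG'def
  set q' : ℕ → K := fun k => coeff k Q' with hq'def
  set Q := ser n q with hQdef
  set G := ser (2 * p) g with hGdef
  set cal := calSer n q with hcaldef
  have hS : HasSubst (moeb b) := hasSubst_moeb b
  have hLinv : L * L⁻¹ = 1 := lin_one_mul_inv b
  have hQ0 : constantCoeff Q ≠ 0 := by rwa [hQdef, constantCoeff_ser]
  have hQ'0 : constantCoeff Q' ≠ 0 := by rwa [hQ'def, constantCoeff_twist]
  -- Step A: `calSer n q' ≡ E (mod u^{n+1})`
  set E := ∑ k ∈ Finset.range (n + 1), C (coeff k cal) * X ^ k * L ^ (n - k + 1) with hEdef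
  have hEuler : X * d⁄dX K E = ((n : K⟦X⟧) + 1) * E - Q' := euler_twist b n q
  have hcong : (X : K⟦X⟧) ^ (n + 1) ∣ E - calSer n q' := by
    rw [PowerSeries.X_pow_dvd_iff]
    intro j hj
    have h := congrArg (coeff j) hEuler
    rw [coeff_X_mul_derivative, map_sub, show ((n : K⟦X⟧) + 1) = C ((n : K) + 1) by
      rw [map_add, map_one, natCast_eq_C], coeff_C_mul] at h
    have hr : ((n + 1 - j : ℕ) : ℚ) ≠ 0 := by rw [Nat.cast_ne_zero]; omega
    rw [map_sub, coeff_calSer, if_pos (by omega), ratCast_smul_eq, sub_eq_zero]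
    have hrK : (((n + 1 - j : ℕ) : ℚ) : K) ≠ 0 := by exact_mod_cast hr
    rw [eq_comm, Rat.cast_inv, inv_mul_eq_iff_eq_mul₀ hrK]
    push_cast [Nat.cast_sub (show j ≤ n + 1 by omega)]
    linear_combination h
  have stepA : coeff n (calSer n q' * G' * Q'⁻¹ ^ 2) = coeff n (E * G' * Q'⁻¹ ^ 2) := by
    obtain ⟨T, hT⟩ := hcong
    have h1 : E * G' * Q'⁻¹ ^ 2
        = calSer n q' * G' * Q'⁻¹ ^ 2 + X ^ (n + 1) * (T * G' * Q'⁻¹ ^ 2) := by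
      linear_combination (G' * Q'⁻¹ ^ 2) * hT
    rw [h1, map_add, coeff_X_pow_mul', if_neg (by omega), add_zero]
  -- Step B: `E G' Q'⁻² = L^{n-1} · (cal G Q⁻²)(u/(1+bu))`
  have hSQ : subst (moeb b) Q * L ^ n = Q' := subst_moeb_ser b n q
  have hSG : subst (moeb b) G * L ^ (2 * p) = G' := subst_moeb_ser b (2 * p) g
  have hScal : subst (moeb b) cal * L ^ n = twist n b (fun k => coeff k cal) := by
    have h1 : ser n (fun k => coeff k cal) = cal :=
      ser_coeff_eq n cal (fun j hj => by rw [hcaldef, coeff_calSer, if_neg (by omega)])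
    conv_lhs => rw [← h1]
    exact subst_moeb_ser b n _
  have hE' : E = L * twist n b (fun k => coeff k cal) := by
    rw [hEdef, twist, Finset.mul_sum]
    refine Finset.sum_congr rfl fun k _ => ?_
    rw [pow_succ]
    ring
  have hSQQ : subst (moeb b) Q * subst (moeb b) Q⁻¹ = 1 := by
    rw [← subst_mul hS, PowerSeries.mul_inv_cancel Q hQ0, ← map_one (C : K →+* K⟦X⟧),
      subst_moeb_C]
  have hQinv' : Q'⁻¹ = L⁻¹ ^ n * subst (moeb b) Q⁻¹ := by
    symm
    rw [PowerSeries.eq_inv_iff_mul_eq_one hQ'0, ← hSQ,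
      show L⁻¹ ^ n * subst (moeb b) Q⁻¹ * (subst (moeb b) Q * L ^ n)
        = (L * L⁻¹) ^ n * (subst (moeb b) Q * subst (moeb b) Q⁻¹) by ring,
      hLinv, hSQQ, one_pow, one_mul]
  have stepB : E * G' * Q'⁻¹ ^ 2 = L ^ p * subst (moeb b) (cal * G * Q⁻¹ ^ 2) := by
    rw [subst_mul hS, subst_mul hS, subst_pow hS, hQinv', hE', ← hScal, ← hSG,
      show L * (subst (moeb b) cal * L ^ n) * (subst (moeb b) G * L ^ (2 * p))
          * (L⁻¹ ^ n * subst (moeb b) Q⁻¹) ^ 2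
        = L ^ p * (subst (moeb b) cal * subst (moeb b) G * subst (moeb b) Q⁻¹ ^ 2)
          * (L * L⁻¹) ^ (2 * p + 2) by rw [hn]; ring,
      hLinv, one_pow, mul_one]
  rw [stepA, stepB, coeff_lin_pow_mul_subst_moeb]

/-- Translation invariance of `Φ_n` over a field, `q₀ ≠ 0`. [folklore] -/
private theorem phiDef_twist_of_ne_zero {n : ℕ} (hn : 2 ≤ n) (b : K) (q g : ℕ → K) (hq : q 0 ≠ 0) :
    phiDef n (fun k => coeff k (twist n b q)) (fun k => coeff k (twist (2 * n - 2) b g))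
      = phiDef n q g := by
  obtain ⟨p, rfl⟩ : ∃ p, n = p + 1 := ⟨n - 1, by omega⟩
  have h2 : 2 * (p + 1) - 2 = 2 * p := by omega
  rw [h2]
  have hq'0 : coeff 0 (twist (p + 1) b q) = q 0 := by
    rw [coeff_zero_eq_constantCoeff_apply, constantCoeff_twist]
  have hq'ne : (fun k => coeff k (twist (p + 1) b q)) 0 ≠ 0 := by
    show coeff 0 (twist (p + 1) b q) ≠ 0
    rw [hq'0]; exact hq
  have hQ' : ser (p + 1) (fun k => coeff k (twist (p + 1) b q)) = twist (p + 1) b q :=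
    ser_coeff_eq _ _ (fun j hj => coeff_twist_eq_zero _ b q j hj)
  rw [phiDef_coeffFun_eq hn _ hq'ne, hQ', hq'0, phiDef_eq_coeff hn q g hq, h2,
    coeff_twist_core b p q g hq]

end TranslField

/-! ## The vanishing statements as polynomial identities (any commutative `ℚ`-algebra)

The field statements above hold on the Zariski-open set `q₀ ≠ 0`; since both sides are
polynomials with rational coefficients in the data, they hold identically.  Formally: prove them
at the generic point (coefficients = indeterminates of `A = ℚ[X_•]`, mapped into the fraction
field of `A`), pull back to `A` along the injective `algebraMap`, and specialise by evaluation. -/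

section Transport

variable {B : Type*} [CommRing B] [Algebra ℚ B]

/-- The generic coefficient ring `ℚ[X_s : s ∈ ℕ ⊕ ℕ]` (two families of indeterminate coefficients).
[folklore] -/
private abbrev GA : Type := MvPolynomial (ℕ ⊕ ℕ) ℚ
/-- The fraction field of the generic coefficient ring. [folklore] -/
private abbrev GK : Type := FractionRing GA

/-- The generic fraction field has characteristic zero. [folklore] -/
private theorem GK_charZero : CharZero GK :=
  charZero_of_injective_algebraMap (IsFractionRing.injective GA GK)

/-- An indeterminate is nonzero in the generic fraction field. [folklore] -/
private theorem algebraMap_GX_ne_zero (s : ℕ ⊕ ℕ) :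
    algebraMap GA GK (MvPolynomial.X s) ≠ 0 :=
  (map_ne_zero_iff _ (IsFractionRing.injective GA GK)).mpr (MvPolynomial.X_ne_zero s)

/-- **`Φ_n` kills `x`-Wronskians**: `Φ_n(Q; P ∂ₓQ - ∂ₓP Q) = 0` for all binary forms `Q`
(degree `n`) and `P` (degree `n-1`), identically in the coefficients. [folklore] -/
private theorem phiDef_wronskX {n : ℕ} (hn : 2 ≤ n) (q p : ℕ → B) :
    phiDef n q (fun k => coeff k (wronskXSer n q p)) = 0 := by
  let Xq : ℕ → GA := fun b => MvPolynomial.X (Sum.inl b)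
  let Xp : ℕ → GA := fun b => MvPolynomial.X (Sum.inr b)
  haveI : CharZero GK := GK_charZero
  have hι : Function.Injective (algebraMap GA GK) := IsFractionRing.injective GA GK
  have hK : phiDef n (algebraMap GA GK ∘ Xq)
      (fun k => coeff k (wronskXSer n (algebraMap GA GK ∘ Xq) (algebraMap GA GK ∘ Xp))) = 0 :=
    phiDef_wronskX_of_ne_zero hn _ _ (algebraMap_GX_ne_zero _)
  have hA : phiDef n Xq (fun k => coeff k (wronskXSer n Xq Xp)) = 0 := by
    apply hι
    rw [map_phiDef, map_zero, ← hK]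
    congr 1
    funext k
    rw [Function.comp_apply, ← coeff_map, map_wronskXSer]
  let e : GA →+* B := MvPolynomial.eval₂Hom (algebraMap ℚ B) (Sum.elim q p)
  have heq : (e : GA → B) ∘ Xq = q := by funext b; simp [e, Xq]
  have hep : (e : GA → B) ∘ Xp = p := by funext b; simp [e, Xp]
  have h := congrArg e hA
  rw [map_phiDef, map_zero, heq] at h
  rw [← h]
  congr 1
  funext k
  rw [Function.comp_apply, ← coeff_map, map_wronskXSer, heq, hep]

/-- **`Φ_n` kills `y`-Wronskians**: `Φ_n(Q; P ∂_yQ - ∂_yP Q) = 0` identically. [folklore] -/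
private theorem phiDef_wronskY {n : ℕ} (hn : 2 ≤ n) (q p : ℕ → B) :
    phiDef n q (fun k => coeff k (wronskYSer n q p)) = 0 := by
  let Xq : ℕ → GA := fun b => MvPolynomial.X (Sum.inl b)
  let Xp : ℕ → GA := fun b => MvPolynomial.X (Sum.inr b)
  haveI : CharZero GK := GK_charZero
  have hι : Function.Injective (algebraMap GA GK) := IsFractionRing.injective GA GK
  have hK : phiDef n (algebraMap GA GK ∘ Xq)
      (fun k => coeff k (wronskYSer n (algebraMap GA GK ∘ Xq) (algebraMap GA GK ∘ Xp))) = 0 :=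
    phiDef_wronskY_of_ne_zero hn _ _ (algebraMap_GX_ne_zero _)
  have hA : phiDef n Xq (fun k => coeff k (wronskYSer n Xq Xp)) = 0 := by
    apply hι
    rw [map_phiDef, map_zero, ← hK]
    congr 1
    funext k
    rw [Function.comp_apply, ← coeff_map, map_wronskYSer]
  let e : GA →+* B := MvPolynomial.eval₂Hom (algebraMap ℚ B) (Sum.elim q p)
  have heq : (e : GA → B) ∘ Xq = q := by funext b; simp [e, Xq]
  have hep : (e : GA → B) ∘ Xp = p := by funext b; simp [e, Xp]
  have h := congrArg e hA
  rw [map_phiDef, map_zero, heq] at h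
  rw [← h]
  congr 1
  funext k
  rw [Function.comp_apply, ← coeff_map, map_wronskYSer, heq, hep]

/-- **`Φ_n` kills squares of cofactors**: `Φ_n(M·N; N²) = 0` for `M` linear and `N` of degree
`n-1`, identically in the coefficients.  On a product of linear forms `ℓ_1 ⋯ ℓ_n` the
transversal quadratic jet is `T = R² - 2QS = Σ_i γ_i² N_i²` with `N_i = Π_{j≠i} M_j`, so
`Φ_n(Q; T) = 0` there. [folklore] -/
private theorem phiDef_sq_cofactor {n : ℕ} (hn : 2 ≤ n) (α β : B) (m : ℕ → B) :
    phiDef n (fun k => coeff k (lin α β * ser (n - 1) m))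
      (fun k => coeff k (ser (n - 1) m ^ 2)) = 0 := by
  let Xa : GA := MvPolynomial.X (Sum.inl 0)
  let Xb : GA := MvPolynomial.X (Sum.inl 1)
  let Xm : ℕ → GA := fun b => MvPolynomial.X (Sum.inr b)
  let ι := algebraMap GA GK
  haveI : CharZero GK := GK_charZero
  have hι : Function.Injective ι := IsFractionRing.injective GA GK
  have hK : phiDef n (fun k => coeff k (lin (ι Xa) (ι Xb) * ser (n - 1) (ι ∘ Xm)))
      (fun k => coeff k (ser (n - 1) (ι ∘ Xm) ^ 2)) = 0 :=
    phiDef_sq_cofactor_of_ne_zero hn _ _ _ (algebraMap_GX_ne_zero _) (algebraMap_GX_ne_zero _)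
  have hA : phiDef n (fun k => coeff k (lin Xa Xb * ser (n - 1) Xm))
      (fun k => coeff k (ser (n - 1) Xm ^ 2)) = 0 := by
    apply hι
    rw [map_phiDef, map_zero, ← hK]
    congr 1
    · funext k
      rw [Function.comp_apply, ← coeff_map, _root_.map_mul (PowerSeries.map ι), map_lin, map_ser]
    · funext k
      rw [Function.comp_apply, ← coeff_map, _root_.map_pow (PowerSeries.map ι), map_ser]
  let e : GA →+* B :=
    MvPolynomial.eval₂Hom (algebraMap ℚ B) (Sum.elim (fun i => if i = 0 then α else β) m)
  have hea : e Xa = α := by simp [e, Xa]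
  have heb : e Xb = β := by simp [e, Xb]
  have hem : (e : GA → B) ∘ Xm = m := by funext b; simp [e, Xm]
  have h := congrArg e hA
  rw [map_phiDef, map_zero] at h
  rw [← h]
  congr 1
  · funext k
    symm
    rw [Function.comp_apply, ← coeff_map, _root_.map_mul (PowerSeries.map e), map_lin, map_ser,
      hea, heb, hem]
  · funext k
    symm
    rw [Function.comp_apply, ← coeff_map, _root_.map_pow (PowerSeries.map e), map_ser, hem]

/-- **Translation invariance of `Φ_n`** (`x ↦ x + b y`): for all binary forms `Q` (degree `n`)
and `G` (degree `2n-2`), `Φ_n(Q(x+by,y); G(x+by,y)) = Φ_n(Q; G)`, identically in the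
coefficients and in `b`. [folklore] -/
private theorem phiDef_twist {n : ℕ} (hn : 2 ≤ n) (b : B) (q g : ℕ → B) :
    phiDef n (fun k => coeff k (twist n b q)) (fun k => coeff k (twist (2 * n - 2) b g))
      = phiDef n q g := by
  let Xb : GA := MvPolynomial.X (Sum.inl 0)
  let Xq : ℕ → GA := fun k => MvPolynomial.X (Sum.inl (k + 1))
  let Xg : ℕ → GA := fun k => MvPolynomial.X (Sum.inr k)
  let ι := algebraMap GA GK
  haveI : CharZero GK := GK_charZero
  have hι : Function.Injective ι := IsFractionRing.injective GA GK
  have hK : phiDef n (fun k => coeff k (twist n (ι Xb) (ι ∘ Xq)))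
      (fun k => coeff k (twist (2 * n - 2) (ι Xb) (ι ∘ Xg))) = phiDef n (ι ∘ Xq) (ι ∘ Xg) :=
    phiDef_twist_of_ne_zero hn _ _ _ (algebraMap_GX_ne_zero _)
  have hA : phiDef n (fun k => coeff k (twist n Xb Xq))
      (fun k => coeff k (twist (2 * n - 2) Xb Xg)) = phiDef n Xq Xg := by
    apply hι
    rw [map_phiDef, map_phiDef, ← hK]
    congr 1
    · funext k
      rw [Function.comp_apply, ← coeff_map, map_twist]
    · funext k
      rw [Function.comp_apply, ← coeff_map, map_twist]
  let e : GA →+* B :=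
    MvPolynomial.eval₂Hom (algebraMap ℚ B) (Sum.elim (fun i => if i = 0 then b else q (i - 1)) g)
  have heb : e Xb = b := by simp [e, Xb]
  have heq : (e : GA → B) ∘ Xq = q := by funext k; simp [e, Xq]
  have heg : (e : GA → B) ∘ Xg = g := by funext k; simp [e, Xg]
  have h := congrArg e hA
  rw [map_phiDef, map_phiDef, heq, heg] at h
  rw [← h]
  congr 1
  · funext k
    symm
    rw [Function.comp_apply, ← coeff_map, map_twist, heb, heq]
  · funext k
    symm
    rw [Function.comp_apply, ← coeff_map, map_twist, heb, heg]

end Transport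

end BrillResidue

end Literature.Computability.AlgebraicComplexity

/-! # Part II. Ternary jets, the highest weight vector `F_n`, and the discharge (`BrillHWV`) -/

namespace Literature.Computability.AlgebraicComplexity

namespace BrillResidue

open PowerSeries

variable {A : Type*} [CommRing A] [Algebra ℚ A]

/-- `Φ_n(Q; G)` only depends on `q_b`, `b ≤ n`, and `g_k`, `k ≤ 2n - 2`. [folklore] -/
private theorem phiDef_congr {n : ℕ} (hn : 2 ≤ n) {q q' g g' : ℕ → A} (hq : ∀ b ≤ n, q b = q' b)
    (hg : ∀ k ≤ 2 * n - 2, g k = g' k) : phiDef n q g = phiDef n q' g' := by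
  have hQ : ser n q = ser n q' := by
    ext b; simp only [coeff_ser]; split_ifs with h
    · exact hq b h
    · rfl
  have hC : calSer n q = calSer n q' := by
    ext b; simp only [coeff_calSer]; split_ifs with h
    · rw [hq b h]
    · rfl
  have hG : ser (2 * n - 2) g = ser (2 * n - 2) g' := by
    ext b; simp only [coeff_ser]; split_ifs with h
    · exact hg b h
    · rfl
  unfold phiDef
  rw [hQ, hC, hG, hq 0 (by omega), hq 1 (by omega), hq 2 hn, hg 0 (by omega), hg 1 (by omega)]

end BrillResidue

namespace BrillHWV

open MvPolynomial

/-! ## Elementary unipotent substitutions `X_l ↦ X_l + t X_k`: coefficient formula -/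

section ElemSubst

variable {σ R : Type*} [Fintype σ] [DecidableEq σ] [CommRing R]

/-- The unipotent elementary substitution `X_l ↦ X_l + t · X_k`, all other variables fixed
(`linSubst (1 + t E_{kl})` in the tree's column convention). [folklore] -/
def elemSubst (k l : σ) (t : R) : MvPolynomial σ R →ₐ[R] MvPolynomial σ R :=
  aeval fun i => if i = l then X l + C t * X k else X i

/-- The exponent vector obtained from `ν` by adding `j` at `l` and removing `j` at `k`
(`ν + j e_l - j e_k`; meaningful for `j ≤ ν k`). [folklore] -/
def srcExp (k l : σ) (ν : σ →₀ ℕ) (j : ℕ) : σ →₀ ℕ :=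
  (ν.update k (ν k - j)).update l (ν l + j)

omit [Fintype σ] in
/-- Value of `srcExp` at `l`. [folklore] -/
@[simp] private theorem srcExp_apply_l
    (k l : σ) (ν : σ →₀ ℕ) (j : ℕ) : srcExp k l ν j l = ν l + j := by
  simp [srcExp]

omit [Fintype σ] in
/-- Value of `srcExp` at `k`. [folklore] -/
private theorem srcExp_apply_k {k l : σ} (hkl : k ≠ l) (ν : σ →₀ ℕ) (j : ℕ) :
    srcExp k l ν j k = ν k - j := by
  simp [srcExp, hkl]

omit [Fintype σ] in
/-- Value of `srcExp` off `k, l`. [folklore] -/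
private theorem srcExp_apply_ne {k l i : σ} (hik : i ≠ k) (hil : i ≠ l) (ν : σ →₀ ℕ) (j : ℕ) :
    srcExp k l ν j i = ν i := by
  simp [srcExp, hik, hil]

omit [Fintype σ] in
/-- `srcExp l k` undoes `srcExp k l`. [folklore] -/
private theorem srcExp_srcExp {k l : σ} (hkl : k ≠ l) (ν : σ →₀ ℕ) {j : ℕ} (hj : j ≤ ν k) :
    srcExp l k (srcExp k l ν j) j = ν := by
  ext i
  by_cases hik : i = k
  · subst hik
    rw [srcExp_apply_l, srcExp_apply_k hkl]
    omega
  · by_cases hil : i = l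
    · subst hil
      rw [srcExp_apply_k (Ne.symm hkl), srcExp_apply_l]
      omega
    · rw [srcExp_apply_ne hil hik, srcExp_apply_ne hik hil]

omit [Fintype σ] in
/-- Inversion of `srcExp`. [folklore] -/
private theorem eq_srcExp_of_srcExp_eq {k l : σ} (hkl : k ≠ l) {μ ν : σ →₀ ℕ} {i : ℕ} (hi : i ≤ μ l)
    (h : srcExp l k μ i = ν) : μ = srcExp k l ν i ∧ i ≤ ν k := by
  have hk : ν k = μ k + i := by rw [← h, srcExp_apply_l]
  have hl : ν l = μ l - i := by rw [← h, srcExp_apply_k (Ne.symm hkl)]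
  refine ⟨?_, by omega⟩
  ext x
  by_cases hxl : x = l
  · subst hxl; rw [srcExp_apply_l, hl]; omega
  · by_cases hxk : x = k
    · subst hxk; rw [srcExp_apply_k hkl, hk]; omega
    · rw [srcExp_apply_ne hxk hxl, ← h, srcExp_apply_ne hxl hxk]

/-- The monomial `Π_{i ≠ l} X_i^{μ_i}` is `monomial (μ.erase l) 1`. [folklore] -/
private theorem prod_erase_X_pow (l : σ) (μ : σ →₀ ℕ) :
    ∏ i ∈ Finset.univ.erase l, (X i : MvPolynomial σ R) ^ (μ i) = monomial (μ.erase l) 1 := by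
  rw [monomial_eq, C_1, one_mul, Finsupp.prod_fintype _ _ (fun i => pow_zero _),
    ← Finset.mul_prod_erase Finset.univ _ (Finset.mem_univ l), Finsupp.erase_same, pow_zero,
    one_mul]
  refine Finset.prod_congr rfl fun i hi => ?_
  rw [Finsupp.erase_ne (Finset.ne_of_mem_erase hi)]

/-- **Elementary substitution of a monomial**: `x^μ ↦ Σ_i C(μ_l, i) t^i x^{μ - i e_l + i e_k}`.
[folklore] -/
private theorem elemSubst_monomial {k l : σ} (hkl : k ≠ l) (t : R) (μ : σ →₀ ℕ) (a : R) :
    elemSubst k l t (monomial μ a) = ∑ i ∈ Finset.range (μ l + 1),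
      C (a * ((μ l).choose i : R) * t ^ i) * monomial (srcExp l k μ i) 1 := by
  unfold elemSubst
  rw [aeval_monomial, algebraMap_eq, Finsupp.prod_fintype _ _ (fun i => pow_zero _),
    ← Finset.mul_prod_erase Finset.univ _ (Finset.mem_univ l), if_pos rfl,
    Finset.prod_congr rfl (fun i hi => by rw [if_neg (Finset.ne_of_mem_erase hi)]),
    prod_erase_X_pow, add_comm (X l), add_pow, Finset.sum_mul, Finset.mul_sum]
  refine Finset.sum_congr rfl fun i hi => ?_
  have hmono : (X k : MvPolynomial σ R) ^ i * X l ^ (μ l - i) * monomial (μ.erase l) 1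
      = monomial (srcExp l k μ i) 1 := by
    rw [X_pow_eq_monomial, X_pow_eq_monomial, monomial_mul, monomial_mul, mul_one, mul_one]
    refine congrArg (fun e => monomial e (1 : R)) ?_
    ext x
    simp only [Finsupp.add_apply, Finsupp.single_apply]
    by_cases hxk : x = k
    · subst hxk
      rw [srcExp_apply_l, Finsupp.erase_ne hkl, if_pos rfl, if_neg (Ne.symm hkl)]
      omega
    · by_cases hxl : x = l
      · subst hxl
        rw [srcExp_apply_k (Ne.symm hkl), Finsupp.erase_same, if_neg (fun h => hxk h.symm),
          if_pos rfl, zero_add, add_zero]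
      · rw [srcExp_apply_ne hxl hxk, Finsupp.erase_ne hxl, if_neg (fun h => hxk h.symm),
          if_neg (fun h => hxl h.symm), zero_add, zero_add]
  rw [mul_pow, ← map_pow, map_mul, map_mul, map_natCast,
    show C a * (C (t ^ i) * (X k : MvPolynomial σ R) ^ i * X l ^ (μ l - i)
        * ((μ l).choose i : MvPolynomial σ R) * monomial (μ.erase l) 1)
      = C a * ((μ l).choose i : MvPolynomial σ R) * C (t ^ i)
        * (X k ^ i * X l ^ (μ l - i) * monomial (μ.erase l) 1) by ring, hmono]

/-- **Coefficients after an elementary substitution** `X_l ↦ X_l + t X_k`: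
`coeff_ν = Σ_{j ≤ ν_k} C(ν_l + j, j) t^j · coeff_{ν + j e_l - j e_k}`. [folklore] -/
private theorem coeff_elemSubst
    {k l : σ} (hkl : k ≠ l) (t : R) (p : MvPolynomial σ R) (ν : σ →₀ ℕ) :
    coeff ν (elemSubst k l t p) = ∑ j ∈ Finset.range (ν k + 1),
      ((ν l + j).choose j : R) * t ^ j * coeff (srcExp k l ν j) p := by
  refine MvPolynomial.induction_on' p (fun μ a => ?_) (fun p q hp hq => ?_)
  · rw [elemSubst_monomial hkl, coeff_sum]
    simp_rw [coeff_C_mul, coeff_monomial]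
    by_cases hM : ∃ j, j ≤ ν k ∧ μ = srcExp k l ν j
    · obtain ⟨j, hj, rfl⟩ := hM
      rw [Finset.sum_eq_single j, Finset.sum_eq_single j, if_pos (srcExp_srcExp hkl ν hj),
        if_pos rfl, srcExp_apply_l]
      · ring
      · intro j' _ hj'
        rw [if_neg, mul_zero]
        intro h
        have := congrArg (fun f => f l) h
        simp only [srcExp_apply_l] at this
        omega
      · intro h; exfalso; exact h (Finset.mem_range.mpr (by omega))
      · intro i hi hij
        rw [if_neg, mul_zero]
        intro h
        have hi' : i ≤ srcExp k l ν j l := Nat.lt_succ_iff.mp (Finset.mem_range.mp hi)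
        have h2 := (eq_srcExp_of_srcExp_eq hkl hi' h).1
        have := congrArg (fun f => f l) h2
        simp only [srcExp_apply_l] at this
        omega
      · intro h; exfalso; exact h (Finset.mem_range.mpr (by rw [srcExp_apply_l]; omega))
    · rw [Finset.sum_eq_zero, Finset.sum_eq_zero]
      · intro j hj
        rw [if_neg, mul_zero]
        intro h
        exact hM ⟨j, Nat.lt_succ_iff.mp (Finset.mem_range.mp hj), h⟩
      · intro i hi
        rw [if_neg, mul_zero]
        intro h
        have hi' : i ≤ μ l := Nat.lt_succ_iff.mp (Finset.mem_range.mp hi)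
        obtain ⟨h1, h2⟩ := eq_srcExp_of_srcExp_eq hkl hi' h
        exact hM ⟨i, h2, h1⟩
  · simp only [map_add, coeff_add, hp, hq, ← Finset.sum_add_distrib, mul_add]

end ElemSubst

/-! ## Ternary jets along the flag `x ≻ y ≻ z` (`x = X 2`, `y = X 1`, `z = X 0`) -/

section Jets

open BrillResidue

variable {R : Type*} [CommRing R]

/-- The exponent vector of `x^a y^b z^c` (`x = X 2`, `y = X 1`, `z = X 0`). [folklore] -/
def mono (a b c : ℕ) : Fin 3 →₀ ℕ :=
  Finsupp.single 2 a + Finsupp.single 1 b + Finsupp.single 0 c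

/-- `x`-exponent of `mono`. [folklore] -/
@[simp] private theorem mono_apply_two (a b c : ℕ) : mono a b c 2 = a := by simp [mono]
/-- `y`-exponent of `mono`. [folklore] -/
@[simp] private theorem mono_apply_one (a b c : ℕ) : mono a b c 1 = b := by simp [mono]
/-- `z`-exponent of `mono`. [folklore] -/
@[simp] private theorem mono_apply_zero (a b c : ℕ) : mono a b c 0 = c := by simp [mono]

/-- Every exponent vector on `Fin 3` is a `mono`. [folklore] -/
private theorem eq_mono (ν : Fin 3 →₀ ℕ) : ν = mono (ν 2) (ν 1) (ν 0) := by
  ext i; fin_cases i <;> simp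

/-- `srcExp` for the root group `y ↦ y + t z`. [folklore] -/
private theorem srcExp01_mono
    (a b c j : ℕ) : srcExp 0 1 (mono a b c) j = mono a (b + j) (c - j) := by
  ext i
  fin_cases i
  · simp [srcExp_apply_k (show (0 : Fin 3) ≠ 1 by decide)]
  · simp [srcExp_apply_l]
  · simp [srcExp_apply_ne (show (2 : Fin 3) ≠ 0 by decide) (show (2 : Fin 3) ≠ 1 by decide)]

/-- `srcExp` for the root group `x ↦ x + t z`. [folklore] -/
private theorem srcExp02_mono
    (a b c j : ℕ) : srcExp 0 2 (mono a b c) j = mono (a + j) b (c - j) := by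
  ext i
  fin_cases i
  · simp [srcExp_apply_k (show (0 : Fin 3) ≠ 2 by decide)]
  · simp [srcExp_apply_ne (show (1 : Fin 3) ≠ 0 by decide) (show (1 : Fin 3) ≠ 2 by decide)]
  · simp [srcExp_apply_l]

/-- `srcExp` for the root group `x ↦ x + t y`. [folklore] -/
private theorem srcExp12_mono
    (a b c j : ℕ) : srcExp 1 2 (mono a b c) j = mono (a + j) (b - j) c := by
  ext i
  fin_cases i
  · simp [srcExp_apply_ne (show (0 : Fin 3) ≠ 1 by decide) (show (0 : Fin 3) ≠ 2 by decide)]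
  · simp [srcExp_apply_k (show (1 : Fin 3) ≠ 2 by decide)]
  · simp [srcExp_apply_l]

/-- The `Q`-jet of a ternary form `p` of degree `n` along the flag: `q_b = coeff (x^{n-b} y^b) p`
(`p = Q(x,y) + z R(x,y) + z² S(x,y) + O(z³)`). [folklore] -/
def jq (n : ℕ) (p : MvPolynomial (Fin 3) R) : ℕ → R := fun b => coeff (mono (n - b) b 0) p

/-- The `R`-jet: `r_b = coeff (x^{n-1-b} y^b z) p`. [folklore] -/
def jr (n : ℕ) (p : MvPolynomial (Fin 3) R) : ℕ → R := fun b => coeff (mono (n - 1 - b) b 1) p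

/-- The `S`-jet: `s_b = coeff (x^{n-2-b} y^b z²) p`. [folklore] -/
def js (n : ℕ) (p : MvPolynomial (Fin 3) R) : ℕ → R := fun b => coeff (mono (n - 2 - b) b 2) p

/-- The `u`-chart of the transversal quadratic jet `T = R² - 2 Q S`. [folklore] -/
def serT (n : ℕ) (p : MvPolynomial (Fin 3) R) : PowerSeries R :=
  ser (n - 1) (jr n p) ^ 2 - 2 * (ser n (jq n p) * ser (n - 2) (js n p))

/-! ### The root group `y ↦ y + t z` -/

/-- `Q` is unchanged under `y ↦ y + t z`. [folklore] -/
private theorem jq_elemSubst01 (n : ℕ) (t : R) (p : MvPolynomial (Fin 3) R) :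
    jq n (elemSubst 0 1 t p) = jq n p := by
  funext b
  simp only [jq]
  rw [coeff_elemSubst (show (0 : Fin 3) ≠ 1 by decide), mono_apply_zero, Finset.sum_range_one,
    srcExp01_mono, mono_apply_one]
  simp

/-- `R ↦ R + t ∂_y Q` under `y ↦ y + t z`. [folklore] -/
private theorem jr_elemSubst01 (n : ℕ) (t : R) (p : MvPolynomial (Fin 3) R) (b : ℕ) :
    jr n (elemSubst 0 1 t p) b = jr n p b + ((b : R) + 1) * t * jq n p (b + 1) := by
  simp only [jr, jq]
  rw [coeff_elemSubst (show (0 : Fin 3) ≠ 1 by decide), mono_apply_zero, Finset.sum_range_succ,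
    Finset.sum_range_one, srcExp01_mono, srcExp01_mono, mono_apply_one,
    show n - 1 - b = n - (b + 1) by omega]
  simp

/-- `S ↦ S + t ∂_y R + (t²/2) ∂_y² Q` under `y ↦ y + t z`. [folklore] -/
private theorem js_elemSubst01 (n : ℕ) (t : R) (p : MvPolynomial (Fin 3) R) (b : ℕ) :
    js n (elemSubst 0 1 t p) b = js n p b + ((b : R) + 1) * t * jr n p (b + 1)
      + (((b + 2).choose 2 : ℕ) : R) * t ^ 2 * jq n p (b + 2) := by
  simp only [js, jr, jq]
  rw [coeff_elemSubst (show (0 : Fin 3) ≠ 1 by decide), mono_apply_zero, Finset.sum_range_succ,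
    Finset.sum_range_succ, Finset.sum_range_one, srcExp01_mono, srcExp01_mono, srcExp01_mono,
    mono_apply_one, show n - 2 - b = n - 1 - (b + 1) by omega,
    show n - 1 - (b + 1) = n - (b + 2) by omega]
  simp

/-- Series form of the `R`-law: `R̃' = R̃ + t Q̃'` (`∂_y = d/du` in the chart). [folklore] -/
private theorem serR_elemSubst01 {n : ℕ} (hn : 1 ≤ n) (t : R) (p : MvPolynomial (Fin 3) R) :
    ser (n - 1) (jr n (elemSubst 0 1 t p))
      = ser (n - 1) (jr n p) + PowerSeries.C t * PowerSeries.derivative R (ser n (jq n p)) := by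
  ext b
  simp only [coeff_ser, map_add, PowerSeries.coeff_C_mul, PowerSeries.coeff_derivative,
    jr_elemSubst01]
  split_ifs with h1 h2
  · ring
  · omega
  · omega
  · simp

/-- Series form of the `S`-law, doubled: `2S̃' = 2S̃ + 2t R̃' + t² Q̃''`. [folklore] -/
private theorem two_mul_serS_elemSubst01 {n : ℕ} (hn : 2 ≤ n) (t : R) (p : MvPolynomial (Fin 3) R) :
    2 * ser (n - 2) (js n (elemSubst 0 1 t p))
      = 2 * ser (n - 2) (js n p)
        + 2 * PowerSeries.C t * PowerSeries.derivative R (ser (n - 1) (jr n p))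
        + PowerSeries.C (t ^ 2) * PowerSeries.derivative R
            (PowerSeries.derivative R (ser n (jq n p))) := by
  ext b
  have h2 : ((2 : PowerSeries R)) = PowerSeries.C (2 : R) := by
    rw [show (2 : PowerSeries R) = ((2 : ℕ) : PowerSeries R) by norm_cast, natCast_eq_C]; norm_cast
  simp only [h2, map_add, PowerSeries.coeff_C_mul, mul_assoc, PowerSeries.coeff_derivative,
    coeff_ser, js_elemSubst01]
  have hc : (((b + 2).choose 2 : ℕ) : R) * 2 = ((b : R) + 1) * ((b : R) + 2) := by
    have := Nat.add_one_mul_choose_eq (b + 1) 1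
    rw [Nat.choose_one_right] at this
    have h' : ((b + 2).choose 2) * 2 = (b + 2) * (b + 1) := by
      rw [show b + 2 = b + 1 + 1 by ring]; linarith [this]
    have h'' := congrArg (Nat.cast : ℕ → R) h'
    push_cast at h''
    linear_combination h''
  by_cases hb : b ≤ n - 2
  · rw [if_pos hb, if_pos hb, if_pos (by omega), if_pos (by omega),
      show b + 1 + 1 = b + 2 by ring]
    push_cast
    linear_combination (t ^ 2 * jq n p (b + 2)) * hc
  · rw [if_neg hb, if_neg hb, if_neg (by omega), if_neg (by omega)]
    ring

/-- `u`-chart of `∂_y Q` as a degree-`(n-1)` coefficient vector. [folklore] -/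
private theorem ser_coeff_derivative_serQ (n : ℕ) (q : ℕ → R) :
    ser (n - 1) (fun b => PowerSeries.coeff b (PowerSeries.derivative R (ser n q)))
      = PowerSeries.derivative R (ser n q) := by
  apply ser_coeff_eq
  intro b hb
  rw [PowerSeries.coeff_derivative, coeff_ser, if_neg (by omega), zero_mul]

/-- The `T`-law under `y ↦ y + t z`: `T̃' = T̃ + 2t·W_y(Q,R) + t²·W_y(Q, ∂_yQ)`. [folklore] -/
private theorem serT_elemSubst01 {n : ℕ} (hn : 2 ≤ n) (t : R) (p : MvPolynomial (Fin 3) R) :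
    serT n (elemSubst 0 1 t p) = serT n p
      + PowerSeries.C (2 * t) * wronskYSer n (jq n p) (jr n p)
      + PowerSeries.C (t ^ 2) * wronskYSer n (jq n p)
          (fun b => PowerSeries.coeff b (PowerSeries.derivative R (ser n (jq n p)))) := by
  have hS := two_mul_serS_elemSubst01 hn t p
  unfold serT wronskYSer
  rw [ser_coeff_derivative_serQ, jq_elemSubst01, serR_elemSubst01 (by omega),
    show (2 : PowerSeries R) * (ser n (jq n p) * ser (n - 2) (js n (elemSubst 0 1 t p)))
      = ser n (jq n p) * (2 * ser (n - 2) (js n (elemSubst 0 1 t p))) by ring, hS, map_mul,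
    map_pow, map_ofNat]
  ring

variable [Algebra ℚ R]

/-- The Brill-type functional on ternary forms: `F_n(p) = Φ_n(Q; R² - 2QS)`. [folklore] -/
def F3 (n : ℕ) (p : MvPolynomial (Fin 3) R) : R :=
  phiDef n (jq n p) (fun k => PowerSeries.coeff k (serT n p))

/-- **`F_n` is invariant under the root group `y ↦ y + t z`.** [folklore] -/
private theorem F3_elemSubst01 {n : ℕ} (hn : 2 ≤ n) (t : R) (p : MvPolynomial (Fin 3) R) :
    F3 n (elemSubst 0 1 t p) = F3 n p := by
  unfold F3
  rw [serT_elemSubst01 hn, jq_elemSubst01]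
  have h : (fun k => PowerSeries.coeff k (serT n p
        + PowerSeries.C (2 * t) * wronskYSer n (jq n p) (jr n p)
        + PowerSeries.C (t ^ 2) * wronskYSer n (jq n p)
            (fun b => PowerSeries.coeff b (PowerSeries.derivative R (ser n (jq n p))))))
      = (fun k => PowerSeries.coeff k (serT n p))
        + ((fun k => (2 * t) * PowerSeries.coeff k (wronskYSer n (jq n p) (jr n p)))
          + fun k => t ^ 2 * PowerSeries.coeff k (wronskYSer n (jq n p)
            (fun b => PowerSeries.coeff b (PowerSeries.derivative R (ser n (jq n p)))))) := by
    funext k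
    simp only [Pi.add_apply, map_add, PowerSeries.coeff_C_mul]
    ring
  rw [h, phiDef_add_right, phiDef_add_right, phiDef_const_mul_right, phiDef_const_mul_right,
    phiDef_wronskY hn, phiDef_wronskY hn, mul_zero, mul_zero, add_zero, add_zero]

/-! ### The root group `x ↦ x + t z` -/

omit [Algebra ℚ R] in
/-- Coefficients of `Dser m F`: `(m - b) F_b`. [folklore] -/
private theorem coeff_Dser (m : ℕ) (F : PowerSeries R) (b : ℕ) :
    PowerSeries.coeff b (Dser m F) = ((m : R) - b) * PowerSeries.coeff b F := by
  simp only [Dser, map_sub, natCast_eq_C, PowerSeries.coeff_C_mul, coeff_X_mul_derivative]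
  ring

omit [Algebra ℚ R] in
/-- The numeral `2` of `R⟦u⟧` is the constant series `C 2`. [folklore] -/
private theorem two_eq_C : (2 : PowerSeries R) = PowerSeries.C (2 : R) := by
  rw [show (2 : PowerSeries R) = ((2 : ℕ) : PowerSeries R) by norm_cast, natCast_eq_C]
  norm_cast

omit [Algebra ℚ R] in
/-- `Q` is unchanged under `x ↦ x + t z`. [folklore] -/
private theorem jq_elemSubst02 (n : ℕ) (t : R) (p : MvPolynomial (Fin 3) R) :
    jq n (elemSubst 0 2 t p) = jq n p := by
  funext b
  simp only [jq]
  rw [coeff_elemSubst (show (0 : Fin 3) ≠ 2 by decide), mono_apply_zero, Finset.sum_range_one,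
    srcExp02_mono, mono_apply_two]
  simp

omit [Algebra ℚ R] in
/-- `R ↦ R + t ∂ₓ Q` under `x ↦ x + t z` (coefficientwise, `b ≤ n - 1`). [folklore] -/
private theorem jr_elemSubst02
    {n : ℕ} (t : R) (p : MvPolynomial (Fin 3) R) {b : ℕ} (hb : b + 1 ≤ n) :
    jr n (elemSubst 0 2 t p) b = jr n p b + ((n - b : ℕ) : R) * t * jq n p b := by
  simp only [jr, jq]
  rw [coeff_elemSubst (show (0 : Fin 3) ≠ 2 by decide), mono_apply_zero, Finset.sum_range_succ,
    Finset.sum_range_one, srcExp02_mono, srcExp02_mono, mono_apply_two,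
    show n - 1 - b + 1 = n - b by omega]
  simp

omit [Algebra ℚ R] in
/-- `S ↦ S + t ∂ₓ R + (t²/2) ∂ₓ² Q` under `x ↦ x + t z` (coefficientwise, `b ≤ n - 2`).
[folklore] -/
private theorem js_elemSubst02
    {n : ℕ} (t : R) (p : MvPolynomial (Fin 3) R) {b : ℕ} (hb : b + 2 ≤ n) :
    js n (elemSubst 0 2 t p) b = js n p b + ((n - 1 - b : ℕ) : R) * t * jr n p b
      + (((n - b).choose 2 : ℕ) : R) * t ^ 2 * jq n p b := by
  simp only [js, jr, jq]
  rw [coeff_elemSubst (show (0 : Fin 3) ≠ 2 by decide), mono_apply_zero, Finset.sum_range_succ,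
    Finset.sum_range_succ, Finset.sum_range_one, srcExp02_mono, srcExp02_mono, srcExp02_mono,
    mono_apply_two, show n - 2 - b + 1 = n - 1 - b by omega, show n - 2 - b + 2 = n - b by omega]
  simp

omit [Algebra ℚ R] in
/-- Series form of the `R`-law: `R̃' = R̃ + t ∂ₓQ̃`. [folklore] -/
private theorem serR_elemSubst02 {n : ℕ} (hn : 1 ≤ n) (t : R) (p : MvPolynomial (Fin 3) R) :
    ser (n - 1) (jr n (elemSubst 0 2 t p))
      = ser (n - 1) (jr n p) + PowerSeries.C t * Dser n (ser n (jq n p)) := by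
  ext b
  simp only [coeff_ser, map_add, PowerSeries.coeff_C_mul, coeff_Dser]
  by_cases hb : b ≤ n - 1
  · rw [if_pos hb, if_pos hb, if_pos (by omega), jr_elemSubst02 t p (by omega),
      Nat.cast_sub (by omega)]
    ring
  · rw [if_neg hb, if_neg hb]
    by_cases hb' : b ≤ n
    · rw [if_pos hb', show b = n by omega]; ring
    · rw [if_neg hb']; ring

omit [Algebra ℚ R] in
/-- Series form of the `S`-law, doubled: `2S̃' = 2S̃ + 2t ∂ₓR̃ + t² ∂ₓ²Q̃`. [folklore] -/
private theorem two_mul_serS_elemSubst02 {n : ℕ} (hn : 2 ≤ n) (t : R) (p : MvPolynomial (Fin 3) R) :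
    2 * ser (n - 2) (js n (elemSubst 0 2 t p))
      = 2 * ser (n - 2) (js n p)
        + 2 * PowerSeries.C t * Dser (n - 1) (ser (n - 1) (jr n p))
        + PowerSeries.C (t ^ 2) * Dser (n - 1) (Dser n (ser n (jq n p))) := by
  ext b
  have h2 : ((2 : PowerSeries R)) = PowerSeries.C (2 : R) := by
    rw [show (2 : PowerSeries R) = ((2 : ℕ) : PowerSeries R) by norm_cast, natCast_eq_C]; norm_cast
  simp only [h2, map_add, PowerSeries.coeff_C_mul, mul_assoc, coeff_Dser, coeff_ser]
  by_cases hb : b ≤ n - 2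
  · obtain ⟨m, hm⟩ : ∃ m, n = b + m + 2 := ⟨n - b - 2, by omega⟩
    have hc : (((n - b).choose 2 : ℕ) : R) * 2 = ((m : R) + 2) * ((m : R) + 1) := by
      have := Nat.add_one_mul_choose_eq (m + 1) 1
      rw [Nat.choose_one_right] at this
      have h' : (n - b).choose 2 * 2 = (m + 2) * (m + 1) := by
        rw [show n - b = m + 1 + 1 by omega]; linarith [this]
      have h'' := congrArg (Nat.cast : ℕ → R) h'
      push_cast at h''
      exact h''
    rw [if_pos hb, if_pos hb, if_pos (by omega), if_pos (by omega), js_elemSubst02 t p (by omega),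
      show ((n - 1 - b : ℕ) : R) = m + 1 by rw [show n - 1 - b = m + 1 by omega]; push_cast; ring,
      show ((n - 1 : ℕ) : R) = b + m + 1 by rw [show n - 1 = b + m + 1 by omega]; push_cast; ring,
      show ((n : ℕ) : R) = b + m + 2 by rw [hm]; push_cast; ring]
    linear_combination (t ^ 2 * jq n p b) * hc
  · rw [if_neg hb, if_neg hb]
    by_cases hb1 : b ≤ n - 1
    · rw [if_pos hb1, if_pos (by omega), show ((n - 1 : ℕ) : R) = b by
        rw [show n - 1 = b by omega]]
      ring
    · rw [if_neg hb1]
      by_cases hb2 : b ≤ n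
      · rw [if_pos hb2, show (n : R) = b by rw [show n = b by omega]]
        ring
      · rw [if_neg hb2]
        ring

omit [Algebra ℚ R] in
/-- `u`-chart of `∂ₓ Q` as a degree-`(n-1)` coefficient vector. [folklore] -/
private theorem ser_coeff_Dser_serQ (n : ℕ) (q : ℕ → R) :
    ser (n - 1) (fun b => PowerSeries.coeff b (Dser n (ser n q))) = Dser n (ser n q) := by
  apply ser_coeff_eq
  intro b hb
  rw [coeff_Dser, coeff_ser]
  by_cases h : b ≤ n
  · rw [if_pos h, show (n : R) = b by rw [show n = b by omega], sub_self, zero_mul]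
  · rw [if_neg h, mul_zero]

omit [Algebra ℚ R] in
/-- The `T`-law under `x ↦ x + t z`: `T̃' = T̃ + 2t·Wₓ(Q,R) + t²·Wₓ(Q, ∂ₓQ)`. [folklore] -/
private theorem serT_elemSubst02 {n : ℕ} (hn : 2 ≤ n) (t : R) (p : MvPolynomial (Fin 3) R) :
    serT n (elemSubst 0 2 t p) = serT n p
      + PowerSeries.C (2 * t) * wronskXSer n (jq n p) (jr n p)
      + PowerSeries.C (t ^ 2) * wronskXSer n (jq n p)
          (fun b => PowerSeries.coeff b (Dser n (ser n (jq n p)))) := by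
  have hS := two_mul_serS_elemSubst02 hn t p
  unfold serT wronskXSer
  rw [ser_coeff_Dser_serQ, jq_elemSubst02, serR_elemSubst02 (by omega),
    show (2 : PowerSeries R) * (ser n (jq n p) * ser (n - 2) (js n (elemSubst 0 2 t p)))
      = ser n (jq n p) * (2 * ser (n - 2) (js n (elemSubst 0 2 t p))) by ring, hS, map_mul,
    map_pow, map_ofNat]
  ring

/-- **`F_n` is invariant under the root group `x ↦ x + t z`.** [folklore] -/
private theorem F3_elemSubst02 {n : ℕ} (hn : 2 ≤ n) (t : R) (p : MvPolynomial (Fin 3) R) :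
    F3 n (elemSubst 0 2 t p) = F3 n p := by
  unfold F3
  rw [serT_elemSubst02 hn, jq_elemSubst02]
  have h : (fun k => PowerSeries.coeff k (serT n p
        + PowerSeries.C (2 * t) * wronskXSer n (jq n p) (jr n p)
        + PowerSeries.C (t ^ 2) * wronskXSer n (jq n p)
            (fun b => PowerSeries.coeff b (Dser n (ser n (jq n p))))))
      = (fun k => PowerSeries.coeff k (serT n p))
        + ((fun k => (2 * t) * PowerSeries.coeff k (wronskXSer n (jq n p) (jr n p)))
          + fun k => t ^ 2 * PowerSeries.coeff k (wronskXSer n (jq n p)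
            (fun b => PowerSeries.coeff b (Dser n (ser n (jq n p)))))) := by
    funext k
    simp only [Pi.add_apply, map_add, PowerSeries.coeff_C_mul]
    ring
  rw [h, phiDef_add_right, phiDef_add_right, phiDef_const_mul_right, phiDef_const_mul_right,
    phiDef_wronskX hn, phiDef_wronskX hn, mul_zero, mul_zero, add_zero, add_zero]

/-! ### The root group `x ↦ x + t y` (translation of the binary forms `Q, R, S`) -/

omit [Algebra ℚ R] in
/-- A jet coefficient after `x ↦ x + t y` is the corresponding twist coefficient: generic
statement for the exponent pattern `x^{m-b} y^b z^c`. [folklore] -/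
private theorem coeff_mono_elemSubst12 (m c : ℕ) (t : R) (p : MvPolynomial (Fin 3) R) {b : ℕ}
    (hb : b ≤ m) :
    coeff (mono (m - b) b c) (elemSubst 1 2 t p)
      = PowerSeries.coeff b (twist m t (fun l => coeff (mono (m - l) l c) p)) := by
  rw [coeff_elemSubst (show (1 : Fin 3) ≠ 2 by decide), mono_apply_one, mono_apply_two,
    coeff_twist m t _ b hb]
  have h : ∀ j ∈ Finset.range (b + 1),
      ((m - b + j).choose j : R) * t ^ j * coeff (srcExp 1 2 (mono (m - b) b c) j) p
        = (fun l => ((m - l).choose (b - l) : R) * t ^ (b - l) * coeff (mono (m - l) l c) p)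
            (b + 1 - 1 - j) := by
    intro j hj
    have hj' : j ≤ b := Nat.lt_succ_iff.mp (Finset.mem_range.mp hj)
    simp only [srcExp12_mono]
    rw [show b + 1 - 1 - j = b - j by omega, show m - (b - j) = m - b + j by omega,
      show b - (b - j) = j by omega]
  rw [Finset.sum_congr rfl h]
  exact Finset.sum_range_reflect
    (fun l => ((m - l).choose (b - l) : R) * t ^ (b - l) * coeff (mono (m - l) l c) p) (b + 1)

omit [Algebra ℚ R] in
/-- `Q̃' = twist n t q` under `x ↦ x + t y`. [folklore] -/
private theorem serQ_elemSubst12 (n : ℕ) (t : R) (p : MvPolynomial (Fin 3) R) :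
    ser n (jq n (elemSubst 1 2 t p)) = twist n t (jq n p) := by
  ext b
  rw [coeff_ser]
  split_ifs with hb
  · exact coeff_mono_elemSubst12 n 0 t p hb
  · exact (coeff_twist_eq_zero n t _ b (not_le.mp hb)).symm

omit [Algebra ℚ R] in
/-- `R̃' = twist (n-1) t r` under `x ↦ x + t y`. [folklore] -/
private theorem serR_elemSubst12 (n : ℕ) (t : R) (p : MvPolynomial (Fin 3) R) :
    ser (n - 1) (jr n (elemSubst 1 2 t p)) = twist (n - 1) t (jr n p) := by
  ext b
  rw [coeff_ser]
  split_ifs with hb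
  · exact coeff_mono_elemSubst12 (n - 1) 1 t p hb
  · exact (coeff_twist_eq_zero (n - 1) t _ b (not_le.mp hb)).symm

omit [Algebra ℚ R] in
/-- `S̃' = twist (n-2) t s` under `x ↦ x + t y`. [folklore] -/
private theorem serS_elemSubst12 (n : ℕ) (t : R) (p : MvPolynomial (Fin 3) R) :
    ser (n - 2) (js n (elemSubst 1 2 t p)) = twist (n - 2) t (js n p) := by
  ext b
  rw [coeff_ser]
  split_ifs with hb
  · exact coeff_mono_elemSubst12 (n - 2) 2 t p hb
  · exact (coeff_twist_eq_zero (n - 2) t _ b (not_le.mp hb)).symm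

omit [Algebra ℚ R] in
/-- A product of truncated series has no coefficients beyond the sum of the truncation orders.
[folklore] -/
private theorem coeff_ser_mul_ser_eq_zero (m m' : ℕ) (f g : ℕ → R) {j : ℕ} (hj : m + m' < j) :
    PowerSeries.coeff j (ser m f * ser m' g) = 0 := by
  rw [PowerSeries.coeff_mul]
  refine Finset.sum_eq_zero fun x hx => ?_
  have hx' := Finset.mem_antidiagonal.mp hx
  rw [coeff_ser, coeff_ser]
  split_ifs with h1 h2 <;> first | (exfalso; omega) | simp

omit [Algebra ℚ R] in
/-- `T̃ = R̃² - 2Q̃S̃` has degree `≤ 2n - 2`. [folklore] -/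
private theorem ser_coeff_serT {n : ℕ} (hn : 2 ≤ n) (p : MvPolynomial (Fin 3) R) :
    ser (2 * n - 2) (fun k => PowerSeries.coeff k (serT n p)) = serT n p := by
  apply ser_coeff_eq
  intro b hb
  unfold serT
  rw [map_sub, pow_two, coeff_ser_mul_ser_eq_zero _ _ _ _ (by omega), two_eq_C,
    PowerSeries.coeff_C_mul, coeff_ser_mul_ser_eq_zero _ _ _ _ (by omega), mul_zero, sub_zero]

end Jets

section JetsField

open BrillResidue

variable {K : Type*} [Field K] [CharZero K]

omit [CharZero K] in
/-- `T̃' = twist (2n-2) t T` under `x ↦ x + t y` (over a field, via the Möbius substitution).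
[folklore] -/
private theorem serT_elemSubst12 {n : ℕ} (hn : 2 ≤ n) (t : K) (p : MvPolynomial (Fin 3) K) :
    serT n (elemSubst 1 2 t p)
      = twist (2 * n - 2) t (fun k => PowerSeries.coeff k (serT n p)) := by
  have hS := hasSubst_moeb t
  rw [← subst_moeb_ser t (2 * n - 2), ser_coeff_serT hn]
  unfold serT
  rw [serQ_elemSubst12, serR_elemSubst12, serS_elemSubst12, ← subst_moeb_ser t n,
    ← subst_moeb_ser t (n - 1), ← subst_moeb_ser t (n - 2), PowerSeries.subst_sub hS,
    PowerSeries.subst_pow hS, PowerSeries.subst_mul hS, PowerSeries.subst_mul hS,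
    two_eq_C, subst_moeb_C]
  obtain ⟨m, rfl⟩ : ∃ m, n = m + 2 := ⟨n - 2, by omega⟩
  rw [show m + 2 - 1 = m + 1 by omega, show m + 2 - 2 = m by omega,
    show 2 * (m + 2) - 2 = 2 * m + 2 by omega]
  ring

/-- **`F_n` is invariant under the root group `x ↦ x + t y`.** [folklore] -/
private theorem F3_elemSubst12 {n : ℕ} (hn : 2 ≤ n) (t : K) (p : MvPolynomial (Fin 3) K) :
    F3 n (elemSubst 1 2 t p) = F3 n p := by
  unfold F3
  rw [serT_elemSubst12 hn,
    phiDef_congr hn (q' := fun k => PowerSeries.coeff k (twist n t (jq n p)))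
      (g' := fun k => PowerSeries.coeff k (twist (2 * n - 2) t
        (fun k => PowerSeries.coeff k (serT n p))))
      (fun b hb => by rw [← serQ_elemSubst12, coeff_ser, if_pos hb]) (fun k _ => rfl),
    phiDef_twist hn]

end JetsField

/-! ## The diagonal torus -/

section Torus

variable {σ R : Type*} [Fintype σ] [DecidableEq σ] [CommRing R]

/-- The diagonal substitution `X_i ↦ d_i X_i`. [folklore] -/
def diagSubst (d : σ → R) : MvPolynomial σ R →ₐ[R] MvPolynomial σ R :=
  aeval fun i => C (d i) * X i

omit [DecidableEq σ] in
/-- The diagonal substitution on a monomial: `x^μ ↦ (Π d_i^{μ_i}) x^μ`. [folklore] -/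
private theorem diagSubst_monomial (d : σ → R) (μ : σ →₀ ℕ) (a : R) :
    diagSubst d (monomial μ a) = monomial μ (a * ∏ i, d i ^ μ i) := by
  unfold diagSubst
  rw [aeval_monomial, algebraMap_eq, Finsupp.prod_fintype _ _ (fun i => pow_zero _),
    monomial_eq, Finsupp.prod_fintype _ _ (fun i => pow_zero _), map_mul, map_prod]
  simp only [mul_pow, map_pow, Finset.prod_mul_distrib]
  ring

/-- **Coefficients after the diagonal substitution**: `coeff_μ (D p) = (Π d_i^{μ_i}) coeff_μ p`.
[folklore] -/
private theorem coeff_diagSubst (d : σ → R) (p : MvPolynomial σ R) (μ : σ →₀ ℕ) :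
    coeff μ (diagSubst d p) = (∏ i, d i ^ μ i) * coeff μ p := by
  refine MvPolynomial.induction_on' p (fun ν a => ?_) (fun p q hp hq => ?_)
  · rw [diagSubst_monomial, coeff_monomial, coeff_monomial]
    split_ifs with h
    · rw [h]; ring
    · rw [mul_zero]
  · rw [map_add, coeff_add, coeff_add, hp, hq, mul_add]

end Torus

section TorusField

open BrillResidue

variable {K : Type*} [Field K] [CharZero K]

omit [CharZero K] in
/-- `c^m c⁻ᵇ = c^{m-b}` for `b ≤ m`, `c ≠ 0`. [folklore] -/
private theorem pow_mul_inv_pow {c : K} (hc : c ≠ 0) {m b : ℕ} (hb : b ≤ m) :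
    c ^ m * c⁻¹ ^ b = c ^ (m - b) := by
  obtain ⟨j, rfl⟩ := Nat.exists_eq_add_of_le hb
  rw [Nat.add_sub_cancel_left, pow_add, show c ^ b * c ^ j * c⁻¹ ^ b = c ^ j * (c * c⁻¹) ^ b by
    ring, mul_inv_cancel₀ hc, one_pow, mul_one]

omit [CharZero K] in
/-- The `u`-chart of a jet slice `x^{m-b} y^b z^c` after the torus `diag(d₀, d₁, d₂)`:
`C(d₀^c d₂^m) · rescale (d₁/d₂)`. [folklore] -/
private theorem ser_torus_slice
    (d : Fin 3 → K) (hd : d 2 ≠ 0) (m c : ℕ) (p : MvPolynomial (Fin 3) K) :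
    ser m (fun b => coeff (mono (m - b) b c) (diagSubst d p))
      = PowerSeries.C (d 0 ^ c * d 2 ^ m)
        * PowerSeries.rescale (d 1 * (d 2)⁻¹) (ser m (fun b => coeff (mono (m - b) b c) p)) := by
  rw [← ser_scale]
  ext b
  simp only [coeff_ser]
  split_ifs with hb
  · rw [coeff_diagSubst, Fin.prod_univ_three, mono_apply_zero, mono_apply_one, mono_apply_two,
      mul_pow, show d 0 ^ c * d 2 ^ m * (d 1 ^ b * (d 2)⁻¹ ^ b)
        = d 0 ^ c * d 1 ^ b * (d 2 ^ m * (d 2)⁻¹ ^ b) by ring, pow_mul_inv_pow hd hb]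
  · rfl

omit [CharZero K] in
/-- The `T`-law under the torus: `T̃' = C(d₀² d₂^{2n-2}) · rescale (d₁/d₂) T̃`. [folklore] -/
private theorem serT_diagSubst {n : ℕ} (hn : 2 ≤ n) (d : Fin 3 → K) (hd : d 2 ≠ 0)
    (p : MvPolynomial (Fin 3) K) :
    serT n (diagSubst d p) = PowerSeries.C (d 0 ^ 2 * d 2 ^ (2 * n - 2))
      * PowerSeries.rescale (d 1 * (d 2)⁻¹) (serT n p) := by
  unfold serT jq jr js
  rw [ser_torus_slice d hd n 0, ser_torus_slice d hd (n - 1) 1, ser_torus_slice d hd (n - 2) 2]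
  obtain ⟨m, rfl⟩ : ∃ m, n = m + 2 := ⟨n - 2, by omega⟩
  rw [show m + 2 - 1 = m + 1 by omega, show m + 2 - 2 = m by omega,
    show 2 * (m + 2) - 2 = 2 * m + 2 by omega]
  simp only [map_sub, map_mul, map_pow, map_ofNat, pow_zero, pow_one, one_mul]
  ring

/-- **Torus covariance of `F_n`**: `F_n(D p) = d₂^{n²-2} d₁^n d₀² · F_n(p)`. [folklore] -/
private theorem F3_diagSubst {n : ℕ} (hn : 2 ≤ n) (d : Fin 3 → K) (hd : d 2 ≠ 0)
    (p : MvPolynomial (Fin 3) K) :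
    F3 n (diagSubst d p) = d 2 ^ (n ^ 2 - 2) * d 1 ^ n * d 0 ^ 2 * F3 n p := by
  unfold F3
  have hq : ∀ b ≤ n, jq n (diagSubst d p) b = d 2 ^ n * (d 1 * (d 2)⁻¹) ^ b * jq n p b := by
    intro b hb
    simp only [jq]
    rw [coeff_diagSubst, Fin.prod_univ_three, mono_apply_zero, mono_apply_one, mono_apply_two,
      mul_pow, show d 2 ^ n * (d 1 ^ b * (d 2)⁻¹ ^ b) = d 1 ^ b * (d 2 ^ n * (d 2)⁻¹ ^ b) by ring,
      pow_mul_inv_pow hd hb]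
    ring
  have hg : ∀ k, PowerSeries.coeff k (serT n (diagSubst d p))
      = (d 0 ^ 2 * d 2 ^ (2 * n - 2)) * (d 1 * (d 2)⁻¹) ^ k * PowerSeries.coeff k (serT n p) := by
    intro k
    rw [serT_diagSubst hn d hd, PowerSeries.coeff_C_mul, PowerSeries.coeff_rescale]
    ring
  rw [phiDef_congr hn (q' := fun b => d 2 ^ n * (d 1 * (d 2)⁻¹) ^ b * jq n p b)
      (g' := fun k => (d 0 ^ 2 * d 2 ^ (2 * n - 2)) * (d 1 * (d 2)⁻¹) ^ k
        * PowerSeries.coeff k (serT n p)) hq (fun k _ => hg k),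
    phiDef_scale hn]
  obtain ⟨m, rfl⟩ : ∃ m, n = m + 2 := ⟨n - 2, by omega⟩
  have h1 : (m + 2) ^ 2 - 2 = m ^ 2 + 4 * m + 2 := by
    rw [show (m + 2) ^ 2 = m ^ 2 + 4 * m + 2 + 2 by ring, Nat.add_sub_cancel]
  rw [show m + 2 - 1 = m + 1 by omega, show 2 * (m + 2) - 2 = 2 * m + 2 by omega, h1,
    show (d 2 ^ (m + 2)) ^ (m + 1) * (d 0 ^ 2 * d 2 ^ (2 * m + 2)) * (d 1 * (d 2)⁻¹) ^ (m + 2)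
      = d 2 ^ (m ^ 2 + 4 * m + 2) * d 1 ^ (m + 2) * d 0 ^ 2 * (d 2 * (d 2)⁻¹) ^ (m + 2) by ring,
    mul_inv_cancel₀ hd, one_pow, mul_one]

/-! ## Upper-triangular substitutions factor through the torus and the three root groups -/

omit [CharZero K] in
/-- **Factorisation of an upper-triangular substitution** on `k[x,y,z]`:
`A = diag(A₀₀, A₁₁, A₂₂) · E₁₂(c) · E₀₂(b) · E₀₁(a)` with `A₀₁ = A₀₀ a`, `A₀₂ = A₀₀ b`,
`A₁₂ = A₁₁ c`, as substitution homomorphisms. [folklore] -/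
private theorem linSubst_eq_comp_of_upper (A : Matrix (Fin 3) (Fin 3) K) (h10 : A 1 0 = 0)
    (h20 : A 2 0 = 0) (h21 : A 2 1 = 0) {a b c : K} (ha : A 0 1 = A 0 0 * a)
    (hb : A 0 2 = A 0 0 * b) (hc : A 1 2 = A 1 1 * c) :
    linSubst (Fin 3) K A = (diagSubst (fun i => A i i)).comp
      ((elemSubst 1 2 c).comp ((elemSubst 0 2 b).comp (elemSubst 0 1 a))) := by
  apply MvPolynomial.algHom_ext
  intro i
  fin_cases i <;>
    simp [linSubst_X, Fin.sum_univ_three, elemSubst, diagSubst, h10, h20, h21, ha, hb, hc,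
      smul_eq_C_mul, map_mul] <;> ring

/-- **Covariance of `F_n` under upper-triangular substitutions** of `k[x,y,z]`
(`x = X 2 ≻ y = X 1 ≻ z = X 0`): `F_n(A · p) = A₂₂^{n²-2} A₁₁^n A₀₀² · F_n(p)`. [folklore] -/
private theorem F3_linSubst_upper
    {n : ℕ} (hn : 2 ≤ n) (A : Matrix (Fin 3) (Fin 3) K) (h10 : A 1 0 = 0)
    (h20 : A 2 0 = 0) (h21 : A 2 1 = 0) (h00 : A 0 0 ≠ 0) (h11 : A 1 1 ≠ 0) (h22 : A 2 2 ≠ 0)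
    (p : MvPolynomial (Fin 3) K) :
    F3 n (linSubst (Fin 3) K A p) = A 2 2 ^ (n ^ 2 - 2) * A 1 1 ^ n * A 0 0 ^ 2 * F3 n p := by
  rw [linSubst_eq_comp_of_upper A h10 h20 h21 (a := A 0 1 / A 0 0) (b := A 0 2 / A 0 0)
    (c := A 1 2 / A 1 1) (by field_simp) (by field_simp) (by field_simp)]
  simp only [AlgHom.comp_apply]
  rw [F3_diagSubst hn (fun i => A i i) h22, F3_elemSubst12 hn, F3_elemSubst02 hn,
    F3_elemSubst01 hn]

end TorusField

/-! ## The highest weight vector of `k[Sym^n k³]` of weight `(n²-2, n, 2)*` -/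

section HWV

open BrillResidue TableauEval
open _root_.Literature.NumberTheory.DiophantineGeometry

/-- Degree of `mono a b c`. [folklore] -/
private theorem degree_mono (a b c : ℕ) : (mono a b c).degree = a + b + c := by
  simp only [mono, map_add, Finsupp.degree_single]

section Natural

variable {R S : Type*} [CommRing R] [CommRing S] [Algebra ℚ R] [Algebra ℚ S]

omit [Algebra ℚ R] [Algebra ℚ S] in
/-- `serT` commutes with a change of coefficient ring. [folklore] -/
private theorem map_serT (φ : R →+* S) (n : ℕ) (p : MvPolynomial (Fin 3) R) :
    PowerSeries.map φ (serT n p) = serT n (MvPolynomial.map φ p) := by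
  have hq : (φ : R → S) ∘ jq n p = jq n (MvPolynomial.map φ p) := by
    funext b; simp [jq, coeff_map]
  have hr : (φ : R → S) ∘ jr n p = jr n (MvPolynomial.map φ p) := by
    funext b; simp [jr, coeff_map]
  have hs : (φ : R → S) ∘ js n p = js n (MvPolynomial.map φ p) := by
    funext b; simp [js, coeff_map]
  unfold serT
  simp only [map_sub, map_mul, map_pow, map_ser, map_ofNat, hq, hr, hs]

/-- `F_n` commutes with a change of coefficient ring (it is a polynomial with rational
coefficients in the coefficients of `p`). [folklore] -/
private theorem map_F3 (φ : R →+* S) (n : ℕ) (p : MvPolynomial (Fin 3) R) :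
    φ (F3 n p) = F3 n (MvPolynomial.map φ p) := by
  unfold F3
  have h1 : (φ : R → S) ∘ jq n p = jq n (MvPolynomial.map φ p) := by
    funext b; simp [jq, coeff_map]
  have h2 : (φ : R → S) ∘ (fun k => PowerSeries.coeff k (serT n p))
      = fun k => PowerSeries.coeff k (serT n (MvPolynomial.map φ p)) := by
    funext k; rw [Function.comp_apply, ← PowerSeries.coeff_map, map_serT]
  rw [map_phiDef, h1, h2]

omit [Algebra ℚ S] in
/-- `F_n` only reads the degree-`n` coefficients. [folklore] -/
private theorem F3_congr {n : ℕ} (hn : 2 ≤ n) {p p' : MvPolynomial (Fin 3) R}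
    (h : ∀ ν : Fin 3 →₀ ℕ, ν.degree = n → coeff ν p = coeff ν p') : F3 n p = F3 n p' := by
  have hq : ser n (jq n p) = ser n (jq n p') := by
    ext b; simp only [coeff_ser, jq]; split_ifs with hb
    · exact h _ (by rw [degree_mono]; omega)
    · rfl
  have hr : ser (n - 1) (jr n p) = ser (n - 1) (jr n p') := by
    ext b; simp only [coeff_ser, jr]; split_ifs with hb
    · exact h _ (by rw [degree_mono]; omega)
    · rfl
  have hs : ser (n - 2) (js n p) = ser (n - 2) (js n p') := by
    ext b; simp only [coeff_ser, js]; split_ifs with hb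
    · exact h _ (by rw [degree_mono]; omega)
    · rfl
  have hT : serT n p = serT n p' := by unfold serT; rw [hq, hr, hs]
  unfold F3
  rw [hT]
  exact phiDef_congr hn (fun b hb => h _ (by rw [degree_mono]; omega)) (fun _ _ => rfl)

end Natural

variable {K : Type*} [Field K] [CharZero K]

variable (K) in
/-- The universal ternary form of degree `n`: `Σ_d X_d · x^d` over the coordinate ring
`k[X_d : |d| = n]` of `Sym^n k³`. [folklore] -/
def univForm (n : ℕ) : MvPolynomial (Fin 3) (MvPolynomial (DegIdx (Fin 3) n) K) :=
  ∑ d : DegIdx (Fin 3) n, monomial d.1 (X d)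

variable (K) in
/-- **The Brill-type highest weight vector** `F_n ∈ k[Sym^n k³]_{n+1}`: `F_n` of the universal
form. [folklore] -/
def F3poly (n : ℕ) : MvPolynomial (DegIdx (Fin 3) n) K := F3 n (univForm K n)

omit [CharZero K] in
/-- Specialising the universal form at a coefficient vector gives `formOf`. [folklore] -/
private theorem map_univForm {n : ℕ} (c : DegIdx (Fin 3) n → K) :
    MvPolynomial.map (aeval c).toRingHom (univForm K n) = formOf c := by
  simp only [univForm, formOf, map_sum, map_monomial, AlgHom.toRingHom_eq_coe, RingHom.coe_coe,
    aeval_X]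

/-- Evaluating `F3poly` at a coefficient vector `c` is `F_n` of the form `Σ c_d x^d`. [folklore] -/
private theorem aeval_F3poly {n : ℕ} (c : DegIdx (Fin 3) n → K) :
    aeval c (F3poly K n) = F3 n (formOf c) := by
  rw [F3poly, ← map_univForm c, ← map_F3]
  rfl

/-- Evaluating `F3poly` at the coefficient vector of any `h` is `F_n(h)`. [folklore] -/
private theorem aeval_formCoeff_F3poly {n : ℕ} (hn : 2 ≤ n) (h : MvPolynomial (Fin 3) K) :
    aeval (formCoeff n h) (F3poly K n) = F3 n h := by
  rw [aeval_F3poly]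
  apply F3_congr hn
  intro ν hν
  have := congrFun (formCoeff_formOf (formCoeff n h)) ⟨ν, mem_degMonomials_iff.mpr hν⟩
  rw [formCoeff_apply, formCoeff_apply] at this
  exact this

/-- The weight `(-2, -n, -(n²-2))` of `GL₃` on the coordinates `(z, y, x) = (X 0, X 1, X 2)`:
the dual `λ*` of `λ = (n²-2, n, 2)`. [folklore] -/
def chi3 (n : ℕ) : Weight (Fin 3) := ![-2, -(n : ℤ), -((n ^ 2 - 2 : ℕ) : ℤ)]

omit [CharZero K] in
/-- The weight character of `chi3 n` on an upper-triangular `g` in terms of the diagonal of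
`g⁻¹`. [folklore] -/
private theorem weightChar_chi3 (n : ℕ) {g : GL (Fin 3) K} (hg : IsUpperTriangular g) :
    weightChar (chi3 n) g = ((g⁻¹ : GL (Fin 3) K) : Matrix (Fin 3) (Fin 3) K) 2 2 ^ (n ^ 2 - 2)
      * ((g⁻¹ : GL (Fin 3) K) : Matrix (Fin 3) (Fin 3) K) 1 1 ^ n
      * ((g⁻¹ : GL (Fin 3) K) : Matrix (Fin 3) (Fin 3) K) 0 0 ^ 2 := by
  simp only [weightChar, chi3, Fin.prod_univ_three, Matrix.cons_val_zero, Matrix.cons_val_one,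
    Matrix.cons_val_two, Matrix.head_cons, Matrix.tail_cons,
    inv_apply_diag_of_isUpperTriangular' hg,
    zpow_neg, zpow_natCast, zpow_ofNat]
  simp only [← inv_pow]
  ring

/-- **`F3poly` is a highest weight vector of weight `(n²-2, n, 2)*`** of the coordinate ring
`k[Sym^n k³]` (degree `n + 1`, i.e. it lies in `Sym^{n+1}(Sym^n k³)*`). [folklore] -/
private theorem F3poly_mem_highestWeightSpace {n : ℕ} (hn : 2 ≤ n) :
    F3poly K n ∈ highestWeightSpace (coordRep (Fin 3) K n) (chi3 n) := by
  intro g hg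
  apply MvPolynomial.funext
  intro c
  change aeval c (coordRep (Fin 3) K n g (F3poly K n))
    = aeval c (weightChar (chi3 n) g • F3poly K n)
  have hc : c = formCoeff n (formOf c) := (formCoeff_formOf c).symm
  rw [map_smul, smul_eq_mul, hc, coordRep_apply, aeval_formCoeff_coordSubst,
    aeval_formCoeff_F3poly hn, aeval_formCoeff_F3poly hn, linSubstRep_apply, weightChar_chi3 n hg]
  have hg' : IsUpperTriangular g⁻¹ := (borelSubgroup (Fin 3) K).inv_mem hg
  exact F3_linSubst_upper hn _ (hg'.apply_eq_zero (by decide)) (hg'.apply_eq_zero (by decide))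
    (hg'.apply_eq_zero (by decide)) (diag_ne_zero_of_isUpperTriangular hg' 0)
    (diag_ne_zero_of_isUpperTriangular hg' 1) (diag_ne_zero_of_isUpperTriangular hg' 2) _

end HWV

/-! ## Nonvanishing: `F_n(xⁿ - yⁿ + x^{n-2} z²) ≠ 0` -/

section Witness

open BrillResidue TableauEval

variable {K : Type*} [Field K] [CharZero K]

/-- `mono` is injective. [folklore] -/
private theorem mono_eq_mono_iff {a b c a' b' c' : ℕ} :
    mono a b c = mono a' b' c' ↔ a = a' ∧ b = b' ∧ c = c' := by
  constructor
  · intro h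
    exact ⟨by simpa using congrArg (fun f => f 2) h, by simpa using congrArg (fun f => f 1) h,
      by simpa using congrArg (fun f => f 0) h⟩
  · rintro ⟨rfl, rfl, rfl⟩; rfl

variable (K) in
/-- The witness form `W_n = xⁿ - yⁿ + x^{n-2} z²`. [folklore] -/
def witnessForm (n : ℕ) : MvPolynomial (Fin 3) K :=
  monomial (mono n 0 0) 1 - monomial (mono 0 n 0) 1 + monomial (mono (n - 2) 0 2) 1

omit [CharZero K] in
/-- Coefficients of the witness form. [folklore] -/
private theorem coeff_witnessForm (n a b c : ℕ) :
    coeff (mono a b c) (witnessForm K n)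
      = (if mono n 0 0 = mono a b c then 1 else 0) - (if mono 0 n 0 = mono a b c then 1 else 0)
        + (if mono (n - 2) 0 2 = mono a b c then 1 else 0) := by
  simp only [witnessForm, coeff_add, coeff_sub, coeff_monomial]

omit [CharZero K] in
/-- The `Q`-jet of the witness is `xⁿ - yⁿ`. [folklore] -/
private theorem jq_witnessForm {n : ℕ} (hn : 2 ≤ n) : jq n (witnessForm K n) = witnessQ n := by
  funext b
  simp only [jq, witnessQ, coeff_witnessForm, mono_eq_mono_iff]
  by_cases hb0 : b = 0
  · subst hb0; simp; omega
  · by_cases hbn : b = n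
    · subst hbn; simp [hb0]
    · rw [if_neg (by omega), if_neg (by omega), if_neg (by omega), if_neg hb0, if_neg hbn]; ring

omit [CharZero K] in
/-- The `R`-jet of the witness vanishes. [folklore] -/
private theorem jr_witnessForm (n : ℕ) : jr n (witnessForm K n) = fun _ => 0 := by
  funext b
  simp only [jr, coeff_witnessForm, mono_eq_mono_iff]
  rw [if_neg (by omega), if_neg (by omega), if_neg (by omega)]; ring

omit [CharZero K] in
/-- The `S`-jet of the witness is `x^{n-2}`. [folklore] -/
private theorem js_witnessForm (n : ℕ) (b : ℕ) :
    js n (witnessForm K n) b = if b = 0 then 1 else 0 := by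
  simp only [js, coeff_witnessForm, mono_eq_mono_iff]
  by_cases hb0 : b = 0
  · subst hb0; simp
  · rw [if_neg (by omega), if_neg (by omega), if_neg (by omega), if_neg hb0]; ring

omit [CharZero K] in
/-- The `T`-jet of the witness is `-2 (xⁿ - yⁿ) x^{n-2}`, i.e. `witnessG`. [folklore] -/
private theorem coeff_serT_witnessForm {n : ℕ} (hn : 2 ≤ n) (k : ℕ) :
    PowerSeries.coeff k (serT n (witnessForm K n)) = witnessG n k := by
  have hS : ser (n - 2) (js n (witnessForm K n)) = 1 := by
    ext b
    rw [coeff_ser, js_witnessForm, PowerSeries.coeff_one]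
    split_ifs <;> first | rfl | omega
  unfold serT
  rw [jr_witnessForm, hS, mul_one, jq_witnessForm hn, show ser (n - 1) (fun _ => (0 : K)) = 0 by
    ext b; simp [coeff_ser], zero_pow two_ne_zero, zero_sub, two_eq_C, map_neg,
    PowerSeries.coeff_C_mul, coeff_ser]
  simp only [witnessQ, witnessG]
  by_cases hk : k ≤ n
  · rw [if_pos hk]
    split_ifs <;> ring
  · rw [if_neg hk, if_neg (by omega), if_neg (by omega)]
    ring

/-- **`F_n` does not vanish at the witness**: `F_n(xⁿ - yⁿ + x^{n-2} z²) ≠ 0`. [folklore] -/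
private theorem F3_witnessForm_ne_zero {n : ℕ} (hn : 2 ≤ n) : F3 n (witnessForm K n) ≠ 0 := by
  unfold F3
  rw [jq_witnessForm hn, show (fun k => PowerSeries.coeff k (serT n (witnessForm K n))) = witnessG n
    from funext (coeff_serT_witnessForm hn)]
  exact phiDef_witness_ne_zero hn

/-- **`F3poly ≠ 0`.** [folklore] -/
private theorem F3poly_ne_zero {n : ℕ} (hn : 2 ≤ n) : F3poly K n ≠ 0 := by
  intro h
  have := aeval_formCoeff_F3poly (K := K) hn (witnessForm K n)
  rw [h, map_zero] at this
  exact F3_witnessForm_ne_zero hn this.symm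

end Witness

/-! ## Vanishing on products of linear forms (the orbit of `x₁ ⋯ x_n`) -/

section Vanishing

open BrillResidue

variable {R : Type*} [CommRing R]

/-- A linear ternary form `α x + β y + γ z`. [folklore] -/
def linForm3 (α β γ : R) : MvPolynomial (Fin 3) R := C α * X 2 + C β * X 1 + C γ * X 0

/-- `linForm3` is homogeneous of degree `1`. [folklore] -/
private theorem isHomogeneous_linForm3 (α β γ : R) : (linForm3 α β γ).IsHomogeneous 1 :=
  (((isHomogeneous_X R 2).C_mul α).add ((isHomogeneous_X R 1).C_mul β)).add
    ((isHomogeneous_X R 0).C_mul γ)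

/-- A product of `N` linear forms is homogeneous of degree `N`. [folklore] -/
private theorem isHomogeneous_prod_linForm3 (α β γ : ℕ → R) (N : ℕ) :
    (∏ i ∈ Finset.range N, linForm3 (α i) (β i) (γ i)).IsHomogeneous N := by
  have h := IsHomogeneous.prod (Finset.range N) (fun i => linForm3 (α i) (β i) (γ i))
    (fun _ => 1) (fun i _ => isHomogeneous_linForm3 (α i) (β i) (γ i))
  simpa using h

/-- Coefficients of `ℓ · p` for a linear form `ℓ`. [folklore] -/
private theorem coeff_linForm3_mul (α β γ : R) (p : MvPolynomial (Fin 3) R) (ν : Fin 3 →₀ ℕ) :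
    coeff ν (linForm3 α β γ * p)
      = α * (if ν 2 ≠ 0 then coeff (ν - Finsupp.single 2 1) p else 0)
        + β * (if ν 1 ≠ 0 then coeff (ν - Finsupp.single 1 1) p else 0)
        + γ * (if ν 0 ≠ 0 then coeff (ν - Finsupp.single 0 1) p else 0) := by
  simp only [linForm3, add_mul, coeff_add, mul_assoc, coeff_C_mul, coeff_X_mul',
    Finsupp.mem_support_iff]

/-- Removing one `x`. [folklore] -/
private theorem mono_sub_single_two
    (a b c : ℕ) : mono a b c - Finsupp.single 2 1 = mono (a - 1) b c := by
  ext i; fin_cases i <;> simp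
/-- Removing one `y`. [folklore] -/
private theorem mono_sub_single_one
    (a b c : ℕ) : mono a b c - Finsupp.single 1 1 = mono a (b - 1) c := by
  ext i; fin_cases i <;> simp
/-- Removing one `z`. [folklore] -/
private theorem mono_sub_single_zero
    (a b c : ℕ) : mono a b c - Finsupp.single 0 1 = mono a b (c - 1) := by
  ext i; fin_cases i <;> simp

/-- Coefficients of `(α + β u) · F`. [folklore] -/
private theorem coeff_lin_mul (α β : R) (F : PowerSeries R) (b : ℕ) :
    PowerSeries.coeff b (lin α β * F)
      = α * PowerSeries.coeff b F + if b = 0 then 0 else β * PowerSeries.coeff (b - 1) F := by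
  cases b with
  | zero =>
    rw [if_pos rfl, add_zero, PowerSeries.coeff_zero_eq_constantCoeff_apply, map_mul,
      constantCoeff_lin, PowerSeries.coeff_zero_eq_constantCoeff_apply]
  | succ b => rw [coeff_succ_lin_mul, if_neg (Nat.succ_ne_zero b), Nat.add_sub_cancel]

/-- A junk-coefficient killer for homogeneous ternary forms. [folklore] -/
private theorem coeff_mono_eq_zero_of_isHomogeneous {p : MvPolynomial (Fin 3) R} {m : ℕ}
    (hp : p.IsHomogeneous m) {a b c : ℕ} (h : a + b + c ≠ m) : coeff (mono a b c) p = 0 :=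
  hp.coeff_eq_zero (by rw [degree_mono]; exact h)

/-- **`Q`-recurrence**: `Q̃(ℓ·p) = (α + β u) · Q̃(p)`. [folklore] -/
private theorem serQ_linForm3_mul (α β γ : R) (m : ℕ) (p : MvPolynomial (Fin 3) R) :
    ser (m + 1) (jq (m + 1) (linForm3 α β γ * p)) = lin α β * ser m (jq m p) := by
  ext b
  rw [coeff_ser, coeff_lin_mul, coeff_ser, coeff_ser]
  simp only [jq]
  by_cases hb : b ≤ m + 1
  · rw [if_pos hb, coeff_linForm3_mul, mono_apply_two, mono_apply_one, mono_apply_zero,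
      mono_sub_single_two, mono_sub_single_one, if_neg (fun h : (0:ℕ) ≠ 0 => h rfl), mul_zero,
      add_zero]
    by_cases hb0 : b = 0
    · subst hb0
      rw [if_pos (show m + 1 - 0 ≠ 0 by omega), if_neg (fun h : (0:ℕ) ≠ 0 => h rfl),
        if_pos (Nat.zero_le m), if_pos rfl, show m + 1 - 0 - 1 = m - 0 by omega]
      ring
    · rw [if_pos (show b ≠ 0 from hb0), if_neg hb0, if_pos (show b - 1 ≤ m by omega),
        show m - (b - 1) = m + 1 - b by omega]
      by_cases hbm : b ≤ m
      · rw [if_pos (show m + 1 - b ≠ 0 by omega), if_pos hbm, show m + 1 - b - 1 = m - b by omega]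
      · rw [if_neg (show ¬(m + 1 - b ≠ 0) by omega), if_neg hbm]
  · rw [if_neg hb, if_neg (show ¬b ≤ m by omega), if_neg (show ¬b = 0 by omega),
      if_neg (show ¬(b - 1 ≤ m) by omega)]
    ring

/-- **`R`-recurrence**: `R̃(ℓ·p) = (α + β u) · R̃(p) + γ · Q̃(p)` (`p` homogeneous). [folklore] -/
private theorem serR_linForm3_mul (α β γ : R) {m : ℕ} {p : MvPolynomial (Fin 3) R}
    (hp : p.IsHomogeneous m) :
    ser m (jr (m + 1) (linForm3 α β γ * p))
      = lin α β * ser (m - 1) (jr m p) + PowerSeries.C γ * ser m (jq m p) := by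
  ext b
  rw [map_add, PowerSeries.coeff_C_mul, coeff_ser, coeff_lin_mul, coeff_ser, coeff_ser,
    coeff_ser]
  simp only [jr, jq, show m + 1 - 1 - b = m - b by omega]
  by_cases hb : b ≤ m
  · rw [if_pos hb, if_pos hb, coeff_linForm3_mul, mono_apply_two, mono_apply_one, mono_apply_zero,
      mono_sub_single_two, mono_sub_single_one, mono_sub_single_zero,
      if_pos (show (1:ℕ) ≠ 0 by decide), show (1:ℕ) - 1 = 0 from rfl]
    by_cases hb0 : b = 0
    · subst hb0
      rw [if_neg (fun h : (0:ℕ) ≠ 0 => h rfl), if_pos rfl, if_pos (Nat.zero_le _), mul_zero,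
        add_zero, add_zero]
      by_cases hm : m = 0
      · subst hm
        rw [if_neg (by omega), show 0 - 1 - 0 = 0 from rfl,
          coeff_mono_eq_zero_of_isHomogeneous (a := 0) (b := 0) (c := 1) hp (by omega)]
      · rw [if_pos (show m - 0 ≠ 0 by omega), show m - 0 - 1 = m - 1 - 0 by omega]
    · rw [if_pos (show b ≠ 0 from hb0), if_neg hb0, if_pos (show b - 1 ≤ m - 1 by omega),
        show m - 1 - (b - 1) = m - b by omega]
      by_cases hbm : b ≤ m - 1
      · rw [if_pos (show m - b ≠ 0 by omega), if_pos hbm, show m - b - 1 = m - 1 - b by omega]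
      · rw [if_neg (show ¬(m - b ≠ 0) by omega), if_neg hbm]
  · rw [if_neg hb, if_neg hb, if_neg (show ¬b ≤ m - 1 by omega), if_neg (show ¬b = 0 by omega),
      mul_zero]
    by_cases h' : b - 1 ≤ m - 1
    · have hm : m = 0 := by omega
      have hb1 : b = 1 := by omega
      subst hm; subst hb1
      rw [if_pos h']
      simp only [show 0 - 1 - (1 - 1) = 0 from rfl,
        coeff_mono_eq_zero_of_isHomogeneous (a := 0) (b := 0) (c := 1) hp (by omega)]
      ring
    · rw [if_neg h']
      ring

/-- **`S`-recurrence**: `S̃(ℓ·p) = (α + β u) · S̃(p) + γ · R̃(p)` (`p` homogeneous). [folklore] -/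
private theorem serS_linForm3_mul (α β γ : R) {m : ℕ} {p : MvPolynomial (Fin 3) R}
    (hp : p.IsHomogeneous m) :
    ser (m - 1) (js (m + 1) (linForm3 α β γ * p))
      = lin α β * ser (m - 2) (js m p) + PowerSeries.C γ * ser (m - 1) (jr m p) := by
  ext b
  rw [map_add, PowerSeries.coeff_C_mul, coeff_ser, coeff_lin_mul, coeff_ser, coeff_ser,
    coeff_ser]
  simp only [js, jr, show m + 1 - 2 - b = m - 1 - b by omega]
  by_cases hb : b ≤ m - 1
  · rw [if_pos hb, if_pos hb, coeff_linForm3_mul, mono_apply_two, mono_apply_one, mono_apply_zero,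
      mono_sub_single_two, mono_sub_single_one, mono_sub_single_zero,
      if_pos (show (2:ℕ) ≠ 0 by decide), show (2:ℕ) - 1 = 1 from rfl]
    by_cases hb0 : b = 0
    · subst hb0
      rw [if_neg (fun h : (0:ℕ) ≠ 0 => h rfl), if_pos rfl, if_pos (Nat.zero_le _), mul_zero,
        add_zero, add_zero]
      by_cases hm : m - 1 = 0
      · rw [if_neg (by omega), show m - 2 - 0 = 0 by omega,
          coeff_mono_eq_zero_of_isHomogeneous (a := 0) (b := 0) (c := 2) hp (by omega)]
      · rw [if_pos (show m - 1 - 0 ≠ 0 by omega), show m - 1 - 0 - 1 = m - 2 - 0 by omega]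
    · rw [if_pos (show b ≠ 0 from hb0), if_neg hb0, if_pos (show b - 1 ≤ m - 2 by omega),
        show m - 2 - (b - 1) = m - 1 - b by omega]
      by_cases hbm : b ≤ m - 2
      · rw [if_pos (show m - 1 - b ≠ 0 by omega), if_pos hbm,
          show m - 1 - b - 1 = m - 2 - b by omega]
      · rw [if_neg (show ¬(m - 1 - b ≠ 0) by omega), if_neg hbm]
  · rw [if_neg hb, if_neg hb, if_neg (show ¬b ≤ m - 2 by omega), if_neg (show ¬b = 0 by omega),
      mul_zero]
    by_cases h' : b - 1 ≤ m - 2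
    · have hb1 : b = 1 := by omega
      subst hb1
      rw [if_pos h']
      simp only [show m - 2 - (1 - 1) = 0 by omega, show 1 - 1 = 0 from rfl,
        coeff_mono_eq_zero_of_isHomogeneous (a := 0) (b := 0) (c := 2) hp (by omega)]
      ring
    · rw [if_neg h']
      ring

/-- **Jets of a product of linear forms**: `Q̃ = Π M_i` and `T̃ = R̃² - 2Q̃S̃ = Σ γ_i² Π_{j≠i} M_j²`
(`M_i = α_i + β_i u`). [folklore] -/
private theorem jets_prod_linForm3 (α β γ : ℕ → R) : ∀ N : ℕ,
    ser N (jq N (∏ i ∈ Finset.range N, linForm3 (α i) (β i) (γ i)))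
        = ∏ i ∈ Finset.range N, lin (α i) (β i)
      ∧ serT N (∏ i ∈ Finset.range N, linForm3 (α i) (β i) (γ i))
        = ∑ i ∈ Finset.range N, PowerSeries.C (γ i ^ 2)
            * (∏ j ∈ (Finset.range N).erase i, lin (α j) (β j)) ^ 2
  | 0 => by
    constructor
    · ext b
      rw [Finset.prod_range_zero, Finset.prod_range_zero, coeff_ser, PowerSeries.coeff_one]
      simp only [jq, coeff_one]
      by_cases hb : b = 0
      · subst hb; rw [if_pos le_rfl, if_pos rfl, if_pos]; ext i; fin_cases i <;> simp
      · rw [if_neg (by omega), if_neg hb]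
    · rw [Finset.prod_range_zero, Finset.sum_range_zero]
      unfold serT
      have h1 : ser (0 - 1) (jr 0 (1 : MvPolynomial (Fin 3) R)) = 0 := by
        ext b; rw [coeff_ser]; simp only [jr, coeff_one, map_zero]
        split_ifs with h1 h2
        · exfalso; have := congrArg (fun f => f 0) h2; simp at this
        · rfl
        · rfl
      have h2 : ser (0 - 2) (js 0 (1 : MvPolynomial (Fin 3) R)) = 0 := by
        ext b; rw [coeff_ser]; simp only [js, coeff_one, map_zero]
        split_ifs with h1 h2
        · exfalso; have := congrArg (fun f => f 0) h2; simp at this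
        · rfl
        · rfl
      rw [h1, h2]; ring
  | N + 1 => by
    obtain ⟨hQ, hT⟩ := jets_prod_linForm3 α β γ N
    have hP := isHomogeneous_prod_linForm3 α β γ N
    rw [Finset.prod_range_succ_comm]
    refine ⟨by rw [serQ_linForm3_mul, hQ, Finset.prod_range_succ_comm], ?_⟩
    have hT' := hT
    unfold serT at hT' ⊢
    rw [hQ] at hT'
    rw [show N + 1 - 1 = N by omega, show N + 1 - 2 = N - 1 by omega, serR_linForm3_mul _ _ _ hP,
      serS_linForm3_mul _ _ _ hP, serQ_linForm3_mul, hQ, Finset.sum_range_succ,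
      Finset.range_add_one, Finset.erase_insert (Finset.notMem_range_self),
      Finset.sum_congr rfl (fun i hi => by
        rw [Finset.erase_insert_of_ne (fun h => (Finset.mem_range.mp hi).ne h.symm),
          Finset.prod_insert (fun h => Finset.notMem_range_self (Finset.mem_of_mem_erase h))]),
      show ∑ i ∈ Finset.range N, PowerSeries.C (γ i ^ 2)
          * (lin (α N) (β N) * ∏ j ∈ (Finset.range N).erase i, lin (α j) (β j)) ^ 2
        = lin (α N) (β N) ^ 2 * ∑ i ∈ Finset.range N, PowerSeries.C (γ i ^ 2)
          * (∏ j ∈ (Finset.range N).erase i, lin (α j) (β j)) ^ 2 by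
        rw [Finset.mul_sum]; exact Finset.sum_congr rfl (fun i _ => by ring), map_pow]
    linear_combination (lin (α N) (β N)) ^ 2 * hT'

/-- Products of `< b` linear charts have no `u^b` coefficient. [folklore] -/
private theorem coeff_prod_lin_eq_zero (α β : ℕ → R) (s : Finset ℕ) :
    ∀ b, s.card < b → PowerSeries.coeff b (∏ j ∈ s, lin (α j) (β j)) = 0 := by
  induction s using Finset.induction_on with
  | empty =>
    intro b hb
    rw [Finset.prod_empty, PowerSeries.coeff_one, if_neg (by simp at hb; omega)]
  | insert a s ha ih =>
    intro b hb
    rw [Finset.card_insert_of_notMem ha] at hb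
    obtain ⟨b, rfl⟩ : ∃ b', b = b' + 1 := ⟨b - 1, by omega⟩
    rw [Finset.prod_insert ha, coeff_succ_lin_mul, ih _ (by omega), ih _ (by omega), mul_zero,
      mul_zero, add_zero]

variable [Algebra ℚ R]

/-- `Φ_n` is additive in `G` over finite sums. [folklore] -/
private theorem phiDef_sum_right (n : ℕ) (q : ℕ → R) (s : Finset ℕ) (g : ℕ → ℕ → R) :
    phiDef n q (fun k => ∑ i ∈ s, g i k) = ∑ i ∈ s, phiDef n q (g i) := by
  induction s using Finset.induction_on with
  | empty =>
    simp only [Finset.sum_empty]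
    have h := phiDef_const_mul_right n q 0 (fun _ => 0)
    simp only [zero_mul] at h
    exact h
  | insert a s ha ih =>
    rw [Finset.sum_insert ha, ← ih, ← phiDef_add_right]
    congr 1
    funext k
    rw [Finset.sum_insert ha, Pi.add_apply]

/-- **`F_n` vanishes on products of `n` linear forms** (hence on the orbit `GL₃ · `(any product),
and — after killing variables — on `GL_m · x₁⋯x_n`). [folklore] -/
private theorem F3_prod_linForm3 {n : ℕ} (hn : 2 ≤ n) (α β γ : ℕ → R) :
    F3 n (∏ i ∈ Finset.range n, linForm3 (α i) (β i) (γ i)) = 0 := by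
  obtain ⟨hQ, hT⟩ := jets_prod_linForm3 α β γ n
  unfold F3
  rw [hT, show (fun k => PowerSeries.coeff k (∑ i ∈ Finset.range n, PowerSeries.C (γ i ^ 2)
      * (∏ j ∈ (Finset.range n).erase i, lin (α j) (β j)) ^ 2))
    = fun k => ∑ i ∈ Finset.range n, γ i ^ 2
      * PowerSeries.coeff k ((∏ j ∈ (Finset.range n).erase i, lin (α j) (β j)) ^ 2) by
      funext k; rw [map_sum]; simp only [PowerSeries.coeff_C_mul], phiDef_sum_right]
  refine Finset.sum_eq_zero fun i hi => ?_
  rw [phiDef_const_mul_right]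
  set Ni := ∏ j ∈ (Finset.range n).erase i, lin (α j) (β j) with hNi_def
  have hNi : ser (n - 1) (fun k => PowerSeries.coeff k Ni) = Ni :=
    ser_coeff_eq _ _ (fun b hb => coeff_prod_lin_eq_zero α β _ b
      (by rw [Finset.card_erase_of_mem hi, Finset.card_range]; omega))
  have hq : ∀ b ≤ n, jq n (∏ i ∈ Finset.range n, linForm3 (α i) (β i) (γ i)) b
      = PowerSeries.coeff b (lin (α i) (β i) * ser (n - 1) (fun k => PowerSeries.coeff k Ni)) := by
    intro b hb
    rw [hNi, hNi_def, Finset.mul_prod_erase (Finset.range n) (fun j => lin (α j) (β j)) hi, ← hQ,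
      coeff_ser, if_pos hb]
  rw [phiDef_congr hn hq (g' := fun k => PowerSeries.coeff k
      (ser (n - 1) (fun k => PowerSeries.coeff k Ni) ^ 2)) (fun k _ => by rw [hNi]),
    phiDef_sq_cofactor hn, mul_zero]

end Vanishing

/-! ## Transfer to `m ≥ 3` variables and the discharge of `DIP2020_thm_2_3_1` -/

section Final

open BrillResidue TableauEval
open _root_.Literature.NumberTheory.DiophantineGeometry
open _root_.Literature.Barriers.ValiantsHypothesis (killCompl_X_app killCompl_X_of_not_mem
  sum_eq_sum_app degIdxMap degIdxMap_injective rename_mem_highestWeightSpace_coordRep)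

/-- The sorted parts of DIP's partition `(n²-2, n, 2)`. [folklore] -/
private theorem sortedParts_dipPartition {n : ℕ} (hn : 2 ≤ n) :
    (dipPartition n hn).sortedParts = [n ^ 2 - 2, n, 2] := by
  have hn2 : 2 ≤ n ^ 2 - 2 := by
    have : 2 * 2 ≤ n * n := Nat.mul_le_mul hn hn
    rw [pow_two]; omega
  have hparts : (dipPartition n hn).parts = ↑[n ^ 2 - 2, n, 2] := by
    rw [dipPartition, Nat.Partition.ofSums_parts, Multiset.filter_eq_self.mpr]
    · rfl
    · intro a ha
      simp only [Multiset.insert_eq_cons, Multiset.mem_cons, Multiset.mem_singleton] at ha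
      omega
  change (dipPartition n hn).parts.sort (· ≥ ·) = _
  rw [hparts, Multiset.coe_sort]
  apply List.mergeSort_eq_self
  have h1 : n ≤ n ^ 2 - 2 := by
    have : n * 2 ≤ n * n := Nat.mul_le_mul_left n hn
    rw [pow_two]; omega
  refine List.Pairwise.cons ?_ (List.Pairwise.cons ?_ (List.pairwise_singleton _ _))
  · intro x hx
    simp only [List.mem_cons, List.not_mem_nil, or_false] at hx
    rcases hx with rfl | rfl
    · exact h1
    · exact hn2
  · intro x hx
    simp only [List.mem_cons, List.not_mem_nil, or_false] at hx
    subst hx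
    exact hn

/-- **The weight bookkeeping**: `chi3 n` extended by zero along the top embedding
`Fin 3 ↪ Fin m` is the dual weight `λ*` of `λ = (n²-2, n, 2)`. [folklore] -/
private theorem extend_chi3 {n m : ℕ} (hn : 2 ≤ n) (h3 : 3 ≤ m) :
    Function.extend (topEmb h3) (chi3 n) 0 = Weight.dualOfPartition m (dipPartition n hn) := by
  funext j
  simp only [Weight.dualOfPartition, Weight.dual, Weight.ofPartition_apply,
    sortedParts_dipPartition hn]
  by_cases hj : j ∈ Set.range (topEmb h3)
  · obtain ⟨i, rfl⟩ := hj
    rw [(topEmb_strictMono h3).injective.extend_apply]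
    have hrev : ((Fin.rev (topEmb h3 i) : Fin m) : ℕ) = 2 - (i : ℕ) := by
      rw [Fin.val_rev, topEmb_val]; have := i.isLt; omega
    rw [hrev]
    fin_cases i <;> simp [chi3]
  · rw [Function.extend_apply' _ _ _ (fun ⟨i, hi⟩ => hj ⟨i, hi⟩), Pi.zero_apply,
      List.getD_eq_default _ _ (by
        rw [List.length_cons, List.length_cons, List.length_cons, List.length_nil, Fin.val_rev]
        have := (mem_range_topEmb_iff h3 j).not.mp hj
        omega)]
    simp

/-- **The degree-`n` part of `g · x₁⋯x_n`, restricted to the three top variables, is a product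
of `n` ternary linear forms.** [folklore] -/
private theorem killCompl_linSubstRep_truncatedChowMonomial {n m : ℕ} (h3 : 3 ≤ m) (hnm : n ≤ m)
    (g : GL (Fin m) ℂ) :
    killCompl (topEmb_strictMono h3).injective
        (linSubstRep (Fin m) ℂ g (truncatedChowMonomial ℂ n m hnm))
      = ∏ i ∈ Finset.range n, linForm3
          (if hi : i < n then (g : Matrix (Fin m) (Fin m) ℂ) (topEmb h3 2) (Fin.castLE hnm ⟨i, hi⟩)
            else 0)
          (if hi : i < n then (g : Matrix (Fin m) (Fin m) ℂ) (topEmb h3 1) (Fin.castLE hnm ⟨i, hi⟩)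
            else 0)
          (if hi : i < n then (g : Matrix (Fin m) (Fin m) ℂ) (topEmb h3 0) (Fin.castLE hnm ⟨i, hi⟩)
            else 0) := by
  have hι := (topEmb_strictMono h3).injective
  rw [linSubstRep_apply, truncatedChowMonomial, map_prod, map_prod,
    ← Fin.prod_univ_eq_prod_range (fun i => linForm3 _ _ _) n]
  refine Finset.prod_congr rfl fun i _ => ?_
  rw [linSubst_X, map_sum, sum_eq_sum_app hι _ (fun y hy => by
    rw [map_smul, killCompl_X_of_not_mem hι hy, smul_zero]), Fin.sum_univ_three, map_smul,
    map_smul, map_smul, killCompl_X_app, killCompl_X_app, killCompl_X_app, dif_pos i.isLt,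
    dif_pos i.isLt, dif_pos i.isLt, linForm3, smul_eq_C_mul, smul_eq_C_mul, smul_eq_C_mul,
    Fin.eta]
  ring

end Final

end BrillHWV

/-! ## The discharge -/

section Discharge

open MvPolynomial BrillHWV BrillResidue
open _root_.Literature.NumberTheory.DiophantineGeometry
open _root_.Literature.Barriers.ValiantsHypothesis (degIdxMap degIdxMap_injective
  rename_mem_highestWeightSpace_coordRep)

/-- **Dörfler–Ikenmeyer–Panova 2020, Thm. 2.3 (1), discharged**: for `n ≥ 2`, `m ≥ n + 1` and
`λ = (n²-2, n, 2)`,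
`mult_{λ*} ℂ[GL_m · x₁⋯x_n]_{n+1} < mult_{λ*} ℂ[GL_m · (x₁ⁿ + ⋯ + x_{n+1}ⁿ)]_{n+1}`.
Proof: the right side is the full plethysm coefficient (`DIP2020_prop_3_3_holds`); on the left the
explicit nonzero highest weight vector `F_n` of weight `λ*` lies in the ideal of the orbit (it
vanishes on products of linear forms), so the multiplicity drops (`HwvIdealRankBound`).
[cite: DorflerIkenmeyerPanova2020, Thm. 2.3] -/
theorem DIP2020_thm_2_3_1_holds : DIP2020_thm_2_3_1 := by
  intro n m hn hm
  have h3 : 3 ≤ m := by omega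
  have hι : StrictMono (topEmb h3) := topEmb_strictMono h3
  have hup := isUpperSet_range_topEmb h3
  have hF : rename (degIdxMap hι.injective) (F3poly ℂ n)
      ∈ highestWeightSpace (coordRep (Fin m) ℂ n)
        (Weight.dualOfPartition m (dipPartition n hn)) := by
    rw [← extend_chi3 hn h3]
    exact rename_mem_highestWeightSpace_coordRep hι hup (F3poly_mem_highestWeightSpace hn)
  have hF0 : rename (degIdxMap hι.injective) (F3poly ℂ n) ≠ 0 := fun h =>
    F3poly_ne_zero (K := ℂ) hn (rename_injective _ (degIdxMap_injective hι.injective)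
      (by rw [h, map_zero]))
  have hI : rename (degIdxMap hι.injective) (F3poly ℂ n)
      ∈ orbitVanishingIdeal (truncatedChowMonomial ℂ n m ((Nat.le_succ n).trans hm)) n := by
    rw [mem_orbitVanishingIdeal_iff]
    intro g
    rw [aeval_formCoeff_rename_degIdxMap, aeval_formCoeff_F3poly hn,
      killCompl_linSubstRep_truncatedChowMonomial h3]
    exact F3_prod_linForm3 hn _ _ _
  have hlt := orbitMultiplicity_lt_plethysmCoeff_of_mem_orbitVanishingIdeal (by omega : n ≠ 0)
    hF hI hF0
  rw [orbitMultiplicity_partialPowerSum_dualOfPartition_eq hm (by omega) le_rfl (dipPartition n hn)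
    ((card_parts_dipPartition_le n hn).trans h3)]
  exact hlt

/-- With Thm. 2.3 (1) discharged, DIP's `λ = (n²-2, n, 2)` is a vanishing ideal occurrence
obstruction outright (the tree's `dip2020_isVanishingIdealOccurrenceObstructionAt'` fed with
`DIP2020_thm_2_3_1_holds`). [cite: DorflerIkenmeyerPanova2020, Thm. 2.3] -/
theorem dip2020_isVanishingIdealOccurrenceObstructionAt_holds {n m : ℕ} (hn : 2 ≤ n)
    (hm : n + 1 ≤ m) :
    IsVanishingIdealOccurrenceObstructionAt
      (truncatedChowMonomial ℂ n m ((Nat.le_succ n).trans hm))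
      (partialPowerSum ℂ (n + 1) m n hm) n (Weight.dualOfPartition m (dipPartition n hn)) :=
  dip2020_isVanishingIdealOccurrenceObstructionAt' DIP2020_thm_2_3_1_holds hn hm

end Discharge

end Literature.Computability.AlgebraicComplexity
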